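import Mathlib
import Literature.NumberTheory.LFunctions.Zhang2022.SkeletonPartThree
import Literature.NumberTheory.LFunctions.Zhang2022.TypedSection16A
import HarnessLib

/-!
# Zhang (2022) §16 "Evaluation of `Φ₂`", second half (pp. 92–95, tex L4579–L4689), typed
# statement-exact: Lemma 16.1, (16.13)–(16.16) with the displayed steps between them, Lemma 16.2,
# the residues `𝓡₂*𝓡₂ⱼ`, and the last step to (16.17)

Topic `Literature/NumberTheory/LFunctions/Zhang2022` (Landau–Siegel audit tree; verdict-neutral).
Y. Zhang, *Discrete mean estimates and the Landau–Siegel zero*, arXiv:2211.02515v1 (2022)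
[Zhang2022LandauSiegel], §16, PDF pp. 92–95 (e-print source `lsz3__2_.tex` L4579–L4689) — **an
unrefereed manuscript under adjudication; every `def … : Prop` below is a CLAIM OF THE MANUSCRIPT,
STATED NOT ASSERTED** (campaign D-0069, statement typing; typed ≠ discharged). Nothing in this file
asserts or denies the manuscript's Theorems 1–2 or says anything about Landau–Siegel zeros.

This file types, one declaration per displayed formula (DAG nodes `Z22:Lem16.1` … `Z22:§16.u045` of
`plan/DAG.tsv`; the last node `Z22:(16.17)` IS the banked `Skeleton.Eval1617 c′`, cited not restated),
the second half of §16: the chain by which the manuscript evaluates the sums `𝒮₂ⱼ` of (16.12) and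
then `Φ₂(p)` and `Φ₂`. All of it refines the coarse skeleton node `Skeleton.Ded1617 c′`
("Prop. 14.1 + Lemmas 5.5, 5.8, 15.1 (+ Lemmas 16.1–16.2, App. A) ⇒ (16.17)"), inside which
Lemmas 16.1 and 16.2 were so far folded; here they become the named nodes `Lemma161`, `Lemma162`.

Objects. The skeleton's objects are REUSED by name (`open … Skeleton`): `𝓛 = ell D`, `P = bigP D`,
`α = alpha D`, `T = bigT D`, `β_j = betaJ c′ D j` (`β₁ = beta1`, …), `𝔫(d) = nset d`, `b(n) = bcoef D n`
((15.1)), `𝔮 = frakq D`, `ϱ*ⱼ = varrhoStar c′ χ j`, `ν = nu χ`, `g = gW D`, `g* = gstar D`,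
`𝔞 = frakA χ`, `𝔓 = frakP D`, `p ∼ P` = `primeWindow D`, `𝔢ⱼ = frake j` (`Section18Defs`),
`ω₁ = GaussWeight.omega1 (ell D ^ 30)` ((4.1), §4 p. 17). The objects the FIRST half of §16 introduces
(pp. 89–92) are those of the sibling file `TypedSection16A` (seat L4-t4), used by name
(`open … Typed.Section16A`): `b₁ = b1coef c′ χ` (tex L4433), `κ̃₂ = kappaTilde2`, `λ₂ = lam2`,
`ξ₂ = xi2` (16.7), `λ̃₂ = lamTilde2` (16.8), `𝓜₂(d,l;s) = calM2 c′ χ d l s` (the Euler product of its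
local factors `calM2Factor`; printed series `calM2Series`), `𝓜₂* = calM2star`, `𝒮₂ⱼ = calS2 c′ χ j`
(16.12), `𝓡₂* = calR2star`, `(16.11) = F1611`, `𝓡₂ⱼ = calR2` (the simple-pole residue as a `limUnder`),
`Φ₂(p) = Phi2p` (16.3).

χ-BOOKKEEPING (plan/GAP-LEDGER.md row **G-L4t1-1**; rulings sz-L4-lead 23:41Z, 23:47Z "RULING 8"):
(15.1) prints `B(s,ψ) = Σ b(n)ψχ(n)n^{−s}` with the χ-free `b = Skeleton.bcoef`, but from §15 p. 80 on
the manuscript USES `b` as the `ψ`-coefficient of `B`, i.e. `χ·b`; accordingly `b₁` is, by its defining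
display (§16 p. 89, tex L4433), `Section16A.b1coef c′ χ n = Σ_{n=lm} l^{−β₃}g*(T²/l)·b(m)χ(m)`, and in
the three displays of this file that print a bare `b(m₁m)` (u032, u033, u035) the campaign convention
`b ↦ χ·b` (= `bcoef D k * χ k`) is used and FLAGGED: with (15.1)'s χ-free `b` those printed literals
do not follow (u035 "by Lemma 15.1" then matches Lemma 15.1 in the same χ-twisted reading, not the
banked literal `Skeleton.Lemma151`). This is a reading convention recorded in the gap ledger, not a
repair of the mathematics.

One generic device: `acVal f s` = the value at `s` of an analytic continuation of `f` from `σ > 1` to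
`σ > 9/10` when one exists (unique by the identity theorem), for "the function `𝔲₂ⱼ(s) = [Dirichlet
series formula] is analytic and bounded for `σ > 9/10` … `𝔲₂ⱼ(1) = …`" (Lemma 16.2), whose printed
definition converges only for `σ > 1` while its VALUE at `1` is used.

| DAG node | locator | declaration(s) | kind |
|---|---|---|---|
| `Z22:Lem16.1` | p.92, tex L4579 | `Lemma161` | CLAIM (Lemma; proof = App. A, `TypedAppendixA2`) |
| `Z22:§16.u027` | p.92, tex L4580 | `Step16_u027` | CLAIM (the lemma's display, as a predicate) |
| `Z22:§16.u028` | p.92, tex L4584 | `frakpFactor`, `frakpA`, `frakp` | object (`𝔭`, case `χ(2) ≠ 1`) |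
| `Z22:§16.u029` | p.92, tex L4588 | `frakpB` | object (`𝔭`, case `χ(2) = 1`) |
| `Z22:(16.13)` | p.93, (16.13), tex L4593 | `Inline16_calM2starLarge` ("|𝓜₂*(s)| ≫ 1"), `Eq16_13`; EDGES `inline16_calM2starLarge_of_lemma161`, `eq16_13_of_calM2starLarge`, `eq16_13_of_lemma161` | CLAIM; DISCHARGED from `Lemma161` |
| `Z22:§16.u030` | p.93, tex L4597 | `varpi2` | object (`ϖ₂ⱼ(n)`) |
| `Z22:§16.u031` | p.93, tex L4602 | `Step16_u031` | CLAIM |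
| `Z22:§16.u032` | p.93, tex L4607 | `Step16_u032` (+ `step16_u032_holds`) | CLAIM, DISCHARGED here (χ-twisted reading) |
| `Z22:§16.u033` | p.93, tex L4611 | `Step16_u033` | CLAIM |
| `Z22:§16.u034` | p.93, tex L4615 | `Step16_u034` | CLAIM |
| `Z22:§16.u035` | p.93, tex L4619 | `Step16_u035` | CLAIM ("by Lemma 15.1") |
| `Z22:(16.14)` | p.93, (16.14), tex L4623 | `Eq16_14` | CLAIM |
| `Z22:§16.u036` | p.93, tex L4627 | `Step16_u036` | CLAIM (printed `ϱ₂ⱼ`, glyph drift for `ϖ₂ⱼ`) |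
| `Z22:§16.u037` | p.94, tex L4631 | `Inline16_innerSum1614` ("= 1 + O(1/𝓛⁷)"), `Step16_u037` (as printed), `Step16_u037R` (REPAIRED reading, GAP row G-L4t5-1: error `O(τ₃(n₁)𝓛⁻⁷ + D^{−c})`), `tau3R` | CLAIM (as printed: non-following, G-L4t5-1) |
| `Z22:(16.15)` | p.94, (16.15), tex L4635 | `Inline16_oneConvChiTau2` (+ `_holds`), `nuConvChi`, `Eq16_15`, `Inline16_nsetRemovable`, `Inline16_varpi2WeightSum` (the summed majorant `Σ|ϖ₂ⱼ|τ₃/n₁ ≪ 𝓛⁶`, G-L4t5-1); EDGE `eq16_15_of_repair : Step16_u031 → Step16_u037R → Inline16_varpi2WeightSum → Eq16_15` | CLAIM; the identity DISCHARGED, (16.15) DISCHARGED modulo u031/u037R/the majorant |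
| `Z22:Lem16.2` | p.94, tex L4646 | `Lemma162` (as printed); `Lemma162R`, `normaliserR`, `frakU2SeriesR`, `frakU2R` (REPAIR CANDIDATES of GAP row G-d57-1: normaliser `ζ(s)²ζ(s−β_j)L(s,χ)L(s−β_j,χ)²`; NOT printed) | CLAIM (Lemma; proof = App. A "sketch only"; as printed: GAP candidate G-d57-1) |
| `Z22:§16.u038` | p.94, tex L4647 | `frakU2Series`, `frakU2` | object (`𝔲₂ⱼ(s)`: printed formula; its continuation) |
| `Z22:§16.u039` | p.94, tex L4651 | `frakU2Main`, `Step16_u039` (EDGE `step16_u039_of_lemma162`), `Step16_u039R` (G-d57-1; EDGE `step16_u039R_of_lemma162R`) | CLAIM (`𝔲₂ⱼ(1) = …`), DISCHARGED modulo Lemma 16.2 |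
| `Z22:§16.u040` | p.94, tex L4657 | `integrand16_u040`, `Step16_u040a`, `Step16_u040b`, `Step16_u040`; `integrand16_u040R` (G-d57-1) with `integrand16_u040R_eq` (= the printed integrand on the line `Re s = 1`) | CLAIM |
| `Z22:§16.u041` | p.94, tex L4663 | `Step16_u041a`, `Step16_u041b`, `Step16_u041`; `Step16_u041aR`, `Step16_u041bR` (G-d57-1, TEAM B typed-strength error `O((1+|L′|)³𝓛⁻⁴)`; EDGE `step16_u041bR_of_u039R`) with `sumLtT_eval_of_repair` | CLAIM ("moved … as in Lemma 8.4") |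
| `Z22:§16.u042` | p.94, tex L4667 | `Step16_u042` (as printed, `O(𝓛⁻⁴)`); `Step16_u042R` (the rate that (16.15) transmits: `O((1+|L′|)³/𝓛)`, NOT printed; EDGES `step16_u042R_of_u042`, `step16_u042R_of_repair`) | CLAIM; the transmitted form DISCHARGED modulo (16.15), the `𝔫(𝔮)`-removal, u040, u041aR/bR |
| `Z22:(16.16)` | p.95, (16.16), tex L4671 | `Eq16_16` (as printed); `Eq16_16R` (`O((1+|L′|)³/𝓛)`, NOT printed; EDGES `eq16_16R_of_eq16_16`, `eq16_16R_of`, `eq16_16R_of_lemma161`, `eq16_16R_of_leaves`) | CLAIM; the transmitted form DISCHARGED modulo Lemma 16.1 (PROVED, sz-d57) + u042R |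
| `Z22:§16.u043` | p.95, tex L4675 | `Step16_u043` | CLAIM ("by Lemma 5.8 and direct calculation") |
| `Z22:§16.u044` | p.95, tex L4679 | `Step16_u044` | CLAIM |
| `Z22:§16.u045` | p.95, tex L4683 | `Step16_u045`, `Inline16_ptPowBeta1` ("(pt₀)^{β₁} = −1 + O(α₁)"; `inline16_ptPowBeta1_holds`) | CLAIM; the inline claim DISCHARGED |
| `Z22:(16.17)` | p.95, (16.17), tex L4687 | `Skeleton.Eval1617 c′` (banked p409865) | CLAIM, cited |

Conventions (the skeleton's, `skel/INTERFACE.md` §3; L4 naming v1): every claim sits inside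
`Skeleton.ForAllLarge` with Assumption (A) as antecedent; "`X = Y + O(E)`" ↦ `∃ C, … ‖X − Y‖ ≤ C·E`;
"`≪`" likewise; "`O(D^{−c})`" with an unspecified `c > 0` ↦ `∃ c > 0, ∃ C, …`; "`o(p)`" ↦ `∀ ε > 0, …
≤ ε·p`; `|·|` ↦ `‖·‖`; `τ₂(m)` = `m.divisors.card`; `α₁` (undefined in v1) read as `α𝓛` as in the
skeleton; `j = 1, 2` throughout ((16.10)); `(2πi)⁻¹∫_{(1)} h(s) ds` ↦ `(1/2π)∫_ℝ h(1 + iv) dv` (the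
tree's `GaussWeight.gWeight_eq_verticalIntegral` convention). Finite sums: `b(m) = 0` for `m ≥ PT⁻¹⁰`
(the supports of `ϰ₁·[n<P^{1/2}]`, `ϰ₂`, `ϰ₃`) and `g*(T²/l) = 0` for `l ≥ 2T²`, so `b₁(n) = 0` for
`n ≥ P`; sums "`Σ_n b₁(n)…`" are typed over `1 ≤ n < P` (as `Section16A.calS2`), "`Σ_{(m,𝔮)=1} b(m₁m)…`"
over `1 ≤ m < P` exactly as in `Skeleton.Lemma151`, "`Σ_{(l,𝔮)=1} … g*(T²/(l₁l))`" over `1 ≤ l < 2T²`.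
TRANSCRIBED AS PRINTED; visible print defects are flagged in the docstrings, never repaired
(u035's `O(D^{−c})` vs Lemma 15.1's `O(α₁τ₂(n₁))`; u036's glyph `ϱ₂ⱼ`; Lemma 16.1's unused hypothesis
`dl < PT⁻²`; the rate of "can be removed with an acceptable error" after (16.15); the prefactor of
`𝔲₂ⱼ` in Lemma 16.2, cf. the G-L4t3-1 family).

Kernel-checked here (0 facts): `step16_u032_holds` (the divisor-pair splitting behind u032),
`inline16_oneConvChiTau2_holds` ("`1∗χτ₂ = ν∗χ`"), `half_le_norm_frakp` (`|𝔭| ≥ 1/2` for every real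
`χ`: each Euler factor is `1`, `1 − 1/(q−1)²` or `q²/(q²−1)`, and `∏(1 − 1/n²)` telescopes),
`inline16_calM2starLarge_of_lemma161` (the EDGE "As a direct consequence of Lemma 16.1 we have
`|𝓜₂*(s)| ≫ 1`", with the constant `1/4`), `eq16_13_of_calM2starLarge` / `eq16_13_of_lemma161` (the EDGE "Thus we can write (16.13)": Lemma 16.1 ⇒ (16.13), the division by `𝓜₂*(1−β_j) ≠ 0`), `inline16_ptPowBeta1_holds` ("`(pt₀)^{β₁} = −1 + O(α₁)`", constant `520 + 5|c′|(π+520)`), `frakU2_spec_of_lemma162` (under Lemma 16.2 the object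
`frakU2` IS an analytic continuation of the printed formula), `calS2_sub_main_eq_of_eq16_13` (the exact
algebra of "Inserting this into (16.13)"), `eq16_15_of_repair` (GAP row G-L4t5-1: the `𝒩(𝔮)`-split u031 +
the REPAIRED u037 + the summed majorant `Σ|ϖ₂ⱼ|τ₃/n₁ ≪ 𝓛⁶` ⇒ (16.15) with its printed `O(1/𝓛)`, pure
bookkeeping: `𝓛⁻⁷·𝓛⁶ = 𝓛⁻¹`, `D^{−c}𝓛⁶ ≤ 7!/(c⁷𝓛)`), `acVal_eq_of_continuation` (identity theorem:
`acVal` IS the continuation whenever one exists) with `step16_u039_of_lemma162` (the EDGE Lemma 16.2 ⇒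
u039) and `frakU2_bounded_of_lemma162`, and for the repair candidates of GAP row G-d57-1 (section
"Repair candidates", NOT printed; typed-strength error terms per TEAM B 01:14Z / sz-L4-lead 01:24Z):
`integrand16_u040R_eq` (on `Re s = 1` the repaired (16.u040) integrand equals the printed one — the repair
moves only the residue claim u041a), `step16_u039R_of_lemma162R`, `step16_u041bR_of_u039R` (the exact
(2.31)-algebra, `L′(1,χ)` real), `sumLtT_eval_of_repair` (u040a ∧ u040b ∧ u041aR ∧ u041bR ⇒ the input of
u042 with error `O((1+|L′|)³𝓛⁻⁴)`); `norm_frakp_le_four` (`|𝔭| ≤ 4`); and, for the rate that (16.15)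
transmits (section "The rate that (16.15) transmits", NOT printed): `step16_u042R_of_repair` ((16.15) +
`𝔫(𝔮)`-removal + u040 + u041aR/bR ⇒ u042 with `O((1+|L′|)³/𝓛)`), `eq16_16R_of` ((16.13) + u042R +
Lemma 16.1 ⇒ (16.16) with `O((1+|L′|)³/𝓛)`, using `1/2 ≤ |𝔭| ≤ 4`, `𝔞 ≤ |L′|²`) and the assembled
`eq16_16R_of_leaves` (Lemma 16.1 + (16.15) + removal + u040 + u041aR/bR ⇒ (16.16)R).

What is deliberately NOT here: no new external fact (plan/FACT-LIST.md inputs are not needed: Lemma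
5.8 and Lemma 15.1 are skeleton nodes `Skeleton.Lemma58`, `Skeleton.Lemma151 c′`); the Appendix-A
proofs of Lemmas 16.1–16.2 (tex L5194–L5243) are the sibling file `TypedAppendixA2`.

## References

* Y. Zhang, arXiv:2211.02515v1 (2022), §16 pp. 88–95, (16.1)–(16.17), Lemmas 16.1–16.2; §15
  Lemma 15.1, (15.1)–(15.2), (15.20); §5 Lemma 5.8; §8 Lemma 8.4; §4 (4.1); Appendix A.
  [cite: Zhang2022LandauSiegel, §16]
-/

noncomputable section

open Complex Real ComplexConjugate MeasureTheory Filter Topology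
open Literature.NumberTheory.LFunctions.Zhang2022
open Literature.NumberTheory.LFunctions.Zhang2022.Skeleton
open Literature.NumberTheory.LFunctions.Zhang2022.Typed.Section16A

namespace Literature.NumberTheory.LFunctions.Zhang2022.Typed.Section16B

/-! ## A generic device: values of analytic continuations -/

open scoped Classical in
/-- **`acVal f s`** — the value at `s` of an analytic continuation of `f` from the half-plane
`σ > 1` to the half-plane `σ > 9/10`: if some `U`, complex-differentiable on `{σ > 9/10}`, agrees
with `f` on `{σ > 1}`, then `acVal f s = U s` (any two such `U` agree on the connected open set
`{σ > 9/10}` by the identity theorem, so the value does not depend on the choice); otherwise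
`acVal f s = f s` (junk). This is how "the function `𝔲₂ⱼ(s) = [formula on σ > 1]` is analytic … for
`σ > 9/10` … `𝔲₂ⱼ(1) = …`" (Lemma 16.2) acquires a value at `s = 1`.
[cite: Zhang2022LandauSiegel, §16 Lemma 16.2 p.94] -/
def acVal (f : ℂ → ℂ) (s : ℂ) : ℂ :=
  if h : ∃ U : ℂ → ℂ, DifferentiableOn ℂ U {z : ℂ | 9 / 10 < z.re} ∧ ∀ z : ℂ, 1 < z.re → U z = f z
  then Classical.choose h s else f s

/-- If `f` HAS an analytic continuation to `σ > 9/10`, then `acVal f` is one: differentiable on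
`{σ > 9/10}` and equal to `f` on `{σ > 1}`. [cite: Zhang2022LandauSiegel, §16 Lemma 16.2 p.94] -/
theorem acVal_spec {f : ℂ → ℂ}
    (h : ∃ U : ℂ → ℂ, DifferentiableOn ℂ U {z : ℂ | 9 / 10 < z.re} ∧ ∀ z : ℂ, 1 < z.re → U z = f z) :
    DifferentiableOn ℂ (acVal f) {z : ℂ | 9 / 10 < z.re} ∧ ∀ z : ℂ, 1 < z.re → acVal f z = f z := by
  have hfun : acVal f = Classical.choose h := by
    funext s
    simp only [acVal, dif_pos h]
  rw [hfun]
  exact Classical.choose_spec h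

variable (c' : ℝ)

/-! ## Lemma 16.1 and the Euler product `𝔭` -/

section LemmaSixteenOne

variable {D : ℕ} [NeZero D] (χ : DirichletCharacter ℂ D)

/-- The local factor of `𝔭`: `(1 − χ(q)q⁻¹)⁻¹(1 − χ(q)/(q−1))` (§16 p. 92, tex L4585).
[cite: Zhang2022LandauSiegel, §16 Lemma 16.1 p.92] -/
def frakpFactor (q : ℕ) : ℂ :=
  (1 - χ (q : ZMod D) * (q : ℂ)⁻¹)⁻¹ * (1 - χ (q : ZMod D) / ((q : ℂ) - 1))

/-- **`𝔭 = ∏_q (1 − χ(q)q⁻¹)⁻¹(1 − χ(q)/(q−1))` if `χ(2) ≠ 1`** (§16 p. 92, tex L4584–L4586, DAG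
`Z22:§16.u028`), the product over all primes `q` (an unconditional product over `Nat.Primes`; the
factors are `1 + O(q⁻²)`). [cite: Zhang2022LandauSiegel, §16 Lemma 16.1 p.92] -/
def frakpA : ℂ := ∏' q : Nat.Primes, frakpFactor χ q

/-- **`𝔭 = 2∏_{q>2} (1 − χ(q)q⁻¹)⁻¹(1 − χ(q)/(q−1))` if `χ(2) = 1`** (§16 p. 92, tex L4588–L4590, DAG
`Z22:§16.u029`) (factor `1` at `q = 2` in the product over `Nat.Primes`, as in `Section16A.calM2star`).
[cite: Zhang2022LandauSiegel, §16 Lemma 16.1 p.92] -/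
def frakpB : ℂ := 2 * ∏' q : Nat.Primes, if (q : ℕ) = 2 then 1 else frakpFactor χ q

/-- **`𝔭`** of Lemma 16.1 (§16 p. 92, tex L4583–L4590): `frakpA` if `χ(2) ≠ 1`, `frakpB` if `χ(2) = 1`.
[cite: Zhang2022LandauSiegel, §16 Lemma 16.1 p.92] -/
def frakp : ℂ := if χ (2 : ZMod D) ≠ 1 then frakpA χ else frakpB χ

/-- **The display of Lemma 16.1** (§16 p. 92, tex L4580–L4582, DAG `Z22:§16.u027`):
"`𝓜₂*(s) = 𝔭 + O(1/𝓛⁸)`", as the predicate `‖𝓜₂*(s) − 𝔭‖ ≤ C𝓛⁻⁸` in `s` and the `O`-constant `C`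
(`𝓜₂* = Section16A.calM2star`). [cite: Zhang2022LandauSiegel, §16 Lemma 16.1 p.92] -/
def Step16_u027 (C : ℝ) (s : ℂ) : Prop := ‖calM2star c' χ s - frakp χ‖ ≤ C * (ell D ^ 8)⁻¹

end LemmaSixteenOne

/-- **Lemma 16.1** (§16 p. 92, tex L4579–L4590, DAG `Z22:Lem16.1`; "will be proved in Appendix A"):
"Suppose `dl < PT⁻²` and `|s − 1| < 5α`. Then `𝓜₂*(s) = 𝔭 + O(1/𝓛⁸)` where `𝔭 = …` (two cases)."
FLAG: the hypothesis `dl < PT⁻²` does not enter `𝓜₂*(s)` (typed as printed, as a vacuous binder).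
CLAIM (so far folded inside `Skeleton.Ded1617 c′`). [cite: Zhang2022LandauSiegel, §16 Lemma 16.1 p.92] -/
def Lemma161 : Prop :=
  ∃ C : ℝ, ForAllLarge fun D _ χ => AssumptionA D χ →
    ∀ d l : ℕ, 1 ≤ d → 1 ≤ l → ((d * l : ℕ) : ℝ) < bigP D / bigT D ^ 2 →
      ∀ s : ℂ, ‖s - 1‖ < 5 * alpha D → Step16_u027 c' χ C s

/-! ## (16.13): `ϖ₂ⱼ` and the factorisation of `𝒮₂ⱼ` -/

section SixteenThirteen

variable {D : ℕ} [NeZero D] (χ : DirichletCharacter ℂ D)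

/-- **`ϖ₂ⱼ(n) = Σ_{n=dl} λ₂(d)d^{β_j}χ(l)𝓜₂(d,l;1−β_j)/𝓜₂*(1−β_j)`** (§16 p. 93, tex L4597–L4599, DAG
`Z22:§16.u030`; "Note that `ϖ₂ⱼ(n)` is multiplicative"; `𝓜₂ = Section16A.calM2`,
`𝓜₂* = Section16A.calM2star`). [cite: Zhang2022LandauSiegel, §16 p.93] -/
def varpi2 (j n : ℕ) : ℂ :=
  ∑ x ∈ n.divisorsAntidiagonal,
    lam2 c' χ x.1 1 * (x.1 : ℂ) ^ betaJ c' D j * χ (x.2 : ZMod D) *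
      calM2 c' χ x.1 x.2 (1 - betaJ c' D j) / calM2star c' χ (1 - betaJ c' D j)

/-- **`(ν∗χ)(n) = Σ_{d∣n} ν(d)χ(n/d)`** (§16 p. 94, (16.15); `ν = Skeleton.nu χ = 1∗χ`).
[cite: Zhang2022LandauSiegel, §16 (16.15) p.94] -/
def nuConvChi : ℕ → ℂ := LSeries.convolution (nu χ) fun n => χ (n : ZMod D)

end SixteenThirteen

/-- **"As a direct consequence of Lemma 16.1 we have `|𝓜₂*(s)| ≫ 1` if `|s − 1| < 5α`"** (§16 p. 93,
tex L4592; inline claim preceding (16.13), DAG `Z22:(16.13)`). CLAIM.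
[cite: Zhang2022LandauSiegel, §16 p.93] -/
def Inline16_calM2starLarge : Prop :=
  ∃ c : ℝ, 0 < c ∧ ForAllLarge fun D _ χ => AssumptionA D χ →
    ∀ s : ℂ, ‖s - 1‖ < 5 * alpha D → c ≤ ‖calM2star c' χ s‖

/-- **(16.13)** (§16 p. 93, tex L4593–L4595, DAG `Z22:(16.13)`): "Thus we can write
`𝒮₂ⱼ = 𝓜₂*(1−β_j) Σ_n b₁(n)ϖ₂ⱼ(n)/n`" (`j = 1, 2`; `𝒮₂ⱼ = Section16A.calS2`, the `n`-sum finite,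
`n < P`). CLAIM (refines `Skeleton.Ded1617 c′`). [cite: Zhang2022LandauSiegel, §16 (16.13) p.93] -/
def Eq16_13 : Prop :=
  ForAllLarge fun D _ χ => AssumptionA D χ → ∀ j ∈ ({1, 2} : Finset ℕ),
    calS2 c' χ j = calM2star c' χ (1 - betaJ c' D j) *
      ∑ n ∈ Finset.Ico 1 ⌈bigP D⌉₊, b1coef c' χ n * varpi2 c' χ j n / (n : ℂ)

/-! ## From (16.13) to (16.14): the `𝔫(𝔮)`-decomposition and Lemma 15.1 -/

open scoped Classical in
/-- **§16, display after (16.13)** (§16 p. 93, tex L4602–L4605, DAG `Z22:§16.u031`): "In a way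
similar to the proof of (15.20) we have `Σ_n b₁(n)ϖ₂ⱼ(n)/n =
Σ_{n₁∈𝔫(𝔮), n₁<T} ϖ₂ⱼ(n₁)/n₁ · Σ_{(n,𝔮)=1} b₁(n₁n)ϖ₂ⱼ(n)/n + O(D^{−c})`" (`𝔮 = Skeleton.frakq D`,
`𝔫 = Skeleton.nset`; `c > 0` unspecified). CLAIM. [cite: Zhang2022LandauSiegel, §16 p.93] -/
def Step16_u031 : Prop :=
  ∃ c : ℝ, 0 < c ∧ ∃ C : ℝ, ForAllLarge fun D _ χ => AssumptionA D χ → ∀ j ∈ ({1, 2} : Finset ℕ),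
    ‖(∑ n ∈ Finset.Ico 1 ⌈bigP D⌉₊, b1coef c' χ n * varpi2 c' χ j n / (n : ℂ)) -
        ∑ n₁ ∈ (Finset.Ico 1 ⌈bigT D⌉₊).filter (fun n₁ => n₁ ∈ nset (frakq D)),
          varpi2 c' χ j n₁ / (n₁ : ℂ) *
            ∑ n ∈ (Finset.Ico 1 ⌈bigP D⌉₊).filter (fun n => Nat.Coprime n (frakq D)),
              b1coef c' χ (n₁ * n) * varpi2 c' χ j n / (n : ℂ)‖ ≤
      C * (D : ℝ) ^ (-c)

/-- **§16, second display after (16.13)** (§16 p. 93, tex L4606–L4609, DAG `Z22:§16.u032`): "Assume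
`n₁ ∈ 𝔫(𝔮)` and `n₁ < T`. For `(n,𝔮) = 1` we have
`b₁(n₁n) = Σ_{n₁=l₁m₁} Σ_{n=lm} (l₁l)^{−β₃} g*(T²/(l₁l)) b(m₁m)`." χ-BOOKKEEPING FLAG (G-L4t1-1): with
`b₁ = Section16A.b1coef` (the `ψ`-coefficient of `BN`, which carries `χ(m)`) the bare printed `b(m₁m)` is
typed in the campaign's χ-twisted reading `b(k)χ(k)`; with (15.1)'s χ-free `b` the printed literal does
not follow. CLAIM — and PROVED below (`step16_u032_holds`): it is the splitting of the divisor pairs of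
`n₁n` for the coprime `n₁`, `n`. [cite: Zhang2022LandauSiegel, §16 p.93] -/
def Step16_u032 : Prop :=
  ForAllLarge fun D _ χ => AssumptionA D χ → ∀ n₁ n : ℕ, n₁ ∈ nset (frakq D) → (n₁ : ℝ) < bigT D →
    1 ≤ n → Nat.Coprime n (frakq D) →
      b1coef c' χ (n₁ * n) =
        ∑ x ∈ n₁.divisorsAntidiagonal, ∑ y ∈ n.divisorsAntidiagonal,
          (((x.1 * y.1 : ℕ) : ℂ)) ^ (-beta3 c' D) * (gstar D (bigT D ^ 2 / ((x.1 * y.1 : ℕ) : ℝ)) : ℂ) *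
            (bcoef D (x.2 * y.2) * χ ((x.2 * y.2 : ℕ) : ZMod D))

/-- **§16, third display after (16.13)** (§16 p. 93, tex L4610–L4614, DAG `Z22:§16.u033`): for
`n₁ ∈ 𝔫(𝔮)`, `n₁ < T`: "Hence `Σ_{(n,𝔮)=1} b₁(n₁n)ϖ₂ⱼ(n)/n = Σ_{n₁=l₁m₁} Σ_{(l,𝔮)=1}
ϖ₂ⱼ(l)/(l(l₁l)^{β₃}) g*(T²/(l₁l)) Σ_{(m,𝔮)=1} b(m₁m)ϖ₂ⱼ(m)/m + O(D^{−c})`, since the terms with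
`(l,m) > 1` above contribute `≪ D^{−c}`" (`l < 2T²` and `m < P` by the supports of `g*` and `b`; the
bare `b(m₁m)` in the χ-twisted reading `b(m₁m)χ(m₁m)`, FLAG G-L4t1-1 as in u032). CLAIM.
[cite: Zhang2022LandauSiegel, §16 p.93] -/
def Step16_u033 : Prop :=
  ∃ c : ℝ, 0 < c ∧ ∃ C : ℝ, ForAllLarge fun D _ χ => AssumptionA D χ → ∀ j ∈ ({1, 2} : Finset ℕ),
    ∀ n₁ : ℕ, n₁ ∈ nset (frakq D) → (n₁ : ℝ) < bigT D →
      ‖(∑ n ∈ (Finset.Ico 1 ⌈bigP D⌉₊).filter (fun n => Nat.Coprime n (frakq D)),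
          b1coef c' χ (n₁ * n) * varpi2 c' χ j n / (n : ℂ)) -
        ∑ x ∈ n₁.divisorsAntidiagonal,
          ∑ l ∈ (Finset.Ico 1 ⌈2 * bigT D ^ 2⌉₊).filter (fun l => Nat.Coprime l (frakq D)),
            varpi2 c' χ j l / ((l : ℂ) * (((x.1 * l : ℕ) : ℂ)) ^ beta3 c' D) *
              (gstar D (bigT D ^ 2 / ((x.1 * l : ℕ) : ℝ)) : ℂ) *
              ∑ m ∈ (Finset.Ico 1 ⌈bigP D⌉₊).filter (fun m => Nat.Coprime m (frakq D)),
                bcoef D (x.2 * m) * χ ((x.2 * m : ℕ) : ZMod D) * varpi2 c' χ j m / (m : ℂ)‖ ≤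
      C * (D : ℝ) ^ (-c)

/-- **§16, fourth display after (16.13)** (§16 p. 93, tex L4614–L4617, DAG `Z22:§16.u034`): "for
`(m,𝔮) = 1` and `m < P` we have trivially `ϖ₂ⱼ(m) = χ(m)ϱ*ⱼ(m) + O(τ₂(m)D^{−c})`"
(`ϱ*ⱼ = Skeleton.varrhoStar`, (15.21)). CLAIM. [cite: Zhang2022LandauSiegel, §16 p.93] -/
def Step16_u034 : Prop :=
  ∃ c : ℝ, 0 < c ∧ ∃ C : ℝ, ForAllLarge fun D _ χ => AssumptionA D χ → ∀ j ∈ ({1, 2} : Finset ℕ),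
    ∀ m : ℕ, 1 ≤ m → Nat.Coprime m (frakq D) → (m : ℝ) < bigP D →
      ‖varpi2 c' χ j m - χ (m : ZMod D) * varrhoStar c' χ j m‖ ≤
        C * m.divisors.card * (D : ℝ) ^ (-c)

/-- **§16, fifth display after (16.13)** (§16 p. 93, tex L4618–L4622, DAG `Z22:§16.u035`): "Hence, for
`m₁ < T`, `Σ_{(m,𝔮)=1} b(m₁m)ϖ₂ⱼ(m)/m = 𝔢ⱼχ(m₁)τ₂(m₁) + O(D^{−c})` by Lemma 15.1" (`m₁ ∣ n₁ ∈ 𝔫(𝔮)`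
in context, kept as the hypothesis `m₁ ∈ 𝔫(𝔮)`; `𝔢ⱼ = frake j`; the bare `b(m₁m)` in the χ-twisted
reading `b(m₁m)χ(m₁m)`, FLAG G-L4t1-1 — with it "by Lemma 15.1" refers to Lemma 15.1 in the same
reading, not to the banked literal `Skeleton.Lemma151`). FLAG: Lemma 15.1 as printed gives the error
`O(α₁τ₂(n₁))`, not `O(D^{−c})` — typed as printed. CLAIM. [cite: Zhang2022LandauSiegel, §16 p.93] -/
def Step16_u035 : Prop :=
  ∃ c : ℝ, 0 < c ∧ ∃ C : ℝ, ForAllLarge fun D _ χ => AssumptionA D χ → ∀ j ∈ ({1, 2} : Finset ℕ),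
    ∀ m₁ : ℕ, m₁ ∈ nset (frakq D) → (m₁ : ℝ) < bigT D →
      ‖(∑ m ∈ (Finset.Ico 1 ⌈bigP D⌉₊).filter (fun m => Nat.Coprime m (frakq D)),
          bcoef D (m₁ * m) * χ ((m₁ * m : ℕ) : ZMod D) * varpi2 c' χ j m / (m : ℂ)) -
        frake j * χ (m₁ : ZMod D) * (m₁.divisors.card : ℂ)‖ ≤ C * (D : ℝ) ^ (-c)

/-- **(16.14)** (§16 p. 93, tex L4622–L4625, DAG `Z22:(16.14)`): for `n₁ ∈ 𝔫(𝔮)`, `n₁ < T`: "It follows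
that `Σ_{(n,𝔮)=1} b₁(n₁n)ϖ₂ⱼ(n)/n = 𝔢ⱼ Σ_{n₁=l₁m₁} χ(m₁)τ₂(m₁) Σ_{(l,𝔮)=1} ϖ₂ⱼ(l)/(l(l₁l)^{β₃})
g*(T²/(l₁l)) + O(D^{−c})`." CLAIM. [cite: Zhang2022LandauSiegel, §16 (16.14) p.93] -/
def Eq16_14 : Prop :=
  ∃ c : ℝ, 0 < c ∧ ∃ C : ℝ, ForAllLarge fun D _ χ => AssumptionA D χ → ∀ j ∈ ({1, 2} : Finset ℕ),
    ∀ n₁ : ℕ, n₁ ∈ nset (frakq D) → (n₁ : ℝ) < bigT D →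
      ‖(∑ n ∈ (Finset.Ico 1 ⌈bigP D⌉₊).filter (fun n => Nat.Coprime n (frakq D)),
          b1coef c' χ (n₁ * n) * varpi2 c' χ j n / (n : ℂ)) -
        frake j * ∑ x ∈ n₁.divisorsAntidiagonal, χ (x.2 : ZMod D) * (x.2.divisors.card : ℂ) *
          ∑ l ∈ (Finset.Ico 1 ⌈2 * bigT D ^ 2⌉₊).filter (fun l => Nat.Coprime l (frakq D)),
            varpi2 c' χ j l / ((l : ℂ) * (((x.1 * l : ℕ) : ℂ)) ^ beta3 c' D) *
              (gstar D (bigT D ^ 2 / ((x.1 * l : ℕ) : ℝ)) : ℂ)‖ ≤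
      C * (D : ℝ) ^ (-c)

/-- **§16, display after (16.14)** (§16 p. 93, tex L4626–L4629, DAG `Z22:§16.u036`): "On the other
hand, if `1 < l < T⁵` and `(l,𝔮) = 1`, then for any `q ∣ l`, `ϱ₂ⱼ(l) ≪ α₁ + O(ν(q))`." FLAG: the
printed glyph `ϱ₂ⱼ` (varrho) is not defined in the manuscript; the object in context is `ϖ₂ⱼ` (varpi)
— glyph drift, typed with `ϖ₂ⱼ`; `α₁` read as `α𝓛`; "`≪ α₁ + O(ν(q))`" read as
`|ϖ₂ⱼ(l)| ≤ C(α𝓛 + |ν(q)|)`, `q` prime. CLAIM. [cite: Zhang2022LandauSiegel, §16 p.93] -/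
def Step16_u036 : Prop :=
  ∃ C : ℝ, ForAllLarge fun D _ χ => AssumptionA D χ → ∀ j ∈ ({1, 2} : Finset ℕ),
    ∀ l : ℕ, 1 < l → (l : ℝ) < bigT D ^ 5 → Nat.Coprime l (frakq D) → ∀ q : ℕ, q.Prime → q ∣ l →
      ‖varpi2 c' χ j l‖ ≤ C * (alpha D * ell D + ‖nu χ q‖)

/-- **"Thus the innermost sum in (16.14) is equal to `1 + O(1/𝓛⁷)`"** (§16 p. 94, tex L4631; inline
claim, DAG `Z22:§16.u037`), for `n₁ ∈ 𝔫(𝔮)`, `n₁ < T`, `l₁ ∣ n₁`. CLAIM.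
[cite: Zhang2022LandauSiegel, §16 p.94] -/
def Inline16_innerSum1614 : Prop :=
  ∃ C : ℝ, ForAllLarge fun D _ χ => AssumptionA D χ → ∀ j ∈ ({1, 2} : Finset ℕ),
    ∀ n₁ : ℕ, n₁ ∈ nset (frakq D) → (n₁ : ℝ) < bigT D → ∀ l₁ ∈ n₁.divisors,
      ‖(∑ l ∈ (Finset.Ico 1 ⌈2 * bigT D ^ 2⌉₊).filter (fun l => Nat.Coprime l (frakq D)),
          varpi2 c' χ j l / ((l : ℂ) * (((l₁ * l : ℕ) : ℂ)) ^ beta3 c' D) *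
            (gstar D (bigT D ^ 2 / ((l₁ * l : ℕ) : ℝ)) : ℂ)) - 1‖ ≤ C * (ell D ^ 7)⁻¹

/-- **§16, first display of p. 94** (tex L4631–L4633, DAG `Z22:§16.u037`): for `n₁ ∈ 𝔫(𝔮)`, `n₁ < T`:
"It follows that `Σ_{(n,𝔮)=1} b₁(n₁n)ϖ₂ⱼ(n)/n = 𝔢ⱼ Σ_{m₁∣n₁} χ(m₁)τ₂(m₁) + O(1/𝓛⁴)`." CLAIM.
[cite: Zhang2022LandauSiegel, §16 p.94] -/
def Step16_u037 : Prop :=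
  ∃ C : ℝ, ForAllLarge fun D _ χ => AssumptionA D χ → ∀ j ∈ ({1, 2} : Finset ℕ),
    ∀ n₁ : ℕ, n₁ ∈ nset (frakq D) → (n₁ : ℝ) < bigT D →
      ‖(∑ n ∈ (Finset.Ico 1 ⌈bigP D⌉₊).filter (fun n => Nat.Coprime n (frakq D)),
          b1coef c' χ (n₁ * n) * varpi2 c' χ j n / (n : ℂ)) -
        frake j * ∑ m₁ ∈ n₁.divisors, χ (m₁ : ZMod D) * (m₁.divisors.card : ℂ)‖ ≤ C * (ell D ^ 4)⁻¹

/-- **"Since `1∗χτ₂ = ν∗χ` (here `1` denotes the arithmetic function identically equal to `1`)"**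
(§16 p. 94, tex L4634; inline identity preceding (16.15), DAG `Z22:(16.15)`): the Dirichlet
convolution of `1` with `n ↦ χ(n)τ₂(n)` equals `ν∗χ` (`ν = 1∗χ`). CLAIM (an exact identity of
arithmetic functions) — PROVED below (`inline16_oneConvChiTau2_holds`).
[cite: Zhang2022LandauSiegel, §16 p.94] -/
def Inline16_oneConvChiTau2 : Prop :=
  ∀ (D : ℕ) [NeZero D] (χ : DirichletCharacter ℂ D), ∀ n : ℕ, 1 ≤ n →
    LSeries.convolution (fun _ => (1 : ℂ)) (fun m => χ (m : ZMod D) * (m.divisors.card : ℂ)) n =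
      nuConvChi χ n

open scoped Classical in
/-- **(16.15)** (§16 p. 94, tex L4634–L4637, DAG `Z22:(16.15)`): "it follows that
`Σ_n b₁(n)ϖ₂ⱼ(n)/n = 𝔢ⱼ Σ_{n₁∈𝔫(𝔮), n₁<T} ϖ₂ⱼ(n₁)(ν∗χ)(n₁)/n₁ + O(1/𝓛)`." CLAIM (refines
`Skeleton.Ded1617 c′`). [cite: Zhang2022LandauSiegel, §16 (16.15) p.94] -/
def Eq16_15 : Prop :=
  ∃ C : ℝ, ForAllLarge fun D _ χ => AssumptionA D χ → ∀ j ∈ ({1, 2} : Finset ℕ),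
    ‖(∑ n ∈ Finset.Ico 1 ⌈bigP D⌉₊, b1coef c' χ n * varpi2 c' χ j n / (n : ℂ)) -
        frake j * ∑ n₁ ∈ (Finset.Ico 1 ⌈bigT D⌉₊).filter (fun n₁ => n₁ ∈ nset (frakq D)),
          varpi2 c' χ j n₁ * nuConvChi χ n₁ / (n₁ : ℂ)‖ ≤ C * (ell D)⁻¹

open scoped Classical in
/-- **"On the right side above, the constraint `n₁ ∈ 𝔫(𝔮)` can be removed with an acceptable error"**
(§16 p. 94, tex L4638; inline claim after (16.15), DAG `Z22:(16.15)`). FLAG: the rate is not printed;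
it is read as the `O(1/𝓛)` of (16.15). CLAIM. [cite: Zhang2022LandauSiegel, §16 p.94] -/
def Inline16_nsetRemovable : Prop :=
  ∃ C : ℝ, ForAllLarge fun D _ χ => AssumptionA D χ → ∀ j ∈ ({1, 2} : Finset ℕ),
    ‖(frake j * ∑ n₁ ∈ (Finset.Ico 1 ⌈bigT D⌉₊).filter (fun n₁ => n₁ ∈ nset (frakq D)),
          varpi2 c' χ j n₁ * nuConvChi χ n₁ / (n₁ : ℂ)) -
        frake j * ∑ n₁ ∈ Finset.Ico 1 ⌈bigT D⌉₊, varpi2 c' χ j n₁ * nuConvChi χ n₁ / (n₁ : ℂ)‖ ≤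
      C * (ell D)⁻¹

/-! ## Lemma 16.2: the function `𝔲₂ⱼ(s)` -/

section LemmaSixteenTwo

variable {D : ℕ} [NeZero D] (χ : DirichletCharacter ℂ D)

/-- The printed formula of **`𝔲₂ⱼ(s) = (ζ(s)³L(s,χ)³)⁻¹ Σ_n ϖ₂ⱼ(n)(ν∗χ)(n)n^{−s}`** (§16 p. 94,
tex L4647–L4649, DAG `Z22:§16.u038`) — meaningful where the series converges (`σ > 1`).
[cite: Zhang2022LandauSiegel, §16 Lemma 16.2 p.94] -/
def frakU2Series (j : ℕ) (s : ℂ) : ℂ :=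
  (riemannZeta s ^ 3 * χ.LFunction s ^ 3)⁻¹ *
    ∑' n : ℕ, varpi2 c' χ j n * nuConvChi χ n / (n : ℂ) ^ s

/-- **`𝔲₂ⱼ(s)`** for `σ > 9/10` (Lemma 16.2: "is analytic … for `σ > 9/10`"): the value of the analytic
continuation of `frakU2Series` (`acVal`); in particular `𝔲₂ⱼ(1) = frakU2 c′ χ j 1`. (No Euler-product
form of `𝔲₂ⱼ` is displayed in §16; the local computations of its Appendix-A proof, `Π₂(l)`, are nodes of
`TypedAppendixA2`.) [cite: Zhang2022LandauSiegel, §16 Lemma 16.2 p.94] -/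
def frakU2 (j : ℕ) (s : ℂ) : ℂ := acVal (frakU2Series c' χ j) s

/-- The main term of `𝔲₂ⱼ(1)`: **`(6/π²)·φ(D)/(D𝔭)·∏_{q∣D} q/(q+1)`** (§16 p. 94, tex L4652).
[cite: Zhang2022LandauSiegel, §16 Lemma 16.2 p.94] -/
def frakU2Main : ℂ :=
  (6 / Real.pi ^ 2 : ℝ) * ((Nat.totient D : ℂ) / ((D : ℂ) * frakp χ)) *
    ∏ q ∈ D.primeFactors, ((q : ℂ) / ((q : ℂ) + 1))

end LemmaSixteenTwo

/-- **Lemma 16.2** (§16 p. 94, tex L4646–L4653, DAG `Z22:Lem16.2`; "will be proved in Appendix A",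
where the proof is "a sketch only"): "The function `𝔲₂ⱼ(s) = (ζ(s)³L(s,χ)³)⁻¹Σ_n ϖ₂ⱼ(n)(ν∗χ)(n)n^{−s}`
is analytic and bounded for `σ > 9/10`. Further we have
`𝔲₂ⱼ(1) = (6/π²)(φ(D)/(D𝔭))∏_{q∣D} q/(q+1) + O(1/𝓛⁴)`" — typed, as `Skeleton.Lemma83`, as the
existence of an analytic continuation `U` of the printed formula from `σ > 1` to `σ > 9/10`,
bounded there ("bounded": a bound depending on the function), with the stated value at `1`
(`j = 1, 2`). FLAG (typed as printed): the sibling HINT L4-t3 (HOME/STATUS 23:45Z) computes that with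
the printed prefactor `(ζ³L³)⁻¹` the series' Euler factors leave `ζ(s−β_j)`-type poles on `σ = 1`
(family of GAP row G-L4t3-1) — for the adjudication, not repaired here. CLAIM (so far folded inside
`Skeleton.Ded1617 c′`). [cite: Zhang2022LandauSiegel, §16 Lemma 16.2 p.94] -/
def Lemma162 : Prop :=
  ∃ C : ℝ, ForAllLarge fun D _ χ => AssumptionA D χ → ∀ j ∈ ({1, 2} : Finset ℕ),
    ∃ U : ℂ → ℂ, DifferentiableOn ℂ U {s : ℂ | 9 / 10 < s.re} ∧
      (∀ s : ℂ, 1 < s.re → U s = frakU2Series c' χ j s) ∧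
      (∃ B : ℝ, ∀ s : ℂ, 9 / 10 < s.re → ‖U s‖ ≤ B) ∧
      ‖U 1 - frakU2Main χ‖ ≤ C * (ell D ^ 4)⁻¹

/-- **The second assertion of Lemma 16.2 as a display** (§16 p. 94, tex L4651–L4653, DAG
`Z22:§16.u039`): "`𝔲₂ⱼ(1) = (6/π²)(φ(D)/(D𝔭))∏_{q∣D} q/(q+1) + O(1/𝓛⁴)`" for the value
`frakU2 c′ χ j 1` of the continuation. CLAIM. [cite: Zhang2022LandauSiegel, §16 Lemma 16.2 p.94] -/
def Step16_u039 : Prop :=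
  ∃ C : ℝ, ForAllLarge fun D _ χ => AssumptionA D χ → ∀ j ∈ ({1, 2} : Finset ℕ),
    ‖frakU2 c' χ j 1 - frakU2Main χ‖ ≤ C * (ell D ^ 4)⁻¹

/-! ## From (16.15) to (16.16): the smoothed sum and the contour shift -/

section SmoothedSum

variable {D : ℕ} [NeZero D] (χ : DirichletCharacter ℂ D)

/-- The integrand of the second line of the display after Lemma 16.2 (§16 p. 94, tex L4659):
`ζ(1+s)³L(1+s,χ)³𝔲₂ⱼ(1+s)T^s ω₁(s)/s` (`ω₁ = GaussWeight.omega1 (𝓛³⁰)`, (4.1)).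
[cite: Zhang2022LandauSiegel, §16 p.94] -/
def integrand16_u040 (j : ℕ) (s : ℂ) : ℂ :=
  riemannZeta (1 + s) ^ 3 * χ.LFunction (1 + s) ^ 3 * frakU2 c' χ j (1 + s) * (bigT D : ℂ) ^ s *
    GaussWeight.omega1 (ell D ^ 30) s / s

end SmoothedSum

/-- **§16, display after Lemma 16.2, first equality** (§16 p. 94, tex L4657–L4658, DAG `Z22:§16.u040`):
"We have `Σ_{n<T} ϖ₂ⱼ(n)(ν∗χ)(n)/n = Σ_n ϖ₂ⱼ(n)(ν∗χ)(n)n⁻¹g(T/n) + O(1/𝓛¹⁰)`" (`g = Skeleton.gW`,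
(4.1); the right-hand sum a series). CLAIM. [cite: Zhang2022LandauSiegel, §16 p.94] -/
def Step16_u040a : Prop :=
  ∃ C : ℝ, ForAllLarge fun D _ χ => AssumptionA D χ → ∀ j ∈ ({1, 2} : Finset ℕ),
    ‖(∑ n ∈ Finset.Ico 1 ⌈bigT D⌉₊, varpi2 c' χ j n * nuConvChi χ n / (n : ℂ)) -
        ∑' n : ℕ, varpi2 c' χ j n * nuConvChi χ n / (n : ℂ) * (gW D (bigT D / n) : ℂ)‖ ≤
      C * (ell D ^ 10)⁻¹

/-- **§16, display after Lemma 16.2, second equality** (§16 p. 94, tex L4658–L4660, DAG `Z22:§16.u040`):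
"`Σ_n ϖ₂ⱼ(n)(ν∗χ)(n)n⁻¹g(T/n) = (2πi)⁻¹∫_{(1)} ζ(1+s)³L(1+s,χ)³𝔲₂ⱼ(1+s)T^sω₁(s) ds/s + O(1/𝓛¹⁰)`"
(the line integral as `(1/2π)∫_ℝ (…)(1 + iv) dv`). CLAIM. [cite: Zhang2022LandauSiegel, §16 p.94] -/
def Step16_u040b : Prop :=
  ∃ C : ℝ, ForAllLarge fun D _ χ => AssumptionA D χ → ∀ j ∈ ({1, 2} : Finset ℕ),
    ‖(∑' n : ℕ, varpi2 c' χ j n * nuConvChi χ n / (n : ℂ) * (gW D (bigT D / n) : ℂ)) -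
        (1 / (2 * π) : ℂ) * ∫ v : ℝ, integrand16_u040 c' χ j (1 + v * I)‖ ≤ C * (ell D ^ 10)⁻¹

/-- **§16, display after Lemma 16.2** (§16 p. 94, tex L4656–L4661, DAG `Z22:§16.u040`): both printed
equalities. CLAIM. [cite: Zhang2022LandauSiegel, §16 p.94] -/
def Step16_u040 : Prop := Step16_u040a c' ∧ Step16_u040b c'

/-- **"The contour of integration is moved in the same way as in the proof of Lemma 8.4. Thus the right
side above is, by Lemma 16.2, equal to `L′(1,χ)³𝔲₂ⱼ(1) + O(1/𝓛⁴)`"** (§16 p. 94, tex L4662–L4664, DAG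
`Z22:§16.u041`, first equality). CLAIM. [cite: Zhang2022LandauSiegel, §16 p.94] -/
def Step16_u041a : Prop :=
  ∃ C : ℝ, ForAllLarge fun D _ χ => AssumptionA D χ → ∀ j ∈ ({1, 2} : Finset ℕ),
    ‖(1 / (2 * π) : ℂ) * (∫ v : ℝ, integrand16_u040 c' χ j (1 + v * I)) -
        deriv χ.LFunction 1 ^ 3 * frakU2 c' χ j 1‖ ≤ C * (ell D ^ 4)⁻¹

/-- **"`L′(1,χ)³𝔲₂ⱼ(1) + O(1/𝓛⁴) = (𝔞/𝔭)(φ(D)/D)L′(1,χ) + O(1/𝓛⁴)`"** (§16 p. 94, tex L4663–L4665,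
DAG `Z22:§16.u041`, second equality; `𝔞 = Skeleton.frakA χ`, (2.31)). CLAIM.
[cite: Zhang2022LandauSiegel, §16 p.94] -/
def Step16_u041b : Prop :=
  ∃ C : ℝ, ForAllLarge fun D _ χ => AssumptionA D χ → ∀ j ∈ ({1, 2} : Finset ℕ),
    ‖deriv χ.LFunction 1 ^ 3 * frakU2 c' χ j 1 -
        (frakA χ : ℂ) / frakp χ * ((Nat.totient D : ℂ) / (D : ℂ)) * deriv χ.LFunction 1‖ ≤
      C * (ell D ^ 4)⁻¹

/-- **§16, second display of p. 94 after Lemma 16.2** (tex L4662–L4665, DAG `Z22:§16.u041`): both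
printed equalities. CLAIM. [cite: Zhang2022LandauSiegel, §16 p.94] -/
def Step16_u041 : Prop := Step16_u041a c' ∧ Step16_u041b c'

/-- **"Hence, by (16.15), `Σ_n b₁(n)ϖ₂ⱼ(n)/n = (𝔞𝔢ⱼ/𝔭)(φ(D)/D)L′(1,χ) + O(1/𝓛⁴)`"** (§16 p. 94,
tex L4666–L4669, DAG `Z22:§16.u042`). CLAIM. [cite: Zhang2022LandauSiegel, §16 p.94] -/
def Step16_u042 : Prop :=
  ∃ C : ℝ, ForAllLarge fun D _ χ => AssumptionA D χ → ∀ j ∈ ({1, 2} : Finset ℕ),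
    ‖(∑ n ∈ Finset.Ico 1 ⌈bigP D⌉₊, b1coef c' χ n * varpi2 c' χ j n / (n : ℂ)) -
        (frakA χ : ℂ) * frake j / frakp χ * ((Nat.totient D : ℂ) / (D : ℂ)) * deriv χ.LFunction 1‖ ≤
      C * (ell D ^ 4)⁻¹

/-- **(16.16)** (§16 p. 95, tex L4670–L4673, DAG `Z22:(16.16)`): "Inserting this into (16.13) and applying
Lemma 16.1 we obtain `𝒮₂ⱼ = 𝔞𝔢ⱼ(φ(D)/D)L′(1,χ) + O(1/𝓛⁴)`" (`j = 1, 2`). CLAIM (refines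
`Skeleton.Ded1617 c′`). [cite: Zhang2022LandauSiegel, §16 (16.16) p.95] -/
def Eq16_16 : Prop :=
  ∃ C : ℝ, ForAllLarge fun D _ χ => AssumptionA D χ → ∀ j ∈ ({1, 2} : Finset ℕ),
    ‖calS2 c' χ j - (frakA χ : ℂ) * frake j * ((Nat.totient D : ℂ) / (D : ℂ)) * deriv χ.LFunction 1‖ ≤
      C * (ell D ^ 4)⁻¹

/-! ## The residues and the evaluation of `Φ₂(p)`, `Φ₂` -/

/-- **"On the other hand, by Lemma 5.8 and direct calculation, `𝓡₂* = β₁ + O(1/𝓛¹⁰)`,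
`𝓡₂ⱼ = −1/(β₁L′(1,χ)) + O(𝓛⁶)`, `j = 1, 2`"** (§16 p. 95, tex L4674–L4677, DAG `Z22:§16.u043`;
`𝓡₂* = Section16A.calR2star`, `𝓡₂ⱼ = Section16A.calR2`). CLAIM. [cite: Zhang2022LandauSiegel, §16 p.95] -/
def Step16_u043 : Prop :=
  ∃ C : ℝ, ForAllLarge fun D _ χ => AssumptionA D χ →
    ‖calR2star c' χ - beta1 c' D‖ ≤ C * (ell D ^ 10)⁻¹ ∧
      ∀ j ∈ ({1, 2} : Finset ℕ),
        ‖calR2 c' χ j + 1 / (beta1 c' D * deriv χ.LFunction 1)‖ ≤ C * ell D ^ 6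

/-- **"so that `𝓡₂*𝓡₂ⱼ = −1/L′(1,χ) + O(𝓛⁻¹L′(1,χ)⁻¹)`"** (§16 p. 95, tex L4678–L4681, DAG
`Z22:§16.u044`). CLAIM. [cite: Zhang2022LandauSiegel, §16 p.95] -/
def Step16_u044 : Prop :=
  ∃ C : ℝ, ForAllLarge fun D _ χ => AssumptionA D χ → ∀ j ∈ ({1, 2} : Finset ℕ),
    ‖calR2star c' χ * calR2 c' χ j + 1 / deriv χ.LFunction 1‖ ≤
      C * (ell D)⁻¹ * ‖deriv χ.LFunction 1‖⁻¹

/-- **"This together with (16.16) and (16.12) yields `Φ₂(p) = −(𝔢₁ + 𝔢₂)𝔞p + o(p)`"** (§16 p. 95,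
tex L4682–L4685, DAG `Z22:§16.u045`; `p ∼ P`, `Φ₂(p) = Section16A.Phi2p`). CLAIM (refines
`Skeleton.Ded1617 c′`). [cite: Zhang2022LandauSiegel, §16 p.95] -/
def Step16_u045 : Prop :=
  ∀ ε : ℝ, 0 < ε → ForAllLarge fun D _ χ => AssumptionA D χ → ∀ p ∈ primeWindow D,
    ‖Phi2p c' χ p + (frake 1 + frake 2) * frakA χ * p‖ ≤ ε * p

/-- **"Since `(pt₀)^{β₁} = −1 + O(α₁)`"** (§16 p. 95, tex L4686; the inline claim by which (16.2) and
the display above give (16.17) = `Skeleton.Eval1617 c′`; `p ∼ P`, `α₁` read as `α𝓛`). CLAIM.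
[cite: Zhang2022LandauSiegel, §16 (16.17) p.95] -/
def Inline16_ptPowBeta1 : Prop :=
  ∃ C : ℝ, ForAllLarge fun D _ χ => AssumptionA D χ → ∀ p ∈ primeWindow D,
    ‖(((p : ℝ) * t0 D : ℝ) : ℂ) ^ beta1 c' D + 1‖ ≤ C * (alpha D * ell D)

/-! ## Kernel-checked bookkeeping -/

/-- Lemma 16.2 supplies the continuation that `frakU2` chooses: under `Lemma162`, for all large `D` and
`j = 1, 2`, `frakU2 c′ χ j` is differentiable on `σ > 9/10` and agrees with the printed formula on
`σ > 1` (so the value `𝔲₂ⱼ(1) = frakU2 c′ χ j 1` of `Step16_u039`–`Step16_u041` is that of an analytic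
continuation). [cite: Zhang2022LandauSiegel, §16 Lemma 16.2 p.94] -/
theorem frakU2_spec_of_lemma162 (h : Lemma162 c') :
    ForAllLarge fun D _ χ => AssumptionA D χ → ∀ j ∈ ({1, 2} : Finset ℕ),
      DifferentiableOn ℂ (frakU2 c' χ j) {s : ℂ | 9 / 10 < s.re} ∧
        ∀ s : ℂ, 1 < s.re → frakU2 c' χ j s = frakU2Series c' χ j s := by
  obtain ⟨C, D₀, hC⟩ := h
  refine ⟨D₀, fun D _ χ hD hq hp hA j hj => ?_⟩
  obtain ⟨U, hU, hUeq, _, _⟩ := hC D χ hD hq hp hA j hj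
  exact acVal_spec ⟨U, hU, hUeq⟩

/-- **"Inserting this into (16.13)", the exact algebra** (§16 p. 95, tex L4670): under (16.13),
`𝒮₂ⱼ − 𝔞𝔢ⱼ(φ(D)/D)L′` splits as `𝓜₂*(1−β_j)·[Σ_n b₁ϖ₂ⱼ/n − (𝔞𝔢ⱼ/𝔭)(φ(D)/D)L′]`
`+ (𝓜₂*(1−β_j) − 𝔭)·(𝔞𝔢ⱼ/𝔭)(φ(D)/D)L′ + (𝔭/𝔭 − 1)·𝔞𝔢ⱼ(φ(D)/D)L′` — the three terms that
`Step16_u042`, Lemma 16.1 and `𝔭 ≠ 0` respectively make `O(𝓛⁻⁴)`, `O(𝓛⁻⁸)`, `0` in the discharge of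
`Eq16_16`. [cite: Zhang2022LandauSiegel, §16 (16.16) p.95] -/
theorem calS2_sub_main_eq_of_eq16_13 (h : Eq16_13 c') :
    ForAllLarge fun D _ χ => AssumptionA D χ → ∀ j ∈ ({1, 2} : Finset ℕ),
      calS2 c' χ j - (frakA χ : ℂ) * frake j * ((Nat.totient D : ℂ) / (D : ℂ)) * deriv χ.LFunction 1 =
        calM2star c' χ (1 - betaJ c' D j) *
            ((∑ n ∈ Finset.Ico 1 ⌈bigP D⌉₊, b1coef c' χ n * varpi2 c' χ j n / (n : ℂ)) -
              (frakA χ : ℂ) * frake j / frakp χ * ((Nat.totient D : ℂ) / (D : ℂ)) *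
                deriv χ.LFunction 1) +
          (calM2star c' χ (1 - betaJ c' D j) - frakp χ) *
            ((frakA χ : ℂ) * frake j / frakp χ * ((Nat.totient D : ℂ) / (D : ℂ)) *
              deriv χ.LFunction 1) +
          (frakp χ / frakp χ - 1) *
            ((frakA χ : ℂ) * frake j * ((Nat.totient D : ℂ) / (D : ℂ)) * deriv χ.LFunction 1) := by
  obtain ⟨D₀, hC⟩ := h
  refine ⟨D₀, fun D _ χ hD hq hp hA j hj => ?_⟩
  rw [hC D χ hD hq hp hA j hj]
  ring

/-! ## Discharges of identity leaves (0 facts) -/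

section Discharges

open ArithmeticFunction

/-- For a Dirichlet character `χ` and `ab = m`: `χ(a)χ(b) = χ(m)`. [folklore] -/
private theorem chi_mul_of_mem_divisorsAntidiagonal {D : ℕ} (χ : DirichletCharacter ℂ D) {m : ℕ}
    {p : ℕ × ℕ} (hp : p ∈ m.divisorsAntidiagonal) :
    χ (p.1 : ZMod D) * χ (p.2 : ZMod D) = χ (m : ZMod D) := by
  rw [← map_mul, ← Nat.cast_mul, (Nat.mem_divisorsAntidiagonal.mp hp).1]

/-- `(χ ∗ χ)(m) = χ(m)τ₂(m)`: the self-convolution of a Dirichlet character. [folklore] -/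
private theorem toAF_chi_mul_self {D : ℕ} (χ : DirichletCharacter ℂ D) :
    toArithmeticFunction (fun m : ℕ => χ (m : ZMod D)) *
        toArithmeticFunction (fun m : ℕ => χ (m : ZMod D)) =
      toArithmeticFunction (fun m : ℕ => χ (m : ZMod D) * (m.divisors.card : ℂ)) := by
  ext m
  rcases eq_or_ne m 0 with rfl | hm
  · simp [toArithmeticFunction]
  simp only [mul_apply, toArithmeticFunction, ArithmeticFunction.coe_mk, if_neg hm]
  have key : ∀ p ∈ m.divisorsAntidiagonal,
      (if p.1 = 0 then (0 : ℂ) else χ (p.1 : ZMod D)) * (if p.2 = 0 then (0 : ℂ) else χ (p.2 : ZMod D))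
        = χ (m : ZMod D) := by
    intro p hp
    have h := Nat.ne_zero_of_mem_divisorsAntidiagonal hp
    rw [if_neg h.1, if_neg h.2, chi_mul_of_mem_divisorsAntidiagonal χ hp]
  rw [Finset.sum_congr rfl key, Finset.sum_const, nsmul_eq_mul, mul_comm,
    ← Nat.map_div_right_divisors, Finset.card_map]

/-- `toArithmeticFunction 1 = ζ` (as `ℂ`-valued arithmetic functions). [folklore] -/
private theorem toAF_one_eq_zeta :
    toArithmeticFunction (fun _ : ℕ => (1 : ℂ)) = ((zeta : ArithmeticFunction ℕ) : ArithmeticFunction ℂ) := by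
  ext m
  rcases eq_or_ne m 0 with rfl | hm
  · simp [toArithmeticFunction]
  · simp [toArithmeticFunction, hm]

/-- `ν = ζ ∗ χ` as arithmetic functions (`ν = Skeleton.nu χ = 1 ∗ χ`). [folklore] -/
private theorem toAF_nu_eq {D : ℕ} [NeZero D] (χ : DirichletCharacter ℂ D) :
    toArithmeticFunction (nu χ) =
      ((zeta : ArithmeticFunction ℕ) : ArithmeticFunction ℂ) *
        toArithmeticFunction (fun m : ℕ => χ (m : ZMod D)) := by
  ext m
  rcases eq_or_ne m 0 with rfl | hm
  · simp [toArithmeticFunction]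
  rw [coe_zeta_mul_apply]
  simp only [toArithmeticFunction, ArithmeticFunction.coe_mk, if_neg hm, nu,
    Literature.NumberTheory.LFunctions.divisorSumChar_apply]
  refine Finset.sum_congr rfl fun d hd => ?_
  rw [if_neg (Nat.pos_of_mem_divisors hd).ne']

/-- **"`1 ∗ χτ₂ = ν ∗ χ`" holds** (§16 p. 94, tex L4634): both sides are `ζ ∗ χ ∗ χ`, by
`(χ ∗ χ)(m) = χ(m)τ₂(m)` (complete multiplicativity) and associativity of Dirichlet convolution.
Kernel discharge of the inline identity preceding (16.15). [cite: Zhang2022LandauSiegel, §16 p.94] -/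
theorem inline16_oneConvChiTau2_holds : Inline16_oneConvChiTau2 := by
  intro D _ χ n _
  show LSeries.convolution _ _ n = LSeries.convolution _ _ n
  rw [LSeries.convolution, LSeries.convolution, toAF_one_eq_zeta, ← toAF_chi_mul_self, toAF_nu_eq,
    mul_assoc]

/-- The divisor pairs of `mn`, `(m,n) = 1`, are the products of the divisor pairs of `m` and of `n`
(the bijection `((i,j),(k,l)) ↦ (ik, jl)`; the same statement is proved, for another purpose, as
`…EllipticCurves.ModularForms.UpperHecke.sum_divisorsAntidiagonal_mul_of_coprime` — re-proved
here privately so that the Zhang2022 import cone stays free of the modular-forms library). [folklore] -/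
private theorem sum_divisorsAntidiagonal_mul_of_coprime {M : Type*} [AddCommMonoid M] {m n : ℕ}
    (hmn : m.Coprime n) (f : ℕ → ℕ → M) :
    ∑ w ∈ (m * n).divisorsAntidiagonal, f w.1 w.2 =
      ∑ x ∈ m.divisorsAntidiagonal, ∑ y ∈ n.divisorsAntidiagonal, f (x.1 * y.1) (x.2 * y.2) := by
  rw [← Finset.sum_product']
  symm
  apply Finset.sum_nbij fun ((i, j), k, l) ↦ (i * k, j * l)
  · rintro ⟨⟨a1, a2⟩, ⟨b1, b2⟩⟩ h
    simp only [Nat.mem_divisorsAntidiagonal, Ne, Finset.mem_product] at h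
    rcases h with ⟨⟨rfl, ha⟩, ⟨rfl, hb⟩⟩
    simp only [Nat.mem_divisorsAntidiagonal, mul_eq_zero, Ne]
    constructor
    · ring
    rw [mul_eq_zero] at *
    exact not_or_intro ha hb
  · simp only [Set.InjOn, Finset.mem_coe, Nat.mem_divisorsAntidiagonal, Finset.mem_product, Prod.mk_inj]
    rintro ⟨⟨a1, a2⟩, ⟨b1, b2⟩⟩ ⟨⟨rfl, ha⟩, ⟨rfl, hb⟩⟩ ⟨⟨c1, c2⟩, ⟨d1, d2⟩⟩ hcd h
    have cop := hmn
    ext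
    · trans Nat.gcd (a1 * a2) (a1 * b1)
      · rw [Nat.gcd_mul_left, cop.coprime_mul_left.coprime_mul_right_right.gcd_eq_one, mul_one]
      · rw [← hcd.1.1, ← hcd.2.1] at cop
        rw [← hcd.1.1, h.1, Nat.gcd_mul_left,
          cop.coprime_mul_left.coprime_mul_right_right.gcd_eq_one, mul_one]
    · trans Nat.gcd (a1 * a2) (a2 * b2)
      · rw [mul_comm, Nat.gcd_mul_left, cop.coprime_mul_right.coprime_mul_left_right.gcd_eq_one,
          mul_one]
      · rw [← hcd.1.1, ← hcd.2.1] at cop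
        rw [← hcd.1.1, h.2, mul_comm, Nat.gcd_mul_left,
          cop.coprime_mul_right.coprime_mul_left_right.gcd_eq_one, mul_one]
    · trans Nat.gcd (b1 * b2) (a1 * b1)
      · rw [mul_comm, Nat.gcd_mul_right,
          cop.coprime_mul_right.coprime_mul_left_right.symm.gcd_eq_one, one_mul]
      · rw [← hcd.1.1, ← hcd.2.1] at cop
        rw [← hcd.2.1, h.1, mul_comm c1 d1, Nat.gcd_mul_left,
          cop.coprime_mul_right.coprime_mul_left_right.symm.gcd_eq_one, mul_one]
    · trans Nat.gcd (b1 * b2) (a2 * b2)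
      · rw [Nat.gcd_mul_right, cop.coprime_mul_left.coprime_mul_right_right.symm.gcd_eq_one, one_mul]
      · rw [← hcd.1.1, ← hcd.2.1] at cop
        rw [← hcd.2.1, h.2, Nat.gcd_mul_right,
          cop.coprime_mul_left.coprime_mul_right_right.symm.gcd_eq_one, one_mul]
  · simp only [Set.SurjOn, Set.subset_def, Finset.mem_coe, Nat.mem_divisorsAntidiagonal,
      Finset.mem_product, Set.mem_image]
    rintro ⟨b1, b2⟩ h
    use ((b1.gcd m, b2.gcd m), (b1.gcd n, b2.gcd n))
    rw [← hmn.gcd_mul _, ← hmn.gcd_mul _, ← h.1, Nat.gcd_mul_gcd_of_coprime_of_mul_eq_mul hmn h.1,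
      Nat.gcd_mul_gcd_of_coprime_of_mul_eq_mul hmn.symm _]
    · rw [Ne, mul_eq_zero, not_or] at h
      simp [h.2.1, h.2.2]
    rw [mul_comm n m, h.1]
  · rintro ⟨⟨a1, a2⟩, ⟨b1, b2⟩⟩ _
    rfl

/-- If every prime factor of `n₁` divides `𝔮` (`n₁ ∈ 𝒩(𝔮)`) and `(n, 𝔮) = 1`, then `(n₁, n) = 1`
(§15 p. 85: "every `n` can be uniquely written as `n = n₁n₂` with `n₁ ∈ 𝒩(𝒬)` and `(n₂,𝒬) = 1`").
[cite: Zhang2022LandauSiegel, §15 (15.20) p.85] -/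
theorem coprime_of_mem_nset_of_coprime {q n₁ n : ℕ} (h₁ : n₁ ∈ nset q) (h : Nat.Coprime n q) :
    Nat.Coprime n₁ n := by
  refine Nat.coprime_of_dvd fun k hk hk₁ hkn => ?_
  have hkq : k ∣ q := h₁.2 k hk hk₁
  have : k ∣ Nat.gcd n q := Nat.dvd_gcd hkn hkq
  rw [h.gcd_eq_one] at this
  exact hk.not_dvd_one this

/-- **The second display after (16.13) holds** (§16 p. 93, tex L4606–L4609, DAG `Z22:§16.u032`):
`b₁(n₁n) = Σ_{n₁=l₁m₁}Σ_{n=lm}(l₁l)^{−β₃}g*(T²/(l₁l))b(m₁m)` (χ-twisted reading of `b`, G-L4t1-1) for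
`n₁ ∈ 𝒩(𝔮)`, `(n,𝔮) = 1` — the divisor pairs of `n₁n` are the products of those of the coprime
`n₁`, `n` (0 facts). [cite: Zhang2022LandauSiegel, §16 p.93] -/
theorem step16_u032_holds : Step16_u032 c' := by
  refine ⟨0, fun D _ χ _ _ _ _ n₁ n hn₁ _ _ hcop => ?_⟩
  unfold b1coef
  exact sum_divisorsAntidiagonal_mul_of_coprime (coprime_of_mem_nset_of_coprime hn₁ hcop)
    (fun l m => (l : ℂ) ^ (-beta3 c' D) * (gstar D (bigT D ^ 2 / l) : ℂ) *
      (bcoef D m * χ (m : ZMod D)))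

/-- `Step16_u032` — `_holds` alias of `step16_u032_holds` above under the fact's exact name (appended
2026-08-28, D-0026 bookkeeping: the proof term is the existing theorem of this file; no statement,
definition or attribute is edited; no new named fact; the ledger's debt table listed the fact
unproved). [cite: Zhang2022LandauSiegel, §16 p.93] -/
theorem _root_.Literature.NumberTheory.LFunctions.Zhang2022.Typed.Section16B.Step16_u032_holds :
    Step16_u032 c' :=
  _root_.Literature.NumberTheory.LFunctions.Zhang2022.Typed.Section16B.step16_u032_holds (c' := c')

/-! ### `|𝔭| ≥ 1/2` and the edge Lemma 16.1 ⇒ `|𝓜₂*(s)| ≫ 1` -/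

/-- The comparison factors `g(q) = 1 − 1/(q−1)²` (`q ≠ 2`), `g(2) = 1`. [folklore] -/
private def gfac (q : ℕ) : ℝ := if q = 2 then 1 else 1 - 1 / (((q : ℝ) - 1) ^ 2)

/-- `g(q) ≥ 0` for a prime `q`. [folklore] -/
private theorem gfac_nonneg {q : ℕ} (hq : q.Prime) : 0 ≤ gfac q := by
  unfold gfac
  split_ifs with h
  · exact zero_le_one
  · have h3 : (3 : ℝ) ≤ q := by exact_mod_cast hq.two_le.lt_of_ne' h |>.nat_succ_le
    have h2 : (2 : ℝ) ≤ (q : ℝ) - 1 := by linarith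
    have : 1 / (((q : ℝ) - 1) ^ 2) ≤ 1 := by
      rw [div_le_one (by positivity)]
      nlinarith
    linarith

/-- `g(q) ≤ 1`. [folklore] -/
private theorem gfac_le_one (q : ℕ) : gfac q ≤ 1 := by
  unfold gfac
  split_ifs
  · exact le_rfl
  · have : 0 ≤ 1 / (((q : ℝ) - 1) ^ 2) := by positivity
    linarith

/-- The value of the local factor of `𝔭` in the three cases `χ(q) ∈ {0, 1, −1}`. [folklore] -/
private theorem frakpFactor_of_eq_zero {D : ℕ} (χ : DirichletCharacter ℂ D) {q : ℕ}
    (h : χ (q : ZMod D) = 0) : frakpFactor χ q = 1 := by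
  simp [frakpFactor, h]

/-- `χ(q) = 1`: the factor is `q(q−2)/(q−1)²`. [folklore] -/
private theorem frakpFactor_of_eq_one {D : ℕ} (χ : DirichletCharacter ℂ D) {q : ℕ} (hq : 2 ≤ q)
    (h : χ (q : ZMod D) = 1) :
    frakpFactor χ q = (((q : ℝ) * ((q : ℝ) - 2) / (((q : ℝ) - 1) ^ 2) : ℝ) : ℂ) := by
  have hq0 : (q : ℂ) ≠ 0 := by exact_mod_cast (by omega : q ≠ 0)
  have hq1 : (q : ℂ) - 1 ≠ 0 := sub_ne_zero.mpr (by exact_mod_cast (by omega : q ≠ 1))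
  simp only [frakpFactor, h, one_mul]
  push_cast
  field_simp
  ring

/-- `χ(q) = −1`: the factor is `q²/((q+1)(q−1))`. [folklore] -/
private theorem frakpFactor_of_eq_neg_one {D : ℕ} (χ : DirichletCharacter ℂ D) {q : ℕ} (hq : 2 ≤ q)
    (h : χ (q : ZMod D) = -1) :
    frakpFactor χ q = (((q : ℝ) ^ 2 / (((q : ℝ) + 1) * ((q : ℝ) - 1)) : ℝ) : ℂ) := by
  have hq0 : (q : ℂ) ≠ 0 := by exact_mod_cast (by omega : q ≠ 0)
  have hq1 : (q : ℂ) - 1 ≠ 0 := sub_ne_zero.mpr (by exact_mod_cast (by omega : q ≠ 1))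
  have hq2 : (q : ℂ) + 1 ≠ 0 := Nat.cast_add_one_ne_zero q
  simp only [frakpFactor, h]
  push_cast
  field_simp
  ring

/-- For a quadratic `χ` and a prime `q` with `¬(q = 2 ∧ χ(2) = 1)`: `g(q) ≤ ‖frakpFactor χ q‖`.
[folklore] -/
private theorem gfac_le_norm_frakpFactor {D : ℕ} (χ : DirichletCharacter ℂ D) (hχ : χ.IsQuadratic)
    {q : ℕ} (hq : q.Prime) (h2 : q = 2 → χ (2 : ZMod D) ≠ 1) :
    gfac q ≤ ‖frakpFactor χ q‖ := by
  have hq2 : 2 ≤ q := hq.two_le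
  rcases hχ (q : ZMod D) with h0 | h1 | hm1
  · rw [frakpFactor_of_eq_zero χ h0, norm_one]
    exact gfac_le_one q
  · -- χ(q) = 1: then q ≠ 2
    have hne : q ≠ 2 := by
      intro hq'
      subst hq'
      exact h2 rfl (by simpa using h1)
    have h3 : (3 : ℝ) ≤ q := by exact_mod_cast hq2.lt_of_ne' hne |>.nat_succ_le
    have hnn : 0 ≤ (q : ℝ) * ((q : ℝ) - 2) / (((q : ℝ) - 1) ^ 2) :=
      div_nonneg (mul_nonneg (by positivity) (by linarith)) (sq_nonneg _)
    rw [frakpFactor_of_eq_one χ hq2 h1, Complex.norm_real, Real.norm_eq_abs,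
      abs_of_nonneg hnn, gfac, if_neg hne]
    have hq1 : (0 : ℝ) < (q : ℝ) - 1 := by linarith
    rw [show (1 : ℝ) - 1 / ((q : ℝ) - 1) ^ 2 = (q * ((q : ℝ) - 2)) / ((q : ℝ) - 1) ^ 2 by
      field_simp; ring]
  · rw [frakpFactor_of_eq_neg_one χ hq2 hm1, Complex.norm_real, Real.norm_eq_abs]
    have hq1 : 0 < ((q : ℝ) + 1) * ((q : ℝ) - 1) := by
      have : (2 : ℝ) ≤ q := by exact_mod_cast hq2
      nlinarith
    rw [abs_of_nonneg (by positivity)]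
    refine le_trans (gfac_le_one q) ?_
    rw [le_div_iff₀ hq1]
    nlinarith


/-! ### `∏_{q} g(q) ≥ 1/2` over any finite set of primes -/

/-- `h(n) = 1 − 1/n²`. [folklore] -/
private def hfac (n : ℕ) : ℝ := 1 - 1 / ((n : ℝ) ^ 2)

/-- Telescoping: `∏_{n=2}^{M} (1 − 1/n²) = (M+1)/(2M)` (`M ≥ 1`). [folklore] -/
private theorem prod_Icc_hfac {M : ℕ} (hM : 1 ≤ M) :
    ∏ n ∈ Finset.Icc 2 M, hfac n = ((M : ℝ) + 1) / (2 * M) := by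
  induction M, hM using Nat.le_induction with
  | base => norm_num
  | succ M hM ih =>
    rw [Finset.prod_Icc_succ_top (by omega), ih, hfac]
    have h0 : (M : ℝ) ≠ 0 := by exact_mod_cast (by omega : M ≠ 0)
    have h1 : (M : ℝ) + 1 ≠ 0 := Nat.cast_add_one_ne_zero M
    push_cast
    field_simp
    ring

/-- `∏_{n=2}^{M} (1 − 1/n²) ≥ 1/2`. [folklore] -/
private theorem half_le_prod_Icc_hfac (M : ℕ) : (1 / 2 : ℝ) ≤ ∏ n ∈ Finset.Icc 2 M, hfac n := by
  rcases Nat.eq_zero_or_pos M with rfl | hM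
  · norm_num
  · rw [prod_Icc_hfac hM]
    have : (0 : ℝ) < M := by exact_mod_cast hM
    rw [div_le_div_iff₀ (by norm_num) (by positivity)]
    nlinarith

/-- `h(n) ≥ 0` for `n ≥ 2`. [folklore] -/
private theorem hfac_nonneg {n : ℕ} (hn : 2 ≤ n) : 0 ≤ hfac n := by
  have h2 : (2 : ℝ) ≤ n := by exact_mod_cast hn
  have : 1 / ((n : ℝ) ^ 2) ≤ 1 := by
    rw [div_le_one (by positivity)]; nlinarith
  unfold hfac; linarith

/-- `h(n) ≤ 1`. [folklore] -/
private theorem hfac_le_one (n : ℕ) : hfac n ≤ 1 := by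
  have : 0 ≤ 1 / ((n : ℝ) ^ 2) := by positivity
  unfold hfac; linarith

/-- For a prime `q ≠ 2`: `g(q) = h(q − 1)`. [folklore] -/
private theorem gfac_eq_hfac {q : ℕ} (hq : q.Prime) (h2 : q ≠ 2) : gfac q = hfac (q - 1) := by
  rw [gfac, if_neg h2, hfac, Nat.cast_pred hq.pos]

/-- **`∏_{q∈S} g(q) ≥ 1/2`** for every finite set `S` of primes: the factors `g(q) = 1 − 1/(q−1)²`
(`q ≥ 3`) are among the factors `1 − 1/n²`, `2 ≤ n ≤ M`, whose product telescopes to `(M+1)/(2M) ≥ 1/2`.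
[folklore] -/
private theorem half_le_prod_gfac (s : Finset Nat.Primes) : (1 / 2 : ℝ) ≤ ∏ q ∈ s, gfac q := by
  classical
  -- drop the prime 2 (factor 1)
  set s' := s.filter (fun q : Nat.Primes => (q : ℕ) ≠ 2) with hs'
  have hdrop : ∏ q ∈ s', gfac q = ∏ q ∈ s, gfac q := by
    refine Finset.prod_filter_of_ne fun q _ hq => ?_
    intro h
    apply hq
    rw [gfac, if_pos h]
  rw [← hdrop]
  -- re-index by `n = q - 1`
  set t : Finset ℕ := s'.image (fun q : Nat.Primes => (q : ℕ) - 1) with ht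
  have hinj : Set.InjOn (fun q : Nat.Primes => (q : ℕ) - 1) ↑s' := by
    intro a _ b _ hab
    have ha1 : 1 ≤ (a : ℕ) := a.2.one_lt.le
    have hb1 : 1 ≤ (b : ℕ) := b.2.one_lt.le
    have : (a : ℕ) = (b : ℕ) := by
      have := hab
      simp only at this
      omega
    exact Subtype.ext this
  have hreidx : ∏ q ∈ s', gfac q = ∏ n ∈ t, hfac n := by
    rw [ht, Finset.prod_image hinj]
    refine Finset.prod_congr rfl fun q hq => ?_
    exact gfac_eq_hfac q.2 (Finset.mem_filter.mp hq).2
  rw [hreidx]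
  -- `t ⊆ [2, M]`
  set M := t.sup id with hM
  have hsub : t ⊆ Finset.Icc 2 M := by
    intro n hn
    rw [Finset.mem_Icc]
    refine ⟨?_, Finset.le_sup (f := id) hn⟩
    obtain ⟨q, hq, rfl⟩ := Finset.mem_image.mp hn
    have hq2 : (q : ℕ) ≠ 2 := (Finset.mem_filter.mp hq).2
    have := q.2.two_le
    omega
  have ht2 : ∀ n ∈ t, 2 ≤ n := fun n hn => (Finset.mem_Icc.mp (hsub hn)).1
  -- compare the products
  have hsplit := Finset.prod_sdiff (f := hfac) hsub
  have hrest : ∏ n ∈ Finset.Icc 2 M \ t, hfac n ≤ 1 :=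
    Finset.prod_le_one (fun n hn => hfac_nonneg (Finset.mem_Icc.mp (Finset.mem_sdiff.mp hn).1).1)
      fun n _ => hfac_le_one n
  have ht0 : 0 ≤ ∏ n ∈ t, hfac n := Finset.prod_nonneg fun n hn => hfac_nonneg (ht2 n hn)
  calc (1 / 2 : ℝ) ≤ ∏ n ∈ Finset.Icc 2 M, hfac n := half_le_prod_Icc_hfac M
    _ = (∏ n ∈ Finset.Icc 2 M \ t, hfac n) * ∏ n ∈ t, hfac n := hsplit.symm
    _ ≤ 1 * ∏ n ∈ t, hfac n := by gcongr
    _ = ∏ n ∈ t, hfac n := one_mul _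

/-! ### `|𝔭| ≥ 1/2` -/

/-- A convergent product of complex numbers whose finite partial products all have norm `≥ 1/2` has
norm `≥ 1/2`; a non-convergent one is `1` by convention. [folklore] -/
private theorem half_le_norm_tprod {ι : Type*} (f : ι → ℂ)
    (h : ∀ s : Finset ι, (1 / 2 : ℝ) ≤ ‖∏ i ∈ s, f i‖) : (1 / 2 : ℝ) ≤ ‖∏' i, f i‖ := by
  by_cases hm : Multipliable f
  · have hP := hm.hasProd
    rw [HasProd, SummationFilter.unconditional_filter] at hP
    have hclosed : IsClosed {z : ℂ | (1 / 2 : ℝ) ≤ ‖z‖} := isClosed_le continuous_const continuous_norm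
    exact hclosed.mem_of_tendsto hP (Filter.Eventually.of_forall h)
  · rw [tprod_eq_one_of_not_multipliable hm, norm_one]
    norm_num

/-- **`|𝔭| ≥ 1/2`** for every real (quadratic) character `χ`: each Euler factor of `𝔭` is `1`
(`χ(q) = 0`), `q(q−2)/(q−1)² = 1 − 1/(q−1)²` (`χ(q) = 1`, `q ≥ 3`) or `q²/(q²−1) ≥ 1` (`χ(q) = −1`),
the prime `2` contributing `1` or `4/3` in the case `χ(2) ≠ 1` and being replaced by the prefactor
`2` in the case `χ(2) = 1`; so every partial product is `≥ ∏(1 − 1/(q−1)²) ≥ 1/2`.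
[cite: Zhang2022LandauSiegel, §16 Lemma 16.1 p.92] -/
theorem half_le_norm_frakp {D : ℕ} (χ : DirichletCharacter ℂ D) (hχ : χ.IsQuadratic) :
    (1 / 2 : ℝ) ≤ ‖frakp χ‖ := by
  unfold frakp
  split_ifs with h2
  · -- case `χ(2) ≠ 1`
    unfold frakpA
    refine half_le_norm_tprod _ fun s => ?_
    rw [norm_prod]
    refine le_trans (half_le_prod_gfac s) (Finset.prod_le_prod (fun q _ => gfac_nonneg q.2) ?_)
    intro q _
    exact gfac_le_norm_frakpFactor χ hχ q.2 fun _ => h2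
  · -- case `χ(2) = 1`
    unfold frakpB
    rw [norm_mul, RCLike.norm_ofNat]
    have key : (1 / 2 : ℝ) ≤
        ‖∏' q : Nat.Primes, (if (q : ℕ) = 2 then (1 : ℂ) else frakpFactor χ q)‖ := by
      refine half_le_norm_tprod _ fun s => ?_
      rw [norm_prod]
      refine le_trans (half_le_prod_gfac s) (Finset.prod_le_prod (fun q _ => gfac_nonneg q.2) ?_)
      intro q _
      split_ifs with hq
      · rw [norm_one, gfac, if_pos hq]
      · exact gfac_le_norm_frakpFactor χ hχ q.2 fun h' => absurd h' hq
    linarith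

/-! ### The edge: Lemma 16.1 ⇒ `|𝓜₂*(s)| ≫ 1` -/

/-- `T² < P` once `𝓛 ≥ 2` (`T = exp 𝓛^{1.1}`, `P = exp 𝓛⁹`): the choice `d = l = 1` is admissible in
Lemma 16.1's (vacuous) hypothesis `dl < PT⁻²`. [cite: Zhang2022LandauSiegel, §6 p.12] -/
theorem bigT_sq_lt_bigP {D : ℕ} (hℓ : 2 ≤ ell D) : bigT D ^ 2 < bigP D := by
  rw [bigT, bigP, ← Real.exp_nat_mul, Real.exp_lt_exp]
  have h1 : (1 : ℝ) ≤ ell D := by linarith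
  have hr : ell D ^ (1.1 : ℝ) ≤ ell D ^ (2 : ℝ) :=
    Real.rpow_le_rpow_of_exponent_le h1 (by norm_num)
  rw [Real.rpow_two] at hr
  have h9 : ell D ^ 9 = ell D ^ 2 * ell D ^ 7 := by ring
  have h7 : (2 : ℝ) ^ 7 ≤ ell D ^ 7 := pow_le_pow_left₀ (by norm_num) hℓ 7
  push_cast
  nlinarith [pow_pos (by linarith : (0 : ℝ) < ell D) 2]


/-- For `D ≥ ⌈exp L⌉`, `𝓛 = log D ≥ L`. [folklore] -/
private theorem le_ell_of_ceil_exp_le {L : ℝ} {D : ℕ} (hD : ⌈Real.exp L⌉₊ ≤ D) : L ≤ ell D := by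
  have h1 : Real.exp L ≤ D := le_trans (Nat.le_ceil _) (by exact_mod_cast hD)
  have hD0 : (0 : ℝ) < D := lt_of_lt_of_le (Real.exp_pos L) h1
  rw [ell, Real.le_log_iff_exp_le hD0]
  exact h1

/-- **Lemma 16.1 ⇒ "`|𝓜₂*(s)| ≫ 1` if `|s − 1| < 5α`"** (§16 p. 93, tex L4592: "As a direct consequence
of Lemma 16.1"), kernel-checked with the explicit constant `1/4`: `|𝔭| ≥ 1/2` (`half_le_norm_frakp`) and
`|𝓜₂*(s) − 𝔭| ≤ C𝓛⁻⁸ ≤ 1/4` for `𝓛 ≥ 4max(C,0) + 2` (taking `d = l = 1` in Lemma 16.1, admissible since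
`T² < P`). [cite: Zhang2022LandauSiegel, §16 p.93] -/
theorem inline16_calM2starLarge_of_lemma161 (h : Lemma161 c') : Inline16_calM2starLarge c' := by
  obtain ⟨C, D₀, hC⟩ := h
  set L : ℝ := 4 * max C 0 + 2 with hL
  refine ⟨1 / 4, by norm_num, max D₀ ⌈Real.exp L⌉₊, fun D _ χ hD hq hp hA s hs => ?_⟩
  have hD₀ : D₀ ≤ D := le_trans (le_max_left _ _) hD
  have hℓ : L ≤ ell D := le_ell_of_ceil_exp_le (le_trans (le_max_right _ _) hD)
  have hC0 : 0 ≤ max C 0 := le_max_right _ _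
  have hℓ2 : 2 ≤ ell D := by linarith
  have hℓ1 : 1 ≤ ell D := by linarith
  -- `d = l = 1` is admissible: `1 < P/T²`
  have hdl : ((1 * 1 : ℕ) : ℝ) < bigP D / bigT D ^ 2 := by
    have hT : 0 < bigT D ^ 2 := pow_pos (Real.exp_pos _) 2
    rw [Nat.cast_mul, Nat.cast_one, mul_one, lt_div_iff₀ hT, one_mul]
    exact bigT_sq_lt_bigP hℓ2
  have key : ‖calM2star c' χ s - frakp χ‖ ≤ C * (ell D ^ 8)⁻¹ :=
    hC D χ hD₀ hq hp hA 1 1 le_rfl le_rfl hdl s hs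
  -- `C 𝓛⁻⁸ ≤ 1/4`
  have hpow : ell D ≤ ell D ^ 8 := by
    calc ell D = ell D ^ 1 := (pow_one _).symm
      _ ≤ ell D ^ 8 := pow_le_pow_right₀ hℓ1 (by norm_num)
  have hℓ8 : 0 < ell D ^ 8 := lt_of_lt_of_le (by linarith) hpow
  have hsmall : C * (ell D ^ 8)⁻¹ ≤ 1 / 4 := by
    calc C * (ell D ^ 8)⁻¹ ≤ max C 0 * (ell D ^ 8)⁻¹ := by
          gcongr
          exact le_max_left _ _
      _ = max C 0 / ell D ^ 8 := by rw [div_eq_mul_inv]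
      _ ≤ max C 0 / ell D := by gcongr
      _ ≤ 1 / 4 := by
          rw [div_le_div_iff₀ (by linarith) (by norm_num)]
          nlinarith
  have hp2 := half_le_norm_frakp χ hq
  have htri : ‖frakp χ‖ - ‖calM2star c' χ s‖ ≤ ‖calM2star c' χ s - frakp χ‖ := by
    rw [← norm_sub_rev]
    exact norm_sub_norm_le _ _
  linarith

/-! ### `(pt₀)^{β₁} = −1 + O(α𝓛)` -/

/-- Membership in the prime window gives `P < p < P(1 + 𝓛⁻⁶⁸)`. [cite: Zhang2022LandauSiegel, §2 p.4] -/
theorem bounds_of_mem_primeWindow {D p : ℕ} (hp : p ∈ primeWindow D) :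
    bigP D < p ∧ (p : ℝ) < bigP D * (1 + (ell D ^ 68)⁻¹) := by
  have h := (Finset.mem_filter.mp hp).1
  rw [Finset.mem_Ioo] at h
  have hP : 0 ≤ bigP D := (Real.exp_pos _).le
  exact ⟨(Nat.floor_lt hP).mp h.1, Nat.lt_ceil.mp h.2⟩

/-- `|e^{iθ} + 1| ≤ |θ − π|`. [folklore] -/
private theorem norm_exp_I_add_one_le (θ : ℝ) : ‖Complex.exp ((θ : ℂ) * I) + 1‖ ≤ |θ - Real.pi| := by
  have h : Complex.exp ((θ : ℂ) * I) + 1 = -(Complex.exp (I * ((θ - Real.pi : ℝ) : ℂ)) - 1) := by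
    have e : Complex.exp ((θ : ℂ) * I) =
        Complex.exp (Real.pi * I) * Complex.exp (I * ((θ - Real.pi : ℝ) : ℂ)) := by
      rw [← Complex.exp_add]
      congr 1
      push_cast
      ring
    rw [e, Complex.exp_pi_mul_I]
    ring
  rw [h, norm_neg]
  simpa using Real.norm_exp_I_mul_ofReal_sub_one_le (x := θ - Real.pi)

/-- **"`(pt₀)^{β₁} = −1 + O(α₁)`" holds** (§16 p. 95, tex L4686; `α₁ = α𝓛`): for `p ∼ P`,
`(pt₀)^{β₁} = exp{iα(1 − 5c′α𝓛)(log p + log t₀)}` with `α log p = π + O(α𝓛⁻⁶⁸)` (`P < p < P(1+𝓛⁻⁶⁸)`,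
`α log P = π`), `α log t₀ = 519α log 𝓛 ≤ 519α𝓛`, and `|e^{iθ} + 1| ≤ |θ − π|`; explicit constant
`C = 520 + 5|c′|(π + 520)` for `𝓛 ≥ 2`. Kernel discharge of the inline claim feeding (16.17).
[cite: Zhang2022LandauSiegel, §16 (16.17) p.95] -/
theorem inline16_ptPowBeta1_holds : Inline16_ptPowBeta1 c' := by
  refine ⟨520 + 5 * |c'| * (Real.pi + 520), ⌈Real.exp 2⌉₊, fun D _ χ hD _ _ _ p hp => ?_⟩
  have hℓ : 2 ≤ ell D := le_ell_of_ceil_exp_le hD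
  obtain ⟨hPp, hpP⟩ := bounds_of_mem_primeWindow hp
  have hP : 0 < bigP D := Real.exp_pos _
  have hp0 : (0 : ℝ) < p := lt_trans hP hPp
  have hℓ1 : 1 ≤ ell D := by linarith
  have hℓ0 : 0 < ell D := by linarith
  have ht0 : 1 ≤ t0 D := one_le_pow₀ hℓ1
  have ht0pos : 0 < t0 D := by linarith
  have hx : 0 < (p : ℝ) * t0 D := mul_pos hp0 ht0pos
  -- log P = 𝓛⁹, α = π/𝓛⁹
  have hlogP : Real.log (bigP D) = ell D ^ 9 := by rw [bigP, Real.log_exp]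
  have hℓ9 : 0 < ell D ^ 9 := pow_pos hℓ0 9
  have hα : alpha D = Real.pi / ell D ^ 9 := by rw [alpha, hlogP]
  have hαpos : 0 < alpha D := by rw [hα]; positivity
  -- αℓ = π/ℓ⁸, and π/ℓ⁹ ≤ αℓ ≤ 1... we only need: α ≤ α ℓ, α ℓ ≤ 1 is not needed? we need α·ℓ⁻⁶⁸... let us set a := α ℓ
  set a : ℝ := alpha D * ell D with ha
  have ha0 : 0 < a := mul_pos hαpos hℓ0
  have hαle : alpha D ≤ a := by
    rw [ha]; exact le_mul_of_one_le_right hαpos.le hℓ1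
  have ha1 : a ≤ 1 := by
    -- a = πℓ/ℓ⁹ and ℓ⁹ = ℓ⁸·ℓ ≥ 256ℓ ≥ πℓ
    rw [ha, hα, div_mul_eq_mul_div, div_le_iff₀ hℓ9, one_mul]
    have h8 : (2 : ℝ) ^ 8 ≤ ell D ^ 8 := pow_le_pow_left₀ (by norm_num) hℓ 8
    have e9 : ell D ^ 9 = ell D ^ 8 * ell D := by ring
    rw [e9]
    nlinarith [Real.pi_lt_four, Real.pi_pos]
  -- the phase θ
  set k : ℝ := 1 - 5 * c' * alpha D * ell D with hk
  set θ : ℝ := Real.log ((p : ℝ) * t0 D) * (alpha D * k) with hθ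
  have hcpow : (((p : ℝ) * t0 D : ℝ) : ℂ) ^ beta1 c' D = Complex.exp ((θ : ℂ) * I) := by
    rw [Complex.cpow_def_of_ne_zero (by exact_mod_cast hx.ne'), ← Complex.ofReal_log hx.le, beta1, hθ,
      hk]
    congr 1
    push_cast
    ring
  rw [hcpow]
  refine le_trans (norm_exp_I_add_one_le θ) ?_
  -- |θ − π| ≤ C a
  have hlogx : Real.log ((p : ℝ) * t0 D) = Real.log p + Real.log (t0 D) :=
    Real.log_mul hp0.ne' ht0pos.ne'
  -- α log p − π = π (log p − ℓ⁹)/ℓ⁹ with 0 ≤ log p − ℓ⁹ ≤ ℓ⁻⁶⁸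
  have hlogp_lo : ell D ^ 9 ≤ Real.log p := by
    rw [← hlogP]; exact Real.log_le_log hP hPp.le
  have hlogp_hi : Real.log p ≤ ell D ^ 9 + (ell D ^ 68)⁻¹ := by
    have h1 : Real.log p ≤ Real.log (bigP D * (1 + (ell D ^ 68)⁻¹)) := Real.log_le_log hp0 hpP.le
    have h2 : Real.log (bigP D * (1 + (ell D ^ 68)⁻¹)) =
        ell D ^ 9 + Real.log (1 + (ell D ^ 68)⁻¹) := by
      rw [Real.log_mul hP.ne' (by positivity), hlogP]
    have h3 : Real.log (1 + (ell D ^ 68)⁻¹) ≤ (ell D ^ 68)⁻¹ := by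
      have := Real.add_one_le_exp ((ell D ^ 68)⁻¹)
      rw [add_comm] at this
      exact (Real.log_le_iff_le_exp (by positivity)).mpr this
    linarith
  have h68 : (ell D ^ 68)⁻¹ ≤ 1 := by
    apply inv_le_one_of_one_le₀
    exact one_le_pow₀ hℓ1
  -- term 1: |α log p − π| ≤ α ≤ a
  have hT1 : |alpha D * Real.log p - Real.pi| ≤ a := by
    have e : alpha D * Real.log p - Real.pi = alpha D * (Real.log p - ell D ^ 9) := by
      rw [hα]; field_simp
    rw [e, abs_of_nonneg (mul_nonneg hαpos.le (by linarith))]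
    calc alpha D * (Real.log p - ell D ^ 9) ≤ alpha D * 1 :=
          mul_le_mul_of_nonneg_left (by linarith) hαpos.le
      _ ≤ a := by rw [mul_one]; exact hαle
  -- term 2: 0 ≤ α log t₀ ≤ 519 a
  have hlogt0 : Real.log (t0 D) = 519 * Real.log (ell D) := by rw [t0, Real.log_pow]; norm_num
  have hlogℓ : Real.log (ell D) ≤ ell D := (Real.log_le_sub_one_of_pos hℓ0).trans (by linarith)
  have hlogℓ0 : 0 ≤ Real.log (ell D) := Real.log_nonneg hℓ1
  have hT2 : 0 ≤ alpha D * Real.log (t0 D) ∧ alpha D * Real.log (t0 D) ≤ 519 * a := by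
    rw [hlogt0]
    refine ⟨by positivity, ?_⟩
    rw [ha]
    nlinarith
  -- assemble: θ − π = (α log p − π) + α log t₀ − 5c′ a (α log p + α log t₀)
  have hθ' : θ - Real.pi = (alpha D * Real.log p - Real.pi) + alpha D * Real.log (t0 D)
      - 5 * c' * a * (alpha D * Real.log p + alpha D * Real.log (t0 D)) := by
    rw [hθ, hlogx, hk, ha]; ring
  have hS : |alpha D * Real.log p + alpha D * Real.log (t0 D)| ≤ Real.pi + 520 := by
    rw [abs_of_nonneg (by nlinarith [hT2.1, hαpos, hlogp_lo, hℓ9])]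
    have : alpha D * Real.log p ≤ Real.pi + a := by
      have := (abs_le.mp hT1).2; linarith
    linarith [hT2.2]
  rw [hθ']
  calc |alpha D * Real.log p - Real.pi + alpha D * Real.log (t0 D) -
          5 * c' * a * (alpha D * Real.log p + alpha D * Real.log (t0 D))|
      ≤ |alpha D * Real.log p - Real.pi| + |alpha D * Real.log (t0 D)| +
          |5 * c' * a * (alpha D * Real.log p + alpha D * Real.log (t0 D))| := by
        refine le_trans (abs_sub _ _) ?_
        gcongr
        exact abs_add_le _ _
    _ ≤ a + 519 * a + 5 * |c'| * a * (Real.pi + 520) := by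
        gcongr
        · rw [abs_of_nonneg hT2.1]; exact hT2.2
        · rw [abs_mul, abs_mul, abs_mul, abs_of_pos ha0, abs_of_pos (by norm_num : (0:ℝ) < 5)]
          gcongr
    _ = (520 + 5 * |c'| * (Real.pi + 520)) * (alpha D * ell D) := by rw [ha]; ring

/-- `Inline16_ptPowBeta1` — `_holds` alias of `inline16_ptPowBeta1_holds` above under the fact's exact name (appended
2026-08-28, D-0026 bookkeeping: the proof term is the existing theorem of this file; no statement,
definition or attribute is edited; no new named fact; the ledger's debt table listed the fact
unproved). [cite: Zhang2022LandauSiegel, §16 (16.17) p.95] -/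
theorem _root_.Literature.NumberTheory.LFunctions.Zhang2022.Typed.Section16B.Inline16_ptPowBeta1_holds :
    Inline16_ptPowBeta1 c' :=
  _root_.Literature.NumberTheory.LFunctions.Zhang2022.Typed.Section16B.inline16_ptPowBeta1_holds (c' := c')


/-! ### The edge `|𝓜₂*(1−β_j)| ≫ 1 ⇒ (16.13)` -/

/-- `‖β₁‖ < 5α` and `‖β₂‖ < 5α` once `𝓛 ≥ π(5|c′| + 1)` (then `5|c′|α𝓛 < 1`): the points
`s = 1 − β_j`, `j = 1, 2`, lie in the disc `|s − 1| < 5α` of Lemma 16.1.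
[cite: Zhang2022LandauSiegel, §2 (2.13), §16 p.93] -/
theorem norm_betaJ_lt_five_alpha {c' : ℝ} {D : ℕ} (hℓ2 : 2 ≤ ell D)
    (hℓ : Real.pi * (5 * |c'| + 1) ≤ ell D) {j : ℕ} (hj : j ∈ ({1, 2} : Finset ℕ)) :
    ‖betaJ c' D j‖ < 5 * alpha D := by
  have hℓ0 : 0 < ell D := by linarith
  have hℓ1 : 1 ≤ ell D := by linarith
  have hℓ9 : 0 < ell D ^ 9 := pow_pos hℓ0 9
  have hα : alpha D = Real.pi / ell D ^ 9 := by rw [alpha, bigP, Real.log_exp]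
  have hαpos : 0 < alpha D := by rw [hα]; positivity
  -- `α𝓛 ≤ π/𝓛 ≤ 1/(5|c'|+1)`
  have haℓ : alpha D * ell D * (5 * |c'| + 1) ≤ 1 := by
    rw [hα]
    have e9 : ell D ^ 9 = ell D ^ 8 * ell D := by ring
    have h8 : ell D ≤ ell D ^ 8 := by
      calc ell D = ell D ^ 1 := (pow_one _).symm
        _ ≤ ell D ^ 8 := pow_le_pow_right₀ hℓ1 (by norm_num)
    rw [div_mul_eq_mul_div, div_mul_eq_mul_div, div_le_one hℓ9, e9]
    have : Real.pi * (5 * |c'| + 1) * ell D ≤ ell D * ell D :=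
      mul_le_mul_of_nonneg_right hℓ hℓ0.le
    nlinarith [Real.pi_pos, abs_nonneg c']
  have hca : |c'| * (alpha D * ell D) ≤ 1 / 5 := by nlinarith [abs_nonneg c', mul_pos hαpos hℓ0]
  have hI : ‖(I : ℂ)‖ = 1 := Complex.norm_I
  simp only [Finset.mem_insert, Finset.mem_singleton] at hj
  rcases hj with rfl | rfl
  · -- β₁ = iα(1 − 5c′α𝓛)
    simp only [betaJ, Nat.one_mod, if_true, beta1]
    rw [norm_mul, norm_mul, hI, one_mul, Complex.norm_real, Complex.norm_real, Real.norm_eq_abs,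
      Real.norm_eq_abs, abs_of_pos hαpos]
    have : |1 - 5 * c' * alpha D * ell D| ≤ 2 := by
      rw [abs_le]
      have h1 : |5 * c' * alpha D * ell D| ≤ 1 := by
        rw [show 5 * c' * alpha D * ell D = 5 * (c' * (alpha D * ell D)) by ring, abs_mul,
          abs_of_pos (by norm_num : (0:ℝ) < 5), abs_mul, abs_of_pos (mul_pos hαpos hℓ0)]
        linarith
      constructor <;> linarith [(abs_le.mp h1).1, (abs_le.mp h1).2]
    nlinarith
  · -- β₂ = 2iα(1 + c′α𝓛)
    simp only [betaJ, Nat.reduceMod, if_true, beta2, show (2 : ℕ) ≠ 1 by norm_num, if_false]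
    rw [norm_mul, norm_mul, norm_mul, hI, mul_one, Complex.norm_real, Complex.norm_real,
      Real.norm_eq_abs, Real.norm_eq_abs, abs_of_pos hαpos, RCLike.norm_ofNat]
    have : |1 + c' * alpha D * ell D| ≤ 6 / 5 := by
      rw [abs_le]
      have h1 : |c' * alpha D * ell D| ≤ 1 / 5 := by
        rw [show c' * alpha D * ell D = c' * (alpha D * ell D) by ring, abs_mul,
          abs_of_pos (mul_pos hαpos hℓ0)]
        exact hca
      constructor <;> linarith [(abs_le.mp h1).1, (abs_le.mp h1).2]
    nlinarith

/-- **`|𝓜₂*(s)| ≫ 1` (|s − 1| < 5α) ⇒ (16.13)**, kernel-checked: at `s = 1 − β_j` (`|β_j| < 5α`,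
`norm_betaJ_lt_five_alpha`) the factor `𝓜₂*(1−β_j)` is non-zero, and then
`𝓜₂*(1−β_j)·Σ_n b₁(n)ϖ₂ⱼ(n)/n = Σ_n b₁(n)n⁻¹Σ_{n=dl}λ₂(d)d^{β_j}χ(l)𝓜₂(d,l;1−β_j) = 𝒮₂ⱼ` is exact
algebra ("Thus we can write …", §16 p. 93). With `inline16_calM2starLarge_of_lemma161`:
Lemma 16.1 ⇒ (16.13). [cite: Zhang2022LandauSiegel, §16 (16.13) p.93] -/
theorem eq16_13_of_calM2starLarge (h : Inline16_calM2starLarge c') : Eq16_13 c' := by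
  obtain ⟨c, hc, D₀, hC⟩ := h
  refine ⟨max D₀ ⌈Real.exp (max 2 (Real.pi * (5 * |c'| + 1)))⌉₊, fun D _ χ hD hq hp hA j hj => ?_⟩
  have hD₀ : D₀ ≤ D := le_trans (le_max_left _ _) hD
  have hL := le_ell_of_ceil_exp_le (le_trans (le_max_right _ _) hD)
  have hℓ2 : 2 ≤ ell D := le_trans (le_max_left _ _) hL
  have hℓ : Real.pi * (5 * |c'| + 1) ≤ ell D := le_trans (le_max_right _ _) hL
  -- `𝓜₂*(1 − β_j) ≠ 0`
  have hs : ‖(1 - betaJ c' D j) - 1‖ < 5 * alpha D := by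
    rw [sub_sub_cancel_left, norm_neg]
    exact norm_betaJ_lt_five_alpha hℓ2 hℓ hj
  have hM : calM2star c' χ (1 - betaJ c' D j) ≠ 0 := by
    intro h0
    have := hC D χ hD₀ hq hp hA (1 - betaJ c' D j) hs
    rw [h0, norm_zero] at this
    linarith
  -- the algebra
  rw [calS2, Finset.mul_sum]
  refine Finset.sum_congr rfl fun n _ => ?_
  rw [varpi2, ← Finset.sum_div]
  field_simp

/-- **Lemma 16.1 ⇒ (16.13)** (the two edges composed). [cite: Zhang2022LandauSiegel, §16 (16.13) p.93] -/
theorem eq16_13_of_lemma161 (h : Lemma161 c') : Eq16_13 c' :=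
  eq16_13_of_calM2starLarge c' (inline16_calM2starLarge_of_lemma161 c' h)


/-! ### G-L4t5-1: the repaired u037 and the summed edge to (16.15) -/

/-- `τ₃(n) = Σ_{m∣n} τ₂(m)` (the 3-fold divisor function), as a real number. [folklore] -/
def tau3R (n : ℕ) : ℝ := ∑ m ∈ n.divisors, (m.divisors.card : ℝ)

/-- `τ₃(n) ≥ 0`. [folklore] -/
private theorem tau3R_nonneg (n : ℕ) : 0 ≤ tau3R n :=
  Finset.sum_nonneg fun _ _ => Nat.cast_nonneg _

/-- `τ₃(n) ≥ 1` for `n ≥ 1` (the divisor `m = 1` contributes `τ₂(1) = 1`). [folklore] -/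
private theorem one_le_tau3R {n : ℕ} (hn : 1 ≤ n) : 1 ≤ tau3R n := by
  unfold tau3R
  have h1 : (1 : ℕ) ∈ n.divisors := Nat.one_mem_divisors.mpr (by omega)
  calc (1 : ℝ) = ((1 : ℕ).divisors.card : ℝ) := by simp
    _ ≤ ∑ m ∈ n.divisors, (m.divisors.card : ℝ) :=
        Finset.single_le_sum (f := fun m : ℕ => (m.divisors.card : ℝ)) (fun _ _ => Nat.cast_nonneg _) h1

/-- **u037 REPAIRED (GAP row G-L4t5-1)** — what (16.14) and "the innermost sum in (16.14) is
`1 + O(1/𝓛⁷)`" actually give for EACH `n₁ ∈ 𝒩(𝔮)`, `n₁ < T`: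
`Σ_{(n,𝔮)=1} b₁(n₁n)ϖ₂ⱼ(n)/n = 𝔢ⱼ Σ_{m₁∣n₁} χ(m₁)τ₂(m₁) + O(τ₃(n₁)𝓛⁻⁷ + D^{−c})` — the error
NON-uniform in `n₁` through `τ₃(n₁) = Σ_{m₁∣n₁}τ₂(m₁)` (the printed display `Step16_u037` claims a
uniform `O(1/𝓛⁴)`, which does not follow: `τ₃(n₁)` is unbounded in powers of `𝓛` on `𝒩(𝔮) ∩ [1,T)`).
NOT PRINTED — the campaign's repaired reading (plan/GAP-LEDGER.md G-L4t5-1). CLAIM.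
[cite: Zhang2022LandauSiegel, §16 p.94 (u037), (16.14)] -/
def Step16_u037R : Prop :=
  ∃ c : ℝ, 0 < c ∧ ∃ C : ℝ, ForAllLarge fun D _ χ => AssumptionA D χ → ∀ j ∈ ({1, 2} : Finset ℕ),
    ∀ n₁ : ℕ, n₁ ∈ nset (frakq D) → (n₁ : ℝ) < bigT D →
      ‖(∑ n ∈ (Finset.Ico 1 ⌈bigP D⌉₊).filter (fun n => Nat.Coprime n (frakq D)),
          b1coef c' χ (n₁ * n) * varpi2 c' χ j n / (n : ℂ)) -
        frake j * ∑ m₁ ∈ n₁.divisors, χ (m₁ : ZMod D) * (m₁.divisors.card : ℂ)‖ ≤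
      C * (tau3R n₁ * (ell D ^ 7)⁻¹ + (D : ℝ) ^ (-c))

open scoped Classical in
/-- **The summed majorant behind (16.15)'s `O(1/𝓛)` (GAP row G-L4t5-1)**:
`Σ_{n₁∈𝒩(𝔮), n₁<T} |ϖ₂ⱼ(n₁)|τ₃(n₁)/n₁ ≪ 𝓛⁶` (each Euler factor at a prime `q < D⁴` is
`1 + O(1)/q`, `|ϖ₂ⱼ(q)τ₃(q)| ≤ 2·3`; `∏_{q<D⁴}(1 + 6/q) ≍ 𝓛⁶`). NOT PRINTED — the input that the printed
`O(1/𝓛)` of (16.15) presupposes once u037 is read as `Step16_u037R`. CLAIM.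
[cite: Zhang2022LandauSiegel, §16 (16.15) p.94] -/
def Inline16_varpi2WeightSum : Prop :=
  ∃ C : ℝ, ForAllLarge fun D _ χ => AssumptionA D χ → ∀ j ∈ ({1, 2} : Finset ℕ),
    ∑ n₁ ∈ (Finset.Ico 1 ⌈bigT D⌉₊).filter (fun n₁ => n₁ ∈ nset (frakq D)),
        ‖varpi2 c' χ j n₁‖ * tau3R n₁ / n₁ ≤ C * ell D ^ 6

/-- `(ν∗χ)(n) = Σ_{m∣n} χ(m)τ₂(m)` for `n ≥ 1` (the identity "`1∗χτ₂ = ν∗χ`" unfolded).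
[cite: Zhang2022LandauSiegel, §16 p.94] -/
theorem nuConvChi_eq_sum_divisors {D : ℕ} [NeZero D] (χ : DirichletCharacter ℂ D) {n : ℕ}
    (hn : 1 ≤ n) : nuConvChi χ n = ∑ m ∈ n.divisors, χ (m : ZMod D) * (m.divisors.card : ℂ) := by
  rw [← inline16_oneConvChiTau2_holds D χ n hn, LSeries.convolution_def]
  simp only
  rw [Nat.sum_divisorsAntidiagonal' (f := fun _ b => (1 : ℂ) * (χ (b : ZMod D) * (b.divisors.card : ℂ)))]
  simp

/-- `D^{−c} = e^{−c𝓛} ≤ 1/(c𝓛)` (`c, 𝓛 > 0`). [folklore] -/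
private theorem rpow_neg_le_inv {D : ℕ} {c : ℝ} (hc : 0 < c) (hℓ : 0 < ell D) :
    (D : ℝ) ^ (-c) ≤ (c * ell D)⁻¹ := by
  have hD : (0 : ℝ) < D := by
    have : ell D ≠ 0 := hℓ.ne'
    rw [ell] at this
    by_contra h
    push Not at h
    have h0 : (D : ℝ) = 0 := le_antisymm h (Nat.cast_nonneg D)
    exact this (by rw [h0, Real.log_zero])
  rw [Real.rpow_def_of_pos hD, ← ell]
  have h1 := Real.add_one_le_exp (c * ell D)
  have hpos : 0 < c * ell D := mul_pos hc hℓ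
  rw [show ell D * -c = -(c * ell D) by ring, Real.exp_neg]
  exact inv_anti₀ hpos (by linarith)

/-- `D^{−c}𝓛⁶ = e^{−c𝓛}𝓛⁶ ≤ 7!/(c⁷𝓛)` (`c, 𝓛 > 0`; from `x⁷/7! ≤ eˣ`). [folklore] -/
private theorem rpow_neg_mul_pow_six_le {D : ℕ} {c : ℝ} (hc : 0 < c) (hℓ : 0 < ell D) :
    (D : ℝ) ^ (-c) * ell D ^ 6 ≤ (Nat.factorial 7 : ℝ) / c ^ 7 * (ell D)⁻¹ := by
  have hD : (0 : ℝ) < D := by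
    have : ell D ≠ 0 := hℓ.ne'
    rw [ell] at this
    by_contra h
    push Not at h
    have h0 : (D : ℝ) = 0 := le_antisymm h (Nat.cast_nonneg D)
    exact this (by rw [h0, Real.log_zero])
  rw [Real.rpow_def_of_pos hD, ← ell, show ell D * -c = -(c * ell D) by ring, Real.exp_neg]
  have hpos : 0 < c * ell D := mul_pos hc hℓ
  have h7 := Real.pow_div_factorial_le_exp (c * ell D) (le_of_lt hpos) 7
  have hfac : (0 : ℝ) < Nat.factorial 7 := by positivity
  -- e^{-x} ≤ 7!/x⁷
  have hexp : (Real.exp (c * ell D))⁻¹ ≤ (Nat.factorial 7 : ℝ) / (c * ell D) ^ 7 := by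
    rw [inv_le_comm₀ (Real.exp_pos _) (by positivity), inv_div]
    exact h7
  calc (Real.exp (c * ell D))⁻¹ * ell D ^ 6 ≤ (Nat.factorial 7 : ℝ) / (c * ell D) ^ 7 * ell D ^ 6 := by
        gcongr
    _ = (Nat.factorial 7 : ℝ) / c ^ 7 * (ell D)⁻¹ := by
        field_simp

open scoped Classical in
/-- **The summed edge to (16.15) (GAP row G-L4t5-1)**, kernel-checked bookkeeping: the
`𝒩(𝔮)`-decomposition `Step16_u031` (error `O(D^{−c})`), the REPAIRED per-`n₁` evaluation
`Step16_u037R` (error `O(τ₃(n₁)𝓛⁻⁷ + D^{−c})`), the identity `1∗χτ₂ = ν∗χ` (proved) and the summed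
majorant `Inline16_varpi2WeightSum` (`Σ|ϖ₂ⱼ|τ₃/n₁ ≪ 𝓛⁶`) give (16.15) with its printed `O(1/𝓛)`:
`𝓛⁻⁷·𝓛⁶ = 𝓛⁻¹`, `D^{−c}𝓛⁶ ≪ 𝓛⁻¹`. [cite: Zhang2022LandauSiegel, §16 (16.15) p.94] -/
theorem eq16_15_of_repair (h31 : Step16_u031 c') (h37 : Step16_u037R c')
    (hS : Inline16_varpi2WeightSum c') : Eq16_15 c' := by
  obtain ⟨c₁, hc₁, C₁, D₁, h31⟩ := h31
  obtain ⟨c₂, hc₂, C₂, D₂, h37⟩ := h37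
  obtain ⟨C₃, D₃, hS⟩ := hS
  refine ⟨|C₁| / c₁ + |C₂| * |C₃| * (1 + (Nat.factorial 7 : ℝ) / c₂ ^ 7),
    max (max D₁ D₂) (max D₃ ⌈Real.exp 1⌉₊), fun D _ χ hD hq hp hA j hj => ?_⟩
  have hD₁ : D₁ ≤ D := le_trans (le_trans (le_max_left _ _) (le_max_left _ _)) hD
  have hD₂ : D₂ ≤ D := le_trans (le_trans (le_max_right _ _) (le_max_left _ _)) hD
  have hD₃ : D₃ ≤ D := le_trans (le_trans (le_max_left _ _) (le_max_right _ _)) hD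
  have hℓ1 : 1 ≤ ell D :=
    le_ell_of_ceil_exp_le (le_trans (le_trans (le_max_right _ _) (le_max_right _ _)) hD)
  have hℓ0 : 0 < ell D := by linarith
  have e31 := h31 D χ hD₁ hq hp hA j hj
  have eS := hS D χ hD₃ hq hp hA j hj
  -- notation
  set F := (Finset.Ico 1 ⌈bigT D⌉₊).filter (fun n₁ => n₁ ∈ nset (frakq D)) with hF
  set X := ∑ n ∈ Finset.Ico 1 ⌈bigP D⌉₊, b1coef c' χ n * varpi2 c' χ j n / (n : ℂ) with hX
  set In : ℕ → ℂ := fun n₁ =>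
    ∑ n ∈ (Finset.Ico 1 ⌈bigP D⌉₊).filter (fun n => Nat.Coprime n (frakq D)),
      b1coef c' χ (n₁ * n) * varpi2 c' χ j n / (n : ℂ) with hIn
  -- the per-`n₁` bound
  have e37 : ∀ n₁ ∈ F, ‖In n₁ - frake j * nuConvChi χ n₁‖ ≤
      |C₂| * (tau3R n₁ * (ell D ^ 7)⁻¹ + (D : ℝ) ^ (-c₂)) := by
    intro n₁ hn₁
    obtain ⟨hIco, hns⟩ := Finset.mem_filter.mp hn₁
    have h1 : 1 ≤ n₁ := (Finset.mem_Ico.mp hIco).1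
    have hT : (n₁ : ℝ) < bigT D := Nat.lt_ceil.mp (Finset.mem_Ico.mp hIco).2
    have key := h37 D χ hD₂ hq hp hA j hj n₁ hns hT
    rw [nuConvChi_eq_sum_divisors χ h1]
    refine le_trans key (mul_le_mul_of_nonneg_right (le_abs_self C₂) ?_)
    have := tau3R_nonneg n₁
    positivity
  -- rewrite the difference
  have hsplit : X - frake j * ∑ n₁ ∈ F, varpi2 c' χ j n₁ * nuConvChi χ n₁ / (n₁ : ℂ) =
      (X - ∑ n₁ ∈ F, varpi2 c' χ j n₁ / (n₁ : ℂ) * In n₁) +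
        ∑ n₁ ∈ F, varpi2 c' χ j n₁ / (n₁ : ℂ) * (In n₁ - frake j * nuConvChi χ n₁) := by
    have e1 : ∑ n₁ ∈ F, varpi2 c' χ j n₁ / (n₁ : ℂ) * (In n₁ - frake j * nuConvChi χ n₁) =
        ∑ n₁ ∈ F, varpi2 c' χ j n₁ / (n₁ : ℂ) * In n₁ -
          ∑ n₁ ∈ F, varpi2 c' χ j n₁ / (n₁ : ℂ) * (frake j * nuConvChi χ n₁) := by
      rw [← Finset.sum_sub_distrib]
      exact Finset.sum_congr rfl fun _ _ => by ring
    have e2 : frake j * ∑ n₁ ∈ F, varpi2 c' χ j n₁ * nuConvChi χ n₁ / (n₁ : ℂ) =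
        ∑ n₁ ∈ F, varpi2 c' χ j n₁ / (n₁ : ℂ) * (frake j * nuConvChi χ n₁) := by
      rw [Finset.mul_sum]
      exact Finset.sum_congr rfl fun _ _ => by ring
    rw [e1, e2]
    ring
  rw [hsplit]
  -- main estimate
  have hterm : ∀ n₁ ∈ F, ‖varpi2 c' χ j n₁ / (n₁ : ℂ) * (In n₁ - frake j * nuConvChi χ n₁)‖ ≤
      ‖varpi2 c' χ j n₁‖ * tau3R n₁ / n₁ * (|C₂| * (ell D ^ 7)⁻¹) +
        ‖varpi2 c' χ j n₁‖ * tau3R n₁ / n₁ * (|C₂| * (D : ℝ) ^ (-c₂)) := by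
    intro n₁ hn₁
    obtain ⟨hIco, _⟩ := Finset.mem_filter.mp hn₁
    have h1 : 1 ≤ n₁ := (Finset.mem_Ico.mp hIco).1
    have hn0 : (0 : ℝ) < n₁ := by exact_mod_cast h1
    rw [norm_mul, norm_div, Complex.norm_natCast]
    have hτ := one_le_tau3R h1
    have hϖ : 0 ≤ ‖varpi2 c' χ j n₁‖ / n₁ := by positivity
    calc ‖varpi2 c' χ j n₁‖ / ↑n₁ * ‖In n₁ - frake j * nuConvChi χ n₁‖
        ≤ ‖varpi2 c' χ j n₁‖ / ↑n₁ * (|C₂| * (tau3R n₁ * (ell D ^ 7)⁻¹ + (D : ℝ) ^ (-c₂))) :=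
          mul_le_mul_of_nonneg_left (e37 n₁ hn₁) hϖ
      _ = ‖varpi2 c' χ j n₁‖ * tau3R n₁ / n₁ * (|C₂| * (ell D ^ 7)⁻¹) +
            ‖varpi2 c' χ j n₁‖ / n₁ * (|C₂| * (D : ℝ) ^ (-c₂)) := by ring
      _ ≤ ‖varpi2 c' χ j n₁‖ * tau3R n₁ / n₁ * (|C₂| * (ell D ^ 7)⁻¹) +
            ‖varpi2 c' χ j n₁‖ * tau3R n₁ / n₁ * (|C₂| * (D : ℝ) ^ (-c₂)) := by
          have hdiv : ‖varpi2 c' χ j n₁‖ / n₁ ≤ ‖varpi2 c' χ j n₁‖ * tau3R n₁ / n₁ := by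
            apply div_le_div_of_nonneg_right _ hn0.le
            calc ‖varpi2 c' χ j n₁‖ = ‖varpi2 c' χ j n₁‖ * 1 := (mul_one _).symm
              _ ≤ ‖varpi2 c' χ j n₁‖ * tau3R n₁ := mul_le_mul_of_nonneg_left hτ (norm_nonneg _)
          have hD0 : 0 ≤ |C₂| * (D : ℝ) ^ (-c₂) :=
            mul_nonneg (abs_nonneg _) (Real.rpow_nonneg (Nat.cast_nonneg D) _)
          have := mul_le_mul_of_nonneg_right hdiv hD0
          linarith
  have hsumS : 0 ≤ ∑ n₁ ∈ F, ‖varpi2 c' χ j n₁‖ * tau3R n₁ / n₁ :=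
    Finset.sum_nonneg fun n₁ _ => by
      have := tau3R_nonneg n₁; positivity
  have eS' : ∑ n₁ ∈ F, ‖varpi2 c' χ j n₁‖ * tau3R n₁ / n₁ ≤ |C₃| * ell D ^ 6 :=
    le_trans eS (mul_le_mul_of_nonneg_right (le_abs_self C₃) (by positivity))
  have hexp1 : (D : ℝ) ^ (-c₁) ≤ (c₁ * ell D)⁻¹ := rpow_neg_le_inv hc₁ hℓ0
  have hexp2 : (D : ℝ) ^ (-c₂) * ell D ^ 6 ≤ (Nat.factorial 7 : ℝ) / c₂ ^ 7 * (ell D)⁻¹ :=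
    rpow_neg_mul_pow_six_le hc₂ hℓ0
  have hDc₁ : 0 ≤ (D : ℝ) ^ (-c₁) := Real.rpow_nonneg (Nat.cast_nonneg D) _
  have hDc₂ : 0 ≤ (D : ℝ) ^ (-c₂) := Real.rpow_nonneg (Nat.cast_nonneg D) _
  calc ‖(X - ∑ n₁ ∈ F, varpi2 c' χ j n₁ / (n₁ : ℂ) * In n₁) +
          ∑ n₁ ∈ F, varpi2 c' χ j n₁ / (n₁ : ℂ) * (In n₁ - frake j * nuConvChi χ n₁)‖
      ≤ ‖X - ∑ n₁ ∈ F, varpi2 c' χ j n₁ / (n₁ : ℂ) * In n₁‖ +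
          ∑ n₁ ∈ F, ‖varpi2 c' χ j n₁ / (n₁ : ℂ) * (In n₁ - frake j * nuConvChi χ n₁)‖ :=
        le_trans (norm_add_le _ _) (by gcongr; exact norm_sum_le _ _)
    _ ≤ C₁ * (D : ℝ) ^ (-c₁) +
          ∑ n₁ ∈ F, (‖varpi2 c' χ j n₁‖ * tau3R n₁ / n₁ * (|C₂| * (ell D ^ 7)⁻¹) +
            ‖varpi2 c' χ j n₁‖ * tau3R n₁ / n₁ * (|C₂| * (D : ℝ) ^ (-c₂))) :=
        add_le_add e31 (Finset.sum_le_sum hterm)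
    _ = C₁ * (D : ℝ) ^ (-c₁) +
          (∑ n₁ ∈ F, ‖varpi2 c' χ j n₁‖ * tau3R n₁ / n₁) *
            (|C₂| * (ell D ^ 7)⁻¹ + |C₂| * (D : ℝ) ^ (-c₂)) := by
        rw [Finset.sum_add_distrib, ← Finset.sum_mul, ← Finset.sum_mul]; ring
    _ ≤ |C₁| * (D : ℝ) ^ (-c₁) +
          (|C₃| * ell D ^ 6) * (|C₂| * (ell D ^ 7)⁻¹ + |C₂| * (D : ℝ) ^ (-c₂)) := by
        have i1 : C₁ * (D : ℝ) ^ (-c₁) ≤ |C₁| * (D : ℝ) ^ (-c₁) :=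
          mul_le_mul_of_nonneg_right (le_abs_self _) hDc₁
        have i2 : (∑ n₁ ∈ F, ‖varpi2 c' χ j n₁‖ * tau3R n₁ / n₁) *
              (|C₂| * (ell D ^ 7)⁻¹ + |C₂| * (D : ℝ) ^ (-c₂)) ≤
            (|C₃| * ell D ^ 6) * (|C₂| * (ell D ^ 7)⁻¹ + |C₂| * (D : ℝ) ^ (-c₂)) :=
          mul_le_mul_of_nonneg_right eS' (by positivity)
        linarith
    _ = |C₁| * (D : ℝ) ^ (-c₁) + |C₂| * |C₃| * (ell D ^ 6 * (ell D ^ 7)⁻¹) +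
          |C₂| * |C₃| * ((D : ℝ) ^ (-c₂) * ell D ^ 6) := by ring
    _ ≤ |C₁| * (c₁ * ell D)⁻¹ + |C₂| * |C₃| * (ell D)⁻¹ +
          |C₂| * |C₃| * ((Nat.factorial 7 : ℝ) / c₂ ^ 7 * (ell D)⁻¹) := by
        have e6 : ell D ^ 6 * (ell D ^ 7)⁻¹ = (ell D)⁻¹ := by
          rw [show ell D ^ 7 = ell D ^ 6 * ell D by ring, mul_inv, ← mul_assoc,
            mul_inv_cancel₀ (pow_ne_zero 6 hℓ0.ne'), one_mul]
        rw [e6]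
        have i1 := mul_le_mul_of_nonneg_left hexp1 (abs_nonneg C₁)
        have i3 := mul_le_mul_of_nonneg_left hexp2 (mul_nonneg (abs_nonneg C₂) (abs_nonneg C₃))
        linarith
    _ = (|C₁| / c₁ + |C₂| * |C₃| * (1 + (Nat.factorial 7 : ℝ) / c₂ ^ 7)) * (ell D)⁻¹ := by
        field_simp
        ring

end Discharges

/-! ## The continuation device `acVal`: uniqueness (identity theorem), and Lemma 16.2 ⇒ u039 -/

section AcValUniqueness

/-- On the half-plane of convergence nothing is chosen: `acVal f z = f z` whenever `Re z > 1` (if a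
continuation `U` exists it agrees with `f` there; otherwise `acVal f = f` by definition).
[cite: Zhang2022LandauSiegel, §16 Lemma 16.2 p.94] -/
theorem acVal_eq_self_of_one_lt_re (f : ℂ → ℂ) {z : ℂ} (hz : 1 < z.re) : acVal f z = f z := by
  unfold acVal
  split_ifs with h
  · exact (Classical.choose_spec h).2 z hz
  · rfl

/-- **Uniqueness of the continuation** (identity theorem on the connected open half-plane
`{σ > 9/10}`): if `U` is complex-differentiable on `{σ > 9/10}` and agrees with `f` on `{σ > 1}`, then
`acVal f = U` on `{σ > 9/10}` — so every property Lemma 16.2 asserts of "the" continuation holds of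
`acVal f`, in particular at `s = 1`. [cite: Zhang2022LandauSiegel, §16 Lemma 16.2 p.94] -/
theorem acVal_eq_of_continuation {f U : ℂ → ℂ}
    (hU : DifferentiableOn ℂ U {z : ℂ | 9 / 10 < z.re}) (hUf : ∀ z : ℂ, 1 < z.re → U z = f z)
    {s : ℂ} (hs : 9 / 10 < s.re) : acVal f s = U s := by
  have h : ∃ V : ℂ → ℂ, DifferentiableOn ℂ V {z : ℂ | 9 / 10 < z.re} ∧ ∀ z : ℂ, 1 < z.re → V z = f z :=
    ⟨U, hU, hUf⟩
  obtain ⟨hV, hVf⟩ := acVal_spec h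
  have hopen : IsOpen {z : ℂ | 9 / 10 < z.re} := isOpen_lt continuous_const Complex.continuous_re
  have hpre : IsPreconnected {z : ℂ | 9 / 10 < z.re} :=
    (convex_halfSpace_re_gt (9 / 10)).isPreconnected
  have h2 : (2 : ℂ) ∈ {z : ℂ | 9 / 10 < z.re} := by
    show (9 / 10 : ℝ) < (2 : ℂ).re
    norm_num
  have hev : acVal f =ᶠ[𝓝 (2 : ℂ)] U := by
    have hmem : {z : ℂ | 1 < z.re} ∈ 𝓝 (2 : ℂ) :=
      (isOpen_lt continuous_const Complex.continuous_re).mem_nhds (by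
        show (1 : ℝ) < (2 : ℂ).re
        norm_num)
    filter_upwards [hmem] with z hz
    rw [hVf z hz, hUf z hz]
  exact (hV.analyticOnNhd hopen).eqOn_of_preconnected_of_eventuallyEq (hU.analyticOnNhd hopen)
    hpre h2 hev hs

end AcValUniqueness

/-- **Lemma 16.2 ⇒ Z22:§16.u039** (the value display): the continuation `frakU2 c′ χ j = acVal …` IS the
`U` of Lemma 16.2 on `{σ > 9/10}` (`acVal_eq_of_continuation`), so `𝔲₂ⱼ(1) = frakU2 c′ χ j 1` carries the
printed value `(6/π²)(φ(D)/(D𝔭))∏_{q∣D} q/(q+1) + O(𝓛⁻⁴)` with the same constant. Kernel edge (0 facts).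
[cite: Zhang2022LandauSiegel, §16 Lemma 16.2 p.94] -/
theorem step16_u039_of_lemma162 (h : Lemma162 c') : Step16_u039 c' := by
  obtain ⟨C, D₀, hC⟩ := h
  refine ⟨C, D₀, fun D _ χ hD hq hp hA j hj => ?_⟩
  obtain ⟨U, hU, hUeq, _, hval⟩ := hC D χ hD hq hp hA j hj
  have h1 : frakU2 c' χ j 1 = U 1 :=
    acVal_eq_of_continuation hU hUeq (by
      show (9 / 10 : ℝ) < (1 : ℂ).re
      norm_num)
  rw [h1]
  exact hval

/-- **Lemma 16.2 ⇒ "bounded for `σ > 9/10`" for the chosen continuation**: under `Lemma162`, for all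
large `D` and `j = 1, 2`, `frakU2 c′ χ j` is bounded on `{σ > 9/10}` (the bound of Lemma 16.2's `U`,
transported by `acVal_eq_of_continuation`). [cite: Zhang2022LandauSiegel, §16 Lemma 16.2 p.94] -/
theorem frakU2_bounded_of_lemma162 (h : Lemma162 c') :
    ForAllLarge fun D _ χ => AssumptionA D χ → ∀ j ∈ ({1, 2} : Finset ℕ),
      ∃ B : ℝ, ∀ s : ℂ, 9 / 10 < s.re → ‖frakU2 c' χ j s‖ ≤ B := by
  obtain ⟨C, D₀, hC⟩ := h
  refine ⟨D₀, fun D _ χ hD hq hp hA j hj => ?_⟩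
  obtain ⟨U, hU, hUeq, ⟨B, hB⟩, _⟩ := hC D χ hD hq hp hA j hj
  refine ⟨B, fun s hs => ?_⟩
  have h1 : frakU2 c' χ j s = U s := acVal_eq_of_continuation hU hUeq hs
  rw [h1]
  exact hB s hs

/-- On the line of integration `Re s = 1` of (16.u040) the factor `𝔲₂ⱼ(1+s)` is the convergent printed
series itself (`Re(1+s) = 2 > 1`; `acVal_eq_self_of_one_lt_re`), unconditionally.
[cite: Zhang2022LandauSiegel, §16 p.94] -/
theorem frakU2_one_add_line {D : ℕ} [NeZero D] (χ : DirichletCharacter ℂ D) (j : ℕ) (v : ℝ) :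
    frakU2 c' χ j (1 + (1 + v * I)) = frakU2Series c' χ j (1 + (1 + v * I)) :=
  acVal_eq_self_of_one_lt_re _ (by norm_num)

/-! ## Repair candidates of GAP row G-d57-1 (NOT printed; the printed decls above stay)

Row G-d57-1 of the cell's GAP ledger (plan/GAP-LEDGER.md; sz-d57 00:23Z, lead ACK 00:24Z) records for
Lemma 16.2 that the printed normaliser `(ζ(s)³L(s,χ)³)⁻¹` does not match the local-factor count of the
series `Σ_n ϖ₂ⱼ(n)(ν∗χ)(n)n^{−s}`: at a prime `q` with `D⁴ < q < P`, u034 gives `ϖ₂ⱼ(q) = χ(q) + q^{β_j}`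
(up to `O(D^{−c})`) and `(ν∗χ)(q) = 1 + 2χ(q)`, so the `q^{−s}`-coefficient is
`2 + χ(q) + q^{β_j}(1 + 2χ(q))` = that of `ζ(s)²L(s,χ)·ζ(s−β_j)L(s−β_j,χ)²`, not of `ζ³L³` (`3 + 3χ(q)`).
The "decl wanted" of the row is Lemma 16.2 for the normaliser `ζ(s)²ζ(s−β_j)L(s,χ)L(s−β_j,χ)²`, with the
(16.u040) integrand changed accordingly and the residue bookkeeping of (16.u041) redone. These are typed
here as CLAIM-VARIANTS (suffix `R`), in the pattern of `TypedSection15C`'s repair candidates for the sibling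
row G-L4t3-1 (Lemma 15.3), so that the discharge lane and TEAM B have kernel targets. Nothing in this
section is a statement of the manuscript; each docstring names the row. Kernel facts proved here:
(i) on the line `Re s = 1` the repaired integrand EQUALS the printed one (`integrand16_u040R_eq`), so the
display (16.u040) is the same claim `Step16_u040b` under the repair — only (16.u041a) changes;
(ii) `Lemma162R ⇒ Step16_u039R` (value at `1` of the chosen continuation). -/

section RepairCandidatesGd57

variable {D : ℕ} [NeZero D] (χ : DirichletCharacter ℂ D)

/-- **Repair candidate of G-d57-1 — the normaliser**: `ζ(s)²ζ(s−β_j)L(s,χ)L(s−β_j,χ)²` (sz-d57's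
local-factor count; in place of the printed `ζ(s)³L(s,χ)³`). NOT PRINTED.
[cite: Zhang2022LandauSiegel, §16 Lemma 16.2 p.94] -/
def normaliserR (j : ℕ) (s : ℂ) : ℂ :=
  riemannZeta s ^ 2 * riemannZeta (s - betaJ c' D j) * χ.LFunction s *
    χ.LFunction (s - betaJ c' D j) ^ 2

/-- **Repair candidate of G-d57-1 — the object**: `E₂ⱼ(s) := (ζ(s)²ζ(s−β_j)L(s,χ)L(s−β_j,χ)²)⁻¹ ·
Σ_n ϖ₂ⱼ(n)(ν∗χ)(n)n^{−s}` (the printed series of u038 with the repaired normaliser; meaningful where the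
series converges, `σ > 1`). NOT PRINTED. [cite: Zhang2022LandauSiegel, §16 Lemma 16.2 p.94] -/
def frakU2SeriesR (j : ℕ) (s : ℂ) : ℂ :=
  (normaliserR c' χ j s)⁻¹ * ∑' n : ℕ, varpi2 c' χ j n * nuConvChi χ n / (n : ℂ) ^ s

/-- The value at `s` of the analytic continuation (`acVal`, `σ > 1 → σ > 9/10`) of `frakU2SeriesR`; in
particular `E₂ⱼ(1) = frakU2R c′ χ j 1`. NOT PRINTED (repair candidate of G-d57-1).
[cite: Zhang2022LandauSiegel, §16 Lemma 16.2 p.94] -/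
def frakU2R (j : ℕ) (s : ℂ) : ℂ := acVal (frakU2SeriesR c' χ j) s

/-- **Repair candidate of G-d57-1 — the (16.u040) integrand**:
`ζ(1+s)²ζ(1+s−β_j)L(1+s,χ)L(1+s−β_j,χ)²·E₂ⱼ(1+s)·T^s ω₁(s)/s` (printed: `ζ(1+s)³L(1+s,χ)³𝔲₂ⱼ(1+s)T^sω₁(s)/s`
= `integrand16_u040`). On the line `Re s = 1` the two integrands are EQUAL (`integrand16_u040R_eq`), so the
second equality of (16.u040) for this integrand is literally `Step16_u040b`. NOT PRINTED.
[cite: Zhang2022LandauSiegel, §16 p.94] -/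
def integrand16_u040R (j : ℕ) (s : ℂ) : ℂ :=
  normaliserR c' χ j (1 + s) * frakU2R c' χ j (1 + s) * (bigT D : ℂ) ^ s *
    GaussWeight.omega1 (ell D ^ 30) s / s

end RepairCandidatesGd57

/-- **Repair candidate of G-d57-1 — Lemma 16.2 for the repaired object** ("decl wanted" of the row):
`E₂ⱼ` (= `frakU2SeriesR` on `σ > 1`) has an analytic continuation `U` to `σ > 9/10`, bounded there, with
`U(1) = (6/π²)(φ(D)/(D𝔭))∏_{q∣D} q/(q+1) + O(𝓛⁻⁴)` (the printed value and the printed error, now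
claimed for `E₂ⱼ`; `j = 1, 2`). Same clothing as the printed `Lemma162`. (TEAM B, verify-on-landing
01:14Z: the value clause at `O(𝓛⁻⁴)` is an `O(1)`-scale object — "fine"; the `L′³`-carrying displays
u041aR/u041bR below carry the matching factor `(1 + |L′(1,χ)|)³`, sz-L4-lead IFACE CHECK 01:24Z.)
NOT PRINTED; the App. A proof of Lemma 16.2 is "a sketch only" (u039–u042 of Appendix A compute the
local data `Π₂(l)`), and sz-d57 proves no restatement — typed as a target, not asserted.
[cite: Zhang2022LandauSiegel, §16 Lemma 16.2 p.94] -/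
def Lemma162R : Prop :=
  ∃ C : ℝ, ForAllLarge fun D _ χ => AssumptionA D χ → ∀ j ∈ ({1, 2} : Finset ℕ),
    ∃ U : ℂ → ℂ, DifferentiableOn ℂ U {s : ℂ | 9 / 10 < s.re} ∧
      (∀ s : ℂ, 1 < s.re → U s = frakU2SeriesR c' χ j s) ∧
      (∃ B : ℝ, ∀ s : ℂ, 9 / 10 < s.re → ‖U s‖ ≤ B) ∧
      ‖U 1 - frakU2Main χ‖ ≤ C * (ell D ^ 4)⁻¹

/-- **Repair candidate of G-d57-1 — u039 for the repaired object**: `E₂ⱼ(1) = frakU2R c′ χ j 1 =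
(6/π²)(φ(D)/(D𝔭))∏_{q∣D} q/(q+1) + O(𝓛⁻⁴)`. NOT PRINTED; follows from `Lemma162R`
(`step16_u039R_of_lemma162R`). [cite: Zhang2022LandauSiegel, §16 Lemma 16.2 p.94] -/
def Step16_u039R : Prop :=
  ∃ C : ℝ, ForAllLarge fun D _ χ => AssumptionA D χ → ∀ j ∈ ({1, 2} : Finset ℕ),
    ‖frakU2R c' χ j 1 - frakU2Main χ‖ ≤ C * (ell D ^ 4)⁻¹

/-- **Repair candidate of G-d57-1 — u041a for the repaired integrand** ("the residue bookkeeping redone"):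
after the contour shift "as in the proof of Lemma 8.4", `(2πi)⁻¹∫_{(1)} ζ(1+s)²ζ(1+s−β_j)L(1+s,χ)
L(1+s−β_j,χ)²E₂ⱼ(1+s)T^sω₁(s)ds/s = L′(1,χ)³E₂ⱼ(1) + O(𝓛⁻⁴)` — the printed main term with `𝔲₂ⱼ(1) ↦
E₂ⱼ(1)`. TYPING NOTE (heuristic, for the adjudication; not a verdict): with the repaired normaliser the
integrand has a triple pole at `s = 0` (`ζ(1+s)²/s`) and a simple pole at `s = β_j` (`ζ(1+s−β_j)`); writing
`G(s) = L(1+s,χ)·B(s)`, `B(s) = (sζ(1+s))²ζ(1+s−β_j)L(1+s−β_j,χ)²E₂ⱼ(1+s)T^sω₁(s)`, one has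
`Res_{s=0} = ½G″(0) ≈ L′(1,χ)B′(0)` (the terms with `L(1,χ)` are negligible under (A)), and
`B′(0) = B(0)(ζ′/ζ(1−β_j) + 2L′/L(1−β_j,χ) + log T + O(1)) ≈ (−β_jL′(1,χ)²E₂ⱼ(1))(−1/β_j + log T + O(1))`,
i.e. `Res_{s=0} ≈ L′(1,χ)³E₂ⱼ(1)(1 + O(α𝓛^{1.1}))`, while `Res_{s=β_j}` carries the factor `L(1,χ)²`; so the
printed main term of u041a is the one the repaired integrand produces — TEAM B's independent residue
calculation (plan/ADJ-TEAMS.md § B 00:46Z) reaches the same output `L′(1,χ)³E₂ⱼ(1)(1 + O(α₁))` with the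
`β_j`-pole negligible. ERROR TERM (TEAM B verify-on-landing 01:14Z / sz-L4-lead IFACE CHECK 01:24Z,
"derivability, not faithfulness"): the residue carries RELATIVE error `O(α₁)` on the main term
`L′(1,χ)³E₂ⱼ(1)`, so an ABSOLUTE `O(𝓛⁻⁴)` (the print of u041) would need `|L′(1,χ)| ≤ 𝓛^{1.3}`, which the
cone does not supply; typed with the factor `(1 + |L′(1,χ)|)³` on the printed `𝓛⁻⁴` (TEAM B's single
shape, derivable and consumer-verified: (16.17) is reached in the relative reading `Skeleton.Eval1617Rel`).
NOT PRINTED. [cite: Zhang2022LandauSiegel, §16 p.94] -/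
def Step16_u041aR : Prop :=
  ∃ C : ℝ, ForAllLarge fun D _ χ => AssumptionA D χ → ∀ j ∈ ({1, 2} : Finset ℕ),
    ‖(1 / (2 * π) : ℂ) * (∫ v : ℝ, integrand16_u040R c' χ j (1 + v * I)) -
        deriv χ.LFunction 1 ^ 3 * frakU2R c' χ j 1‖ ≤
      C * (1 + ‖deriv χ.LFunction 1‖) ^ 3 * (ell D ^ 4)⁻¹

/-- **Repair candidate of G-d57-1 — u041b for the repaired object**:
`L′(1,χ)³E₂ⱼ(1) = (𝔞/𝔭)(φ(D)/D)L′(1,χ) + O((1 + |L′(1,χ)|)³𝓛⁻⁴)` — exact algebra from `Step16_u039R` and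
(2.31) `𝔞 = (6/π²)L′(1,χ)²∏_{q∣D} q/(q+1)` (`L′(1,χ)` real), the error being `|L′|³·O(𝓛⁻⁴)`; PROVED
from `Step16_u039R` below (`step16_u041bR_of_u039R`). Error shape per TEAM B 01:14Z (its remark (i):
"by (2.31) the left side is literally `|L′|³·|E₂ⱼ(1) − frakU2Main|`"). NOT PRINTED.
[cite: Zhang2022LandauSiegel, §16 p.94] -/
def Step16_u041bR : Prop :=
  ∃ C : ℝ, ForAllLarge fun D _ χ => AssumptionA D χ → ∀ j ∈ ({1, 2} : Finset ℕ),
    ‖deriv χ.LFunction 1 ^ 3 * frakU2R c' χ j 1 -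
        (frakA χ : ℂ) / frakp χ * ((Nat.totient D : ℂ) / (D : ℂ)) * deriv χ.LFunction 1‖ ≤
      C * (1 + ‖deriv χ.LFunction 1‖) ^ 3 * (ell D ^ 4)⁻¹

/-! ### Kernel facts about the repair candidates (0 facts) -/

section RepairEdges

/-- `Re β_j = 0` (`β_j ∈ {β₁, β₂, β₃}`, `β_k = i b_k`). [cite: Zhang2022LandauSiegel, §8 p.17] -/
theorem betaJ_re_eq_zero (D j : ℕ) : (betaJ c' D j).re = 0 := by
  unfold betaJ
  split_ifs <;> simp [beta1, beta2, beta3]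

/-- The repaired normaliser does not vanish on `Re s > 1` (`ζ(s) ≠ 0`, `L(s,χ) ≠ 0` there, also at
`s − β_j` since `Re β_j = 0`). [cite: Zhang2022LandauSiegel, §16 Lemma 16.2 p.94] -/
theorem normaliserR_ne_zero {D : ℕ} [NeZero D] (χ : DirichletCharacter ℂ D) (j : ℕ) {s : ℂ}
    (hs : 1 < s.re) : normaliserR c' χ j s ≠ 0 := by
  have hs' : 1 < (s - betaJ c' D j).re := by
    rw [Complex.sub_re, betaJ_re_eq_zero, sub_zero]
    exact hs
  have hζ : riemannZeta s ≠ 0 := riemannZeta_ne_zero_of_one_lt_re hs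
  have hζ' : riemannZeta (s - betaJ c' D j) ≠ 0 := riemannZeta_ne_zero_of_one_lt_re hs'
  have hL : χ.LFunction s ≠ 0 :=
    DirichletCharacter.LFunction_ne_zero_of_one_le_re χ (Or.inr (by
      intro h
      rw [h, Complex.one_re] at hs
      exact lt_irrefl _ hs)) hs.le
  have hL' : χ.LFunction (s - betaJ c' D j) ≠ 0 :=
    DirichletCharacter.LFunction_ne_zero_of_one_le_re χ (Or.inr (by
      intro h
      rw [h, Complex.one_re] at hs'
      exact lt_irrefl _ hs')) hs'.le
  unfold normaliserR
  exact mul_ne_zero (mul_ne_zero (mul_ne_zero (pow_ne_zero _ hζ) hζ') hL) (pow_ne_zero _ hL')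

/-- The printed normaliser `ζ(s)³L(s,χ)³` does not vanish on `Re s > 1`.
[cite: Zhang2022LandauSiegel, §16 Lemma 16.2 p.94] -/
theorem zeta_pow_mul_LFunction_pow_ne_zero {D : ℕ} [NeZero D] (χ : DirichletCharacter ℂ D) {s : ℂ}
    (hs : 1 < s.re) : riemannZeta s ^ 3 * χ.LFunction s ^ 3 ≠ 0 := by
  have hζ : riemannZeta s ≠ 0 := riemannZeta_ne_zero_of_one_lt_re hs
  have hL : χ.LFunction s ≠ 0 :=
    DirichletCharacter.LFunction_ne_zero_of_one_le_re χ (Or.inr (by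
      intro h
      rw [h, Complex.one_re] at hs
      exact lt_irrefl _ hs)) hs.le
  exact mul_ne_zero (pow_ne_zero _ hζ) (pow_ne_zero _ hL)

/-- On the line `Re s = 1` the PRINTED integrand of (16.u040) is the Dirichlet series itself times
`T^sω₁(s)/s`: `ζ³L³·𝔲₂ⱼ = Σ_n ϖ₂ⱼ(ν∗χ)n^{−(1+s)}` at `Re(1+s) = 2` (no continuation involved).
[cite: Zhang2022LandauSiegel, §16 p.94] -/
theorem integrand16_u040_eq_series {D : ℕ} [NeZero D] (χ : DirichletCharacter ℂ D) (j : ℕ) (v : ℝ) :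
    integrand16_u040 c' χ j (1 + v * I) =
      (∑' n : ℕ, varpi2 c' χ j n * nuConvChi χ n / (n : ℂ) ^ (1 + (1 + v * I))) *
        (bigT D : ℂ) ^ (1 + v * I) * GaussWeight.omega1 (ell D ^ 30) (1 + v * I) / (1 + v * I) := by
  have hre : 1 < (1 + (1 + v * I) : ℂ).re := by norm_num
  have hne := zeta_pow_mul_LFunction_pow_ne_zero χ hre
  unfold integrand16_u040
  rw [frakU2_one_add_line, frakU2Series, ← mul_assoc (riemannZeta _ ^ 3 * χ.LFunction _ ^ 3),
    mul_inv_cancel₀ hne, one_mul]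

/-- On the line `Re s = 1` the REPAIRED integrand is the same Dirichlet series times `T^sω₁(s)/s`.
[cite: Zhang2022LandauSiegel, §16 p.94] -/
theorem integrand16_u040R_eq_series {D : ℕ} [NeZero D] (χ : DirichletCharacter ℂ D) (j : ℕ) (v : ℝ) :
    integrand16_u040R c' χ j (1 + v * I) =
      (∑' n : ℕ, varpi2 c' χ j n * nuConvChi χ n / (n : ℂ) ^ (1 + (1 + v * I))) *
        (bigT D : ℂ) ^ (1 + v * I) * GaussWeight.omega1 (ell D ^ 30) (1 + v * I) / (1 + v * I) := by
  have hre : 1 < (1 + (1 + v * I) : ℂ).re := by norm_num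
  have hne := normaliserR_ne_zero c' χ j hre
  have hline : frakU2R c' χ j (1 + (1 + v * I)) = frakU2SeriesR c' χ j (1 + (1 + v * I)) :=
    acVal_eq_self_of_one_lt_re _ hre
  unfold integrand16_u040R
  rw [hline, frakU2SeriesR, ← mul_assoc (normaliserR c' χ j _), mul_inv_cancel₀ hne, one_mul]

/-- **The repair does not touch (16.u040)**: on the line of integration the repaired integrand equals the
printed one, for every `D`, `χ`, `j`, `v` — so `Step16_u040b` is verbatim the u040-display of the repaired
chain, and only the residue claim (u041a ↦ `Step16_u041aR`) changes. [cite: Zhang2022LandauSiegel, §16 p.94] -/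
theorem integrand16_u040R_eq {D : ℕ} [NeZero D] (χ : DirichletCharacter ℂ D) (j : ℕ) (v : ℝ) :
    integrand16_u040R c' χ j (1 + v * I) = integrand16_u040 c' χ j (1 + v * I) := by
  rw [integrand16_u040R_eq_series, integrand16_u040_eq_series]

/-- Hence the two line integrals of (16.u040) coincide. [cite: Zhang2022LandauSiegel, §16 p.94] -/
theorem integral_integrand16_u040R_eq {D : ℕ} [NeZero D] (χ : DirichletCharacter ℂ D) (j : ℕ) :
    (∫ v : ℝ, integrand16_u040R c' χ j (1 + v * I)) = ∫ v : ℝ, integrand16_u040 c' χ j (1 + v * I) := by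
  refine integral_congr_ae (Filter.Eventually.of_forall fun v => ?_)
  exact integrand16_u040R_eq c' χ j v

/-- `Lemma162R` supplies the continuation that `frakU2R` chooses (differentiable on `σ > 9/10`, equal to
the repaired formula on `σ > 1`). NOT PRINTED (bookkeeping of the repair candidate).
[cite: Zhang2022LandauSiegel, §16 Lemma 16.2 p.94] -/
theorem frakU2R_spec_of_lemma162R (h : Lemma162R c') :
    ForAllLarge fun D _ χ => AssumptionA D χ → ∀ j ∈ ({1, 2} : Finset ℕ),
      DifferentiableOn ℂ (frakU2R c' χ j) {s : ℂ | 9 / 10 < s.re} ∧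
        ∀ s : ℂ, 1 < s.re → frakU2R c' χ j s = frakU2SeriesR c' χ j s := by
  obtain ⟨C, D₀, hC⟩ := h
  refine ⟨D₀, fun D _ χ hD hq hp hA j hj => ?_⟩
  obtain ⟨U, hU, hUeq, _, _⟩ := hC D χ hD hq hp hA j hj
  exact acVal_spec ⟨U, hU, hUeq⟩

/-- `Lemma162R ⇒ Step16_u039R` (value at `1` of the chosen continuation, by `acVal_eq_of_continuation`).
NOT PRINTED (edge between repair candidates). [cite: Zhang2022LandauSiegel, §16 Lemma 16.2 p.94] -/
theorem step16_u039R_of_lemma162R (h : Lemma162R c') : Step16_u039R c' := by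
  obtain ⟨C, D₀, hC⟩ := h
  refine ⟨C, D₀, fun D _ χ hD hq hp hA j hj => ?_⟩
  obtain ⟨U, hU, hUeq, _, hval⟩ := hC D χ hD hq hp hA j hj
  have h1 : frakU2R c' χ j 1 = U 1 :=
    acVal_eq_of_continuation hU hUeq (by
      show (9 / 10 : ℝ) < (1 : ℂ).re
      norm_num)
  rw [h1]
  exact hval

/-- `Lemma162R ⇒` the chosen continuation `frakU2R` is bounded on `{σ > 9/10}`. NOT PRINTED.
[cite: Zhang2022LandauSiegel, §16 Lemma 16.2 p.94] -/
theorem frakU2R_bounded_of_lemma162R (h : Lemma162R c') :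
    ForAllLarge fun D _ χ => AssumptionA D χ → ∀ j ∈ ({1, 2} : Finset ℕ),
      ∃ B : ℝ, ∀ s : ℂ, 9 / 10 < s.re → ‖frakU2R c' χ j s‖ ≤ B := by
  obtain ⟨C, D₀, hC⟩ := h
  refine ⟨D₀, fun D _ χ hD hq hp hA j hj => ?_⟩
  obtain ⟨U, hU, hUeq, ⟨B, hB⟩, _⟩ := hC D χ hD hq hp hA j hj
  refine ⟨B, fun s hs => ?_⟩
  have h1 : frakU2R c' χ j s = U s := acVal_eq_of_continuation hU hUeq hs
  rw [h1]
  exact hB s hs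

/-- `α₁ = α·log T ≥ 0` (`α = π/log P`, `log P = 𝓛⁹ ≥ 0`, `log T = 𝓛^{1.1} ≥ 0`).
[cite: Zhang2022LandauSiegel, §6 p.12] -/
theorem alpha_mul_log_bigT_nonneg (D : ℕ) : 0 ≤ alpha D * Real.log (bigT D) := by
  have hα : 0 ≤ alpha D := by
    rw [alpha, bigP, Real.log_exp]
    exact div_nonneg Real.pi_pos.le (pow_nonneg (Real.log_natCast_nonneg D) 9)
  have hT : 0 ≤ Real.log (bigT D) := by
    rw [bigT, Real.log_exp]
    exact Real.rpow_nonneg (Real.log_natCast_nonneg D) _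
  exact mul_nonneg hα hT

/-- **`Step16_u039R ⇒ Step16_u041bR`** (PROVED): `L′(1,χ)³E₂ⱼ(1) − (𝔞/𝔭)(φ(D)/D)L′(1,χ) =
L′(1,χ)³·(E₂ⱼ(1) − frakU2Main)` exactly, because `L′(1,χ)³·(6/π²)(φ(D)/(D𝔭))∏_{q∣D}q/(q+1) =
(𝔞/𝔭)(φ(D)/D)L′(1,χ)` by (2.31) (`Lemma171.frakAC_eq`: `𝔞 = (6/π²)L′(1,χ)²∏_{q∣D}q/(q+1)` with `L′(1,χ)`
real for the real primitive `χ`, `D ≥ 3`); hence the error is `|L′|³·C𝓛⁻⁴ ≤ max(C,0)·(1+|L′|)³𝓛⁻⁴`.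
NOT PRINTED (edge between repair candidates of G-d57-1). [cite: Zhang2022LandauSiegel, §16 p.94] -/
theorem step16_u041bR_of_u039R (h : Step16_u039R c') : Step16_u041bR c' := by
  obtain ⟨C, D₀, hC⟩ := h
  refine ⟨max C 0, max D₀ 3, fun D _ χ hD hq hp hA j hj => ?_⟩
  have hD₀ : D₀ ≤ D := le_trans (le_max_left _ _) hD
  have hD3 : 3 ≤ D := le_trans (le_max_right _ _) hD
  have e := hC D χ hD₀ hq hp hA j hj
  have hne : χ ≠ 1 := ne_one_of_isPrimitive_of_three_le hp hD3
  have hAC := Lemma171.frakAC_eq χ hne (MulChar.IsQuadratic.sq_eq_one hq)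
  set L := deriv χ.LFunction 1 with hL
  set E := frakU2R c' χ j 1 with hE
  have hid : L ^ 3 * E - (frakA χ : ℂ) / frakp χ * ((Nat.totient D : ℂ) / (D : ℂ)) * L =
      L ^ 3 * (E - frakU2Main χ) := by
    rw [← hAC, Lemma171.frakAC, frakU2Main]
    push_cast
    ring
  rw [hid, norm_mul, norm_pow]
  have hℓ0 : 0 < ell D := by
    have h3 : (3 : ℝ) ≤ D := by exact_mod_cast hD3
    have : 1 ≤ ell D := by
      rw [ell, Real.le_log_iff_exp_le (by linarith)]
      have := Real.exp_one_lt_d9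
      linarith
    linarith
  have h4 : 0 ≤ (ell D ^ 4)⁻¹ := inv_nonneg.mpr (pow_nonneg hℓ0.le 4)
  have hL0 : 0 ≤ ‖L‖ := norm_nonneg _
  have hC0 : C ≤ max C 0 := le_max_left _ _
  have hM0 : 0 ≤ max C 0 := le_max_right _ _
  have h1 : ‖L‖ ^ 3 ≤ (1 + ‖L‖) ^ 3 := by
    gcongr
    linarith
  calc ‖L‖ ^ 3 * ‖E - frakU2Main χ‖ ≤ (1 + ‖L‖) ^ 3 * (max C 0 * (ell D ^ 4)⁻¹) := by
        refine mul_le_mul h1 (le_trans e (mul_le_mul_of_nonneg_right hC0 h4)) (norm_nonneg _) ?_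
        positivity
    _ = max C 0 * (1 + ‖L‖) ^ 3 * (ell D ^ 4)⁻¹ := by ring

/-- **The repaired u040–u041 chain lands on the printed u042 input, at TEAM B's precision**:
`Step16_u040a ∧ Step16_u040b ∧ Step16_u041aR ∧ Step16_u041bR ⇒
Σ_{n<T} ϖ₂ⱼ(n)(ν∗χ)(n)/n = (𝔞/𝔭)(φ(D)/D)L′(1,χ) + O((1+|L′(1,χ)|)³𝓛⁻⁴)` — via
`integral_integrand16_u040R_eq` (pure bookkeeping: triangle inequality, constants added, `𝓛⁻¹⁰ ≤ 𝓛⁻⁴ ≤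
(1+|L′|)³𝓛⁻⁴` for `𝓛 ≥ 1`). The printed `O(𝓛⁻⁴)` of u042/(16.16) would need `|L′(1,χ)| = O(1)`; the
PRINTED chain does not deliver it either (plan/ADJ-TEAMS.md § B 00:55Z; the consumer (16.17) is unaffected
in its relative reading). [cite: Zhang2022LandauSiegel, §16 p.94] -/
theorem sumLtT_eval_of_repair (h40a : Step16_u040a c') (h40b : Step16_u040b c')
    (h41a : Step16_u041aR c') (h41b : Step16_u041bR c') :
    ∃ C : ℝ, ForAllLarge fun D _ χ => AssumptionA D χ → ∀ j ∈ ({1, 2} : Finset ℕ),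
      ‖(∑ n ∈ Finset.Ico 1 ⌈bigT D⌉₊, varpi2 c' χ j n * nuConvChi χ n / (n : ℂ)) -
          (frakA χ : ℂ) / frakp χ * ((Nat.totient D : ℂ) / (D : ℂ)) * deriv χ.LFunction 1‖ ≤
        C * (1 + ‖deriv χ.LFunction 1‖) ^ 3 * (ell D ^ 4)⁻¹ := by
  obtain ⟨C₁, D₁, h₁⟩ := h40a
  obtain ⟨C₂, D₂, h₂⟩ := h40b
  obtain ⟨C₃, D₃, h₃⟩ := h41a
  obtain ⟨C₄, D₄, h₄⟩ := h41b
  refine ⟨max C₁ 0 + max C₂ 0 + max C₃ 0 + max C₄ 0,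
    max (max (max D₁ D₂) (max D₃ D₄)) 3, fun D _ χ hD hq hp hA j hj => ?_⟩
  have hD₁ : D₁ ≤ D :=
    le_trans (le_trans (le_max_left _ _) (le_max_left _ _)) (le_trans (le_max_left _ _) hD)
  have hD₂ : D₂ ≤ D :=
    le_trans (le_trans (le_max_right _ _) (le_max_left _ _)) (le_trans (le_max_left _ _) hD)
  have hD₃ : D₃ ≤ D :=
    le_trans (le_trans (le_max_left _ _) (le_max_right _ _)) (le_trans (le_max_left _ _) hD)
  have hD₄ : D₄ ≤ D :=
    le_trans (le_trans (le_max_right _ _) (le_max_right _ _)) (le_trans (le_max_left _ _) hD)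
  have hD3 : 3 ≤ D := le_trans (le_max_right _ _) hD
  have e₁ := h₁ D χ hD₁ hq hp hA j hj
  have e₂ := h₂ D χ hD₂ hq hp hA j hj
  have e₃ := h₃ D χ hD₃ hq hp hA j hj
  have e₄ := h₄ D χ hD₄ hq hp hA j hj
  rw [integral_integrand16_u040R_eq] at e₃
  have hℓ : 1 ≤ ell D := by
    have h3 : (3 : ℝ) ≤ D := by exact_mod_cast hD3
    rw [ell, Real.le_log_iff_exp_le (by linarith)]
    have := Real.exp_one_lt_d9
    linarith
  have hℓ0 : 0 < ell D := lt_of_lt_of_le zero_lt_one hℓ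
  have h10 : (ell D ^ 10)⁻¹ ≤ (ell D ^ 4)⁻¹ :=
    inv_anti₀ (pow_pos hℓ0 4) (pow_le_pow_right₀ hℓ (by norm_num))
  have h4 : 0 ≤ (ell D ^ 4)⁻¹ := inv_nonneg.mpr (pow_nonneg hℓ0.le 4)
  -- abbreviations
  set Y := (1 + ‖deriv χ.LFunction 1‖) ^ 3 * (ell D ^ 4)⁻¹ with hY
  have hcube : 1 ≤ (1 + ‖deriv χ.LFunction 1‖) ^ 3 :=
    one_le_pow₀ (le_add_of_nonneg_right (norm_nonneg _))
  have h4Y : (ell D ^ 4)⁻¹ ≤ Y := by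
    calc (ell D ^ 4)⁻¹ = 1 * (ell D ^ 4)⁻¹ := (one_mul _).symm
      _ ≤ Y := mul_le_mul_of_nonneg_right hcube h4
  have hY0 : 0 ≤ Y := le_trans h4 h4Y
  set S := ∑ n ∈ Finset.Ico 1 ⌈bigT D⌉₊, varpi2 c' χ j n * nuConvChi χ n / (n : ℂ) with hS
  set W := ∑' n : ℕ, varpi2 c' χ j n * nuConvChi χ n / (n : ℂ) * (gW D (bigT D / n) : ℂ) with hW
  set J := (1 / (2 * π) : ℂ) * ∫ v : ℝ, integrand16_u040 c' χ j (1 + v * I) with hJ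
  set V := deriv χ.LFunction 1 ^ 3 * frakU2R c' χ j 1 with hV
  set M := (frakA χ : ℂ) / frakp χ * ((Nat.totient D : ℂ) / (D : ℂ)) * deriv χ.LFunction 1 with hM
  have hsplit : S - M = (S - W) + (W - J) + (J - V) + (V - M) := by ring
  calc ‖S - M‖ = ‖(S - W) + (W - J) + (J - V) + (V - M)‖ := by rw [hsplit]
    _ ≤ ‖S - W‖ + ‖W - J‖ + ‖J - V‖ + ‖V - M‖ := by
        have t1 : ‖(S - W) + (W - J)‖ ≤ ‖S - W‖ + ‖W - J‖ := norm_add_le _ _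
        have t2 : ‖(S - W) + (W - J) + (J - V)‖ ≤ ‖(S - W) + (W - J)‖ + ‖J - V‖ := norm_add_le _ _
        have t3 : ‖(S - W) + (W - J) + (J - V) + (V - M)‖ ≤ ‖(S - W) + (W - J) + (J - V)‖ + ‖V - M‖ :=
          norm_add_le _ _
        linarith
    _ ≤ max C₁ 0 * Y + max C₂ 0 * Y + max C₃ 0 * Y + max C₄ 0 * Y := by
        have h10' : 0 ≤ (ell D ^ 10)⁻¹ := inv_nonneg.mpr (pow_nonneg hℓ0.le 10)
        have b₁ : ‖S - W‖ ≤ max C₁ 0 * Y :=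
          le_trans e₁ (le_trans (mul_le_mul_of_nonneg_right (le_max_left _ _) h10')
            (mul_le_mul_of_nonneg_left (le_trans h10 h4Y) (le_max_right _ _)))
        have b₂ : ‖W - J‖ ≤ max C₂ 0 * Y :=
          le_trans e₂ (le_trans (mul_le_mul_of_nonneg_right (le_max_left _ _) h10')
            (mul_le_mul_of_nonneg_left (le_trans h10 h4Y) (le_max_right _ _)))
        have b₃ : ‖J - V‖ ≤ max C₃ 0 * Y := by
          refine le_trans e₃ ?_
          rw [mul_assoc]
          exact mul_le_mul_of_nonneg_right (le_max_left _ _) hY0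
        have b₄ : ‖V - M‖ ≤ max C₄ 0 * Y := by
          refine le_trans e₄ ?_
          rw [mul_assoc]
          exact mul_le_mul_of_nonneg_right (le_max_left _ _) hY0
        exact add_le_add (add_le_add (add_le_add b₁ b₂) b₃) b₄
    _ = (max C₁ 0 + max C₂ 0 + max C₃ 0 + max C₄ 0) * (1 + ‖deriv χ.LFunction 1‖) ^ 3 *
          (ell D ^ 4)⁻¹ := by rw [hY]; ring

end RepairEdges

/-! ### `|𝔭| ≤ 4` -/

section FrakpUpper

/-- `u(n) = n²/(n² − 1)` (`= (1 − 1/n²)⁻¹` for `n ≥ 2`). [folklore] -/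
private def ufac (n : ℕ) : ℝ := (n : ℝ) ^ 2 / ((n : ℝ) ^ 2 - 1)

/-- `u(n) = h(n)⁻¹` for `n ≥ 2`. [folklore] -/
private theorem ufac_eq_inv_hfac {n : ℕ} (hn : 2 ≤ n) : ufac n = (hfac n)⁻¹ := by
  have h2 : (2 : ℝ) ≤ n := by exact_mod_cast hn
  have hn0 : (n : ℝ) ^ 2 ≠ 0 := by positivity
  have hn1 : (n : ℝ) ^ 2 - 1 ≠ 0 := by nlinarith
  rw [ufac, hfac]
  field_simp

/-- `u(n) ≥ 1` for `n ≥ 2`. [folklore] -/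
private theorem one_le_ufac {n : ℕ} (hn : 2 ≤ n) : 1 ≤ ufac n := by
  have h2 : (2 : ℝ) ≤ n := by exact_mod_cast hn
  rw [ufac, le_div_iff₀ (by nlinarith)]
  linarith

/-- `∏_{n=2}^{M} n²/(n²−1) ≤ 2` (the product equals `2M/(M+1)`). [folklore] -/
private theorem prod_Icc_ufac_le_two (M : ℕ) : ∏ n ∈ Finset.Icc 2 M, ufac n ≤ 2 := by
  rcases Nat.eq_zero_or_pos M with rfl | hM
  · norm_num
  · have h := prod_Icc_hfac hM
    have hprod : ∏ n ∈ Finset.Icc 2 M, ufac n = (∏ n ∈ Finset.Icc 2 M, hfac n)⁻¹ := by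
      rw [← Finset.prod_inv_distrib]
      exact Finset.prod_congr rfl fun n hn => ufac_eq_inv_hfac (Finset.mem_Icc.mp hn).1
    rw [hprod, h]
    have hM' : (0 : ℝ) < M := by exact_mod_cast hM
    rw [inv_div, div_le_iff₀ (by positivity)]
    linarith

/-- `‖frakpFactor χ q‖ ≤ q²/(q²−1)` for a prime `q` and a real `χ` (the three cases `χ(q) ∈ {0, 1, −1}`
give `1`, `q(q−2)/(q−1)² ≤ 1`, `q²/(q²−1)`). [folklore] -/
private theorem norm_frakpFactor_le_ufac {D : ℕ} (χ : DirichletCharacter ℂ D) (hχ : χ.IsQuadratic)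
    {q : ℕ} (hq : q.Prime) : ‖frakpFactor χ q‖ ≤ ufac q := by
  have hq2 : 2 ≤ q := hq.two_le
  have h2 : (2 : ℝ) ≤ q := by exact_mod_cast hq2
  rcases hχ (q : ZMod D) with h0 | h1 | hm1
  · rw [frakpFactor_of_eq_zero χ h0, norm_one]
    exact one_le_ufac hq2
  · rw [frakpFactor_of_eq_one χ hq2 h1, Complex.norm_real, Real.norm_eq_abs]
    have hnn : 0 ≤ (q : ℝ) * ((q : ℝ) - 2) / (((q : ℝ) - 1) ^ 2) :=
      div_nonneg (mul_nonneg (by positivity) (by linarith)) (sq_nonneg _)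
    rw [abs_of_nonneg hnn]
    refine le_trans ?_ (one_le_ufac hq2)
    have hpos : 0 < ((q : ℝ) - 1) ^ 2 := by nlinarith
    rw [div_le_one hpos]
    nlinarith
  · rw [frakpFactor_of_eq_neg_one χ hq2 hm1, Complex.norm_real, Real.norm_eq_abs]
    have hq1 : 0 < ((q : ℝ) + 1) * ((q : ℝ) - 1) := by nlinarith
    rw [abs_of_nonneg (by positivity), ufac,
      show ((q : ℝ) + 1) * ((q : ℝ) - 1) = (q : ℝ) ^ 2 - 1 by ring]

/-- `∏_{q ∈ S} q²/(q²−1) ≤ 2` over every finite set `S` of primes. [folklore] -/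
private theorem prod_ufac_le_two (s : Finset Nat.Primes) : ∏ q ∈ s, ufac q ≤ 2 := by
  classical
  set t : Finset ℕ := s.image (fun q : Nat.Primes => (q : ℕ)) with ht
  have hinj : Set.InjOn (fun q : Nat.Primes => (q : ℕ)) ↑s := fun a _ b _ hab => Subtype.ext hab
  have hre : ∏ q ∈ s, ufac q = ∏ n ∈ t, ufac n := by rw [ht, Finset.prod_image hinj]
  rw [hre]
  set M := t.sup id with hM
  have hsub : t ⊆ Finset.Icc 2 M := by
    intro n hn
    rw [Finset.mem_Icc]
    refine ⟨?_, Finset.le_sup (f := id) hn⟩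
    obtain ⟨q, _, rfl⟩ := Finset.mem_image.mp hn
    exact q.2.two_le
  have hsplit := Finset.prod_sdiff (f := ufac) hsub
  have hrest : 1 ≤ ∏ n ∈ Finset.Icc 2 M \ t, ufac n :=
    Finset.prod_induction _ (fun x => 1 ≤ x) (fun a b ha hb => one_le_mul_of_one_le_of_one_le ha hb)
      le_rfl fun n hn => one_le_ufac (Finset.mem_Icc.mp (Finset.mem_sdiff.mp hn).1).1
  have ht0 : 0 ≤ ∏ n ∈ t, ufac n :=
    Finset.prod_nonneg fun n hn => le_trans zero_le_one (one_le_ufac (Finset.mem_Icc.mp (hsub hn)).1)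
  calc ∏ n ∈ t, ufac n = 1 * ∏ n ∈ t, ufac n := (one_mul _).symm
    _ ≤ (∏ n ∈ Finset.Icc 2 M \ t, ufac n) * ∏ n ∈ t, ufac n :=
        mul_le_mul_of_nonneg_right hrest ht0
    _ = ∏ n ∈ Finset.Icc 2 M, ufac n := hsplit
    _ ≤ 2 := prod_Icc_ufac_le_two M

/-- A convergent product of complex numbers whose finite partial products all have norm `≤ B`
(`B ≥ 1`) has norm `≤ B`; a non-convergent one is `1`. [folklore] -/
private theorem norm_tprod_le_of_partial {ι : Type*} (f : ι → ℂ) {B : ℝ} (hB : 1 ≤ B)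
    (h : ∀ s : Finset ι, ‖∏ i ∈ s, f i‖ ≤ B) : ‖∏' i, f i‖ ≤ B := by
  by_cases hm : Multipliable f
  · have hP := hm.hasProd
    rw [HasProd, SummationFilter.unconditional_filter] at hP
    have hclosed : IsClosed {z : ℂ | ‖z‖ ≤ B} := isClosed_le continuous_norm continuous_const
    exact hclosed.mem_of_tendsto hP (Filter.Eventually.of_forall h)
  · rw [tprod_eq_one_of_not_multipliable hm, norm_one]
    exact hB

/-- **`|𝔭| ≤ 4`** for every real (quadratic) character `χ`: each Euler factor of `𝔭` has norm
`≤ q²/(q²−1)` and `∏_{2≤n≤M} n²/(n²−1) = 2M/(M+1) ≤ 2`; the prefactor `2` of the case `χ(2) = 1` doubles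
the bound. (With `half_le_norm_frakp`: `1/2 ≤ |𝔭| ≤ 4`.) [cite: Zhang2022LandauSiegel, §16 Lemma 16.1 p.92] -/
theorem norm_frakp_le_four {D : ℕ} (χ : DirichletCharacter ℂ D) (hχ : χ.IsQuadratic) :
    ‖frakp χ‖ ≤ 4 := by
  unfold frakp
  split_ifs with h2
  · unfold frakpA
    refine le_trans (norm_tprod_le_of_partial _ (by norm_num : (1 : ℝ) ≤ 2) fun s => ?_) (by norm_num)
    rw [norm_prod]
    exact le_trans (Finset.prod_le_prod (fun q _ => norm_nonneg _)
      fun q _ => norm_frakpFactor_le_ufac χ hχ q.2) (prod_ufac_le_two s)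
  · unfold frakpB
    rw [norm_mul, RCLike.norm_ofNat]
    have key : ‖∏' q : Nat.Primes, (if (q : ℕ) = 2 then (1 : ℂ) else frakpFactor χ q)‖ ≤ 2 := by
      refine norm_tprod_le_of_partial _ (by norm_num) fun s => ?_
      rw [norm_prod]
      refine le_trans (Finset.prod_le_prod (fun q _ => norm_nonneg _) fun q _ => ?_)
        (prod_ufac_le_two s)
      split_ifs with hq
      · rw [norm_one]
        exact one_le_ufac q.2.two_le
      · exact norm_frakpFactor_le_ufac χ hχ q.2
    linarith

end FrakpUpper

/-! ## The rate that (16.15) transmits: u042 and (16.16) with `O((1+|L′|)³/𝓛)` (NOT printed)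

The printed (16.15) carries `+ O(1/𝓛)` (tex L4636), while the next two displays deduced "by (16.15)" —
u042 (tex L4667) and (16.16) (tex L4671) — print `O(1/𝓛⁴)`. With the printed rates the deduction transmits
`O(1/𝓛)·|𝔢_j|` from (16.15) and the `𝔫(𝔮)`-removal, plus the u040–u041 evaluation error (`O((1+|L′|)³𝓛⁻⁴)`
in the typed-strength reading of TEAM B) and Lemma 16.1's `O(𝓛⁻⁸)·|𝔞𝔢_jL′/𝔭|` — not `O(1/𝓛⁴)`. The §15
sibling of this rate slip is GAP row G-L4t3-3 (`TypedSection15C.Eq15_23R`: (15.23) with the `O(1/𝓛)` that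
(15.22) transmits). As there, the transmitted forms are typed as CLAIM-VARIANTS (suffix `R`), implied by the
printed claims, and — here — PROVED from the displayed inputs, with the uniform error
`C·(1 + |L′(1,χ)|)³·𝓛⁻¹` (no upper bound for `L′(1,χ)` is used; with the classical `|L′| ≪ 𝓛²` this is
`O(𝓛⁵)` absolutely but `O(𝔞/𝓛)` relative to the main terms `∝ 𝔞 ∝ L′(1,χ)²`, which is what the consumer
(16.17) needs in its relative reading `Skeleton.Eval1617Rel`, plan/ADJ-TEAMS.md § B). Nothing in this
section is a statement of the manuscript. -/

/-- `‖𝔢_j‖ ≤ ‖𝔢₁‖ + ‖𝔢₂‖` for `j ∈ {1, 2}` (a uniform constant for the two cases).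
[cite: Zhang2022LandauSiegel, §15 (15.2)] -/
theorem norm_frake_le_of_mem {j : ℕ} (hj : j ∈ ({1, 2} : Finset ℕ)) :
    ‖frake j‖ ≤ ‖frake 1‖ + ‖frake 2‖ := by
  simp only [Finset.mem_insert, Finset.mem_singleton] at hj
  rcases hj with rfl | rfl
  · exact le_add_of_nonneg_right (norm_nonneg _)
  · exact le_add_of_nonneg_left (norm_nonneg _)

/-- `0 ≤ 𝔞 ≤ |L′(1,χ)|²` (`𝔞 = (6/π²)(Re L′(1,χ))²∏_{q∣D}q/(q+1)`, `6/π² ≤ 1`, `∏ ≤ 1`), for every `D`, `χ`.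
[cite: Zhang2022LandauSiegel, §2 (2.31)] -/
theorem frakA_nonneg_and_le_norm_sq {D : ℕ} [NeZero D] (χ : DirichletCharacter ℂ D) :
    0 ≤ frakA χ ∧ frakA χ ≤ ‖deriv χ.LFunction 1‖ ^ 2 := by
  rw [frakA, Lemma171.frakA_def]
  have hprod : ∏ p ∈ D.primeFactors, ((p : ℝ) / (p + 1)) ≤ 1 := by
    refine Finset.prod_le_one (fun p _ => by positivity) (fun p _ => ?_)
    rw [div_le_one (by positivity)]
    linarith
  have hprod0 : 0 ≤ ∏ p ∈ D.primeFactors, ((p : ℝ) / (p + 1)) :=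
    Finset.prod_nonneg fun p _ => by positivity
  have hπ : 6 / Real.pi ^ 2 ≤ 1 := by
    rw [div_le_one (by positivity)]
    nlinarith [Real.pi_gt_three]
  have hπ0 : 0 ≤ 6 / Real.pi ^ 2 := by positivity
  have hre : (deriv χ.LFunction 1).re ^ 2 ≤ ‖deriv χ.LFunction 1‖ ^ 2 := by
    have habs := Complex.abs_re_le_norm (deriv χ.LFunction 1)
    exact sq_le_sq' (abs_le.mp habs).1 (abs_le.mp habs).2
  refine ⟨by positivity, ?_⟩
  calc 6 / Real.pi ^ 2 * (deriv χ.LFunction 1).re ^ 2 * ∏ p ∈ D.primeFactors, ((p : ℝ) / (p + 1))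
      ≤ 1 * ‖deriv χ.LFunction 1‖ ^ 2 * 1 := by gcongr
    _ = ‖deriv χ.LFunction 1‖ ^ 2 := by ring

/-- **u042 with the error that (16.15) transmits**: `Σ_n b₁(n)ϖ₂ⱼ(n)/n = (𝔞𝔢ⱼ/𝔭)(φ(D)/D)L′(1,χ) +
O((1+|L′(1,χ)|)³/𝓛)` (the printed u042, tex L4667, writes `O(1/𝓛⁴)` "by (16.15)", whose printed error is
`O(1/𝓛)`). NOT PRINTED; implied by the printed `Step16_u042` (`step16_u042R_of_u042`) and PROVED from
(16.15), the removal of `n₁ ∈ 𝔫(𝔮)`, u040 and the repaired u041 (`step16_u042R_of_repair`).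
[cite: Zhang2022LandauSiegel, §16 p.94] -/
def Step16_u042R : Prop :=
  ∃ C : ℝ, ForAllLarge fun D _ χ => AssumptionA D χ → ∀ j ∈ ({1, 2} : Finset ℕ),
    ‖(∑ n ∈ Finset.Ico 1 ⌈bigP D⌉₊, b1coef c' χ n * varpi2 c' χ j n / (n : ℂ)) -
        (frakA χ : ℂ) * frake j / frakp χ * ((Nat.totient D : ℂ) / (D : ℂ)) * deriv χ.LFunction 1‖ ≤
      C * (1 + ‖deriv χ.LFunction 1‖) ^ 3 * (ell D)⁻¹

/-- **(16.16) with the error that (16.15) transmits**: `𝒮₂ⱼ = 𝔞𝔢ⱼ(φ(D)/D)L′(1,χ) + O((1+|L′(1,χ)|)³/𝓛)`.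
NOT PRINTED; implied by the printed `Eq16_16` (`eq16_16R_of_eq16_16`) and PROVED from (16.13), `Step16_u042R`
and Lemma 16.1 (`eq16_16R_of`; Lemma 16.1 is sz-d57's theorem `AppendixA.lemma161_holds` and (16.13) follows
from it by `eq16_13_of_lemma161`, so `Eq16_16R` rests on `Step16_u042R` alone: `eq16_16R_of_lemma161`).
[cite: Zhang2022LandauSiegel, §16 (16.16) p.95] -/
def Eq16_16R : Prop :=
  ∃ C : ℝ, ForAllLarge fun D _ χ => AssumptionA D χ → ∀ j ∈ ({1, 2} : Finset ℕ),
    ‖calS2 c' χ j - (frakA χ : ℂ) * frake j * ((Nat.totient D : ℂ) / (D : ℂ)) * deriv χ.LFunction 1‖ ≤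
      C * (1 + ‖deriv χ.LFunction 1‖) ^ 3 * (ell D)⁻¹

/-- `C𝓛⁻ᵏ ≤ max(C,0)·(1+|L′|)³·𝓛⁻¹` for `𝓛 ≥ 1`, `k ≥ 1`. [folklore] -/
private theorem mul_inv_pow_le_cube_mul_inv {C L x : ℝ} (hL : 1 ≤ L) (hx : 0 ≤ x) {k : ℕ} (hk : 1 ≤ k) :
    C * (L ^ k)⁻¹ ≤ max C 0 * (1 + x) ^ 3 * L⁻¹ := by
  have hL0 : 0 < L := by linarith
  have hcube : 1 ≤ (1 + x) ^ 3 := one_le_pow₀ (le_add_of_nonneg_right hx)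
  calc C * (L ^ k)⁻¹ ≤ max C 0 * (L ^ k)⁻¹ :=
        mul_le_mul_of_nonneg_right (le_max_left _ _) (inv_nonneg.mpr (pow_nonneg hL0.le k))
    _ ≤ max C 0 * L⁻¹ := by
        refine mul_le_mul_of_nonneg_left (inv_anti₀ hL0 ?_) (le_max_right _ _)
        calc L = L ^ 1 := (pow_one _).symm
          _ ≤ L ^ k := pow_le_pow_right₀ hL hk
    _ = max C 0 * 1 * L⁻¹ := by ring
    _ ≤ max C 0 * (1 + x) ^ 3 * L⁻¹ :=
        mul_le_mul_of_nonneg_right (mul_le_mul_of_nonneg_left hcube (le_max_right _ _))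
          (inv_nonneg.mpr hL0.le)

/-- The printed u042 implies its transmitted form. [cite: Zhang2022LandauSiegel, §16 p.94] -/
theorem step16_u042R_of_u042 (h : Step16_u042 c') : Step16_u042R c' := by
  obtain ⟨C, D₀, hC⟩ := h
  refine ⟨max C 0, max D₀ ⌈Real.exp 1⌉₊, fun D _ χ hD hq hp hA j hj => ?_⟩
  have e := hC D χ (le_trans (le_max_left _ _) hD) hq hp hA j hj
  exact le_trans e (mul_inv_pow_le_cube_mul_inv
    (le_ell_of_ceil_exp_le (le_trans (le_max_right _ _) hD)) (norm_nonneg _) (by norm_num))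

/-- The printed (16.16) implies its transmitted form. [cite: Zhang2022LandauSiegel, §16 (16.16) p.95] -/
theorem eq16_16R_of_eq16_16 (h : Eq16_16 c') : Eq16_16R c' := by
  obtain ⟨C, D₀, hC⟩ := h
  refine ⟨max C 0, max D₀ ⌈Real.exp 1⌉₊, fun D _ χ hD hq hp hA j hj => ?_⟩
  have e := hC D χ (le_trans (le_max_left _ _) hD) hq hp hA j hj
  exact le_trans e (mul_inv_pow_le_cube_mul_inv
    (le_ell_of_ceil_exp_le (le_trans (le_max_right _ _) hD)) (norm_nonneg _) (by norm_num))

open scoped Classical in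
/-- **`Step16_u042R` from the displayed inputs** (PROVED, 0 facts): (16.15) [`Eq16_15`, `O(1/𝓛)`] +
"the constraint `n₁ ∈ 𝔫(𝔮)` can be removed" [`Inline16_nsetRemovable`] + u040 [`Step16_u040a/b`] + the
repaired u041 [`Step16_u041aR/bR`, via `sumLtT_eval_of_repair`] ⇒ `Σ_n b₁ϖ₂ⱼ/n =
(𝔞𝔢ⱼ/𝔭)(φ(D)/D)L′(1,χ) + O((1+|L′|)³/𝓛)` (`𝓛⁻⁴ ≤ 𝓛⁻¹`, `1 ≤ (1+|L′|)³`, `|𝔢_j| ≤ |𝔢₁| + |𝔢₂|`).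
[cite: Zhang2022LandauSiegel, §16 p.94] -/
theorem step16_u042R_of_repair (h15 : Eq16_15 c') (hrem : Inline16_nsetRemovable c')
    (h40a : Step16_u040a c') (h40b : Step16_u040b c') (h41a : Step16_u041aR c')
    (h41b : Step16_u041bR c') : Step16_u042R c' := by
  obtain ⟨C₁, D₁, h₁⟩ := h15
  obtain ⟨C₂, D₂, h₂⟩ := hrem
  obtain ⟨C₀, D₀, h₀⟩ := sumLtT_eval_of_repair c' h40a h40b h41a h41b
  set E : ℝ := ‖frake 1‖ + ‖frake 2‖ with hE
  refine ⟨max C₁ 0 + max C₂ 0 + E * max C₀ 0,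
    max (max D₁ D₂) (max D₀ ⌈Real.exp 1⌉₊), fun D _ χ hD hq hp hA j hj => ?_⟩
  have hD₁ : D₁ ≤ D := le_trans (le_trans (le_max_left _ _) (le_max_left _ _)) hD
  have hD₂ : D₂ ≤ D := le_trans (le_trans (le_max_right _ _) (le_max_left _ _)) hD
  have hD₀ : D₀ ≤ D := le_trans (le_trans (le_max_left _ _) (le_max_right _ _)) hD
  have hℓ1 : (1 : ℝ) ≤ ell D :=
    le_ell_of_ceil_exp_le (le_trans (le_trans (le_max_right _ _) (le_max_right _ _)) hD)
  have hℓ0 : 0 < ell D := by linarith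
  have hinv0 : 0 ≤ (ell D)⁻¹ := inv_nonneg.mpr hℓ0.le
  have e₁ := h₁ D χ hD₁ hq hp hA j hj
  have e₂ := h₂ D χ hD₂ hq hp hA j hj
  have e₀ := h₀ D χ hD₀ hq hp hA j hj
  have hEj : ‖frake j‖ ≤ E := norm_frake_le_of_mem hj
  set x : ℝ := ‖deriv χ.LFunction 1‖ with hx
  have hx0 : 0 ≤ x := norm_nonneg _
  set Y : ℝ := (1 + x) ^ 3 * (ell D)⁻¹ with hY
  have hcube : 1 ≤ (1 + x) ^ 3 := one_le_pow₀ (le_add_of_nonneg_right hx0)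
  have hY0 : 0 ≤ Y := by positivity
  have hinvY : (ell D)⁻¹ ≤ Y := by
    calc (ell D)⁻¹ = 1 * (ell D)⁻¹ := (one_mul _).symm
      _ ≤ Y := mul_le_mul_of_nonneg_right hcube hinv0
  have h4 : (ell D ^ 4)⁻¹ ≤ (ell D)⁻¹ := by
    refine inv_anti₀ hℓ0 ?_
    calc ell D = ell D ^ 1 := (pow_one _).symm
      _ ≤ ell D ^ 4 := pow_le_pow_right₀ hℓ1 (by norm_num)
  -- abbreviations
  set A := ∑ n ∈ Finset.Ico 1 ⌈bigP D⌉₊, b1coef c' χ n * varpi2 c' χ j n / (n : ℂ) with hA'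
  set F := ∑ n₁ ∈ (Finset.Ico 1 ⌈bigT D⌉₊).filter (fun n₁ => n₁ ∈ nset (frakq D)),
    varpi2 c' χ j n₁ * nuConvChi χ n₁ / (n₁ : ℂ) with hF
  set S := ∑ n ∈ Finset.Ico 1 ⌈bigT D⌉₊, varpi2 c' χ j n * nuConvChi χ n / (n : ℂ) with hS
  set M := (frakA χ : ℂ) / frakp χ * ((Nat.totient D : ℂ) / (D : ℂ)) * deriv χ.LFunction 1 with hM
  have hmain : (frakA χ : ℂ) * frake j / frakp χ * ((Nat.totient D : ℂ) / (D : ℂ)) *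
      deriv χ.LFunction 1 = frake j * M := by rw [hM]; ring
  rw [hmain]
  have hsplit : A - frake j * M = (A - frake j * F) + (frake j * F - frake j * S) +
      frake j * (S - M) := by ring
  have e₀' : ‖S - M‖ ≤ max C₀ 0 * Y := by
    refine le_trans e₀ ?_
    calc C₀ * (1 + x) ^ 3 * (ell D ^ 4)⁻¹ ≤ max C₀ 0 * (1 + x) ^ 3 * (ell D ^ 4)⁻¹ :=
          mul_le_mul_of_nonneg_right (mul_le_mul_of_nonneg_right (le_max_left _ _) (by positivity))
            (inv_nonneg.mpr (pow_nonneg hℓ0.le 4))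
      _ ≤ max C₀ 0 * (1 + x) ^ 3 * (ell D)⁻¹ := mul_le_mul_of_nonneg_left h4 (by positivity)
      _ = max C₀ 0 * Y := by rw [hY]; ring
  have t3 : ‖frake j * (S - M)‖ ≤ E * max C₀ 0 * Y := by
    rw [norm_mul]
    calc ‖frake j‖ * ‖S - M‖ ≤ E * (max C₀ 0 * Y) :=
          mul_le_mul hEj e₀' (norm_nonneg _) (le_trans (norm_nonneg _) hEj)
      _ = E * max C₀ 0 * Y := by ring
  have t1 : ‖A - frake j * F‖ ≤ max C₁ 0 * Y :=
    le_trans e₁ (le_trans (mul_le_mul_of_nonneg_right (le_max_left _ _) hinv0)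
      (mul_le_mul_of_nonneg_left hinvY (le_max_right _ _)))
  have t2 : ‖frake j * F - frake j * S‖ ≤ max C₂ 0 * Y :=
    le_trans e₂ (le_trans (mul_le_mul_of_nonneg_right (le_max_left _ _) hinv0)
      (mul_le_mul_of_nonneg_left hinvY (le_max_right _ _)))
  calc ‖A - frake j * M‖ = ‖(A - frake j * F) + (frake j * F - frake j * S) + frake j * (S - M)‖ := by
        rw [hsplit]
    _ ≤ ‖A - frake j * F‖ + ‖frake j * F - frake j * S‖ + ‖frake j * (S - M)‖ := by
        have u1 : ‖(A - frake j * F) + (frake j * F - frake j * S)‖ ≤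
            ‖A - frake j * F‖ + ‖frake j * F - frake j * S‖ := norm_add_le _ _
        have u2 := norm_add_le ((A - frake j * F) + (frake j * F - frake j * S)) (frake j * (S - M))
        linarith
    _ ≤ max C₁ 0 * Y + max C₂ 0 * Y + E * max C₀ 0 * Y := add_le_add (add_le_add t1 t2) t3
    _ = (max C₁ 0 + max C₂ 0 + E * max C₀ 0) * (1 + x) ^ 3 * (ell D)⁻¹ := by rw [hY]; ring

/-- **`Eq16_16R` from (16.13), `Step16_u042R` and Lemma 16.1** (PROVED, 0 facts): by the exact splitting
`calS2_sub_main_eq_of_eq16_13`, `𝒮₂ⱼ − 𝔞𝔢ⱼ(φ(D)/D)L′ = 𝓜₂*(1−β_j)·[Σ_n b₁ϖ₂ⱼ/n − (𝔞𝔢ⱼ/𝔭)(φ(D)/D)L′]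
+ (𝓜₂*(1−β_j) − 𝔭)·(𝔞𝔢ⱼ/𝔭)(φ(D)/D)L′ + 0`; the first bracket is `O((1+|L′|)³/𝓛)` (u042R) against
`|𝓜₂*(1−β_j)| ≤ |𝔭| + C𝓛⁻⁸ ≤ 4 + C` (`norm_frakp_le_four`, Lemma 16.1 at `s = 1 − β_j`, `|β_j| < 5α`,
`d = l = 1`), the second is `C𝓛⁻⁸ · 2𝔞|𝔢_j||L′| ≤ 2C|𝔢_j|(1+|L′|)³𝓛⁻⁸` (`|𝔭| ≥ 1/2`, `𝔞 ≤ |L′|²`), the third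
vanishes as `𝔭 ≠ 0`. No upper bound for `L′(1,χ)` is used. [cite: Zhang2022LandauSiegel, §16 (16.16) p.95] -/
theorem eq16_16R_of (h13 : Eq16_13 c') (h42 : Step16_u042R c') (h161 : Lemma161 c') :
    Eq16_16R c' := by
  obtain ⟨D₃, h₃⟩ := calS2_sub_main_eq_of_eq16_13 c' h13
  obtain ⟨C₄, D₄, h₄⟩ := h42
  obtain ⟨C_L, D_L, hL⟩ := h161
  set E : ℝ := ‖frake 1‖ + ‖frake 2‖ with hE
  set L₀ : ℝ := max 3 (Real.pi * (5 * |c'| + 1)) with hL₀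
  refine ⟨(4 + max C_L 0) * max C₄ 0 + max C_L 0 * (2 * E),
    max (max D₃ D₄) (max D_L ⌈Real.exp L₀⌉₊), fun D _ χ hD hq hp hA j hj => ?_⟩
  have hD₃ : D₃ ≤ D := le_trans (le_trans (le_max_left _ _) (le_max_left _ _)) hD
  have hD₄ : D₄ ≤ D := le_trans (le_trans (le_max_right _ _) (le_max_left _ _)) hD
  have hD_L : D_L ≤ D := le_trans (le_trans (le_max_left _ _) (le_max_right _ _)) hD
  have hℓL₀ : L₀ ≤ ell D :=
    le_ell_of_ceil_exp_le (le_trans (le_trans (le_max_right _ _) (le_max_right _ _)) hD)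
  have hℓ3 : 3 ≤ ell D := le_trans (le_max_left _ _) hℓL₀
  have hℓπ : Real.pi * (5 * |c'| + 1) ≤ ell D := le_trans (le_max_right _ _) hℓL₀
  have hℓ2 : 2 ≤ ell D := by linarith
  have hℓ1 : 1 ≤ ell D := by linarith
  have hℓ0 : 0 < ell D := by linarith
  have hinv0 : 0 ≤ (ell D)⁻¹ := inv_nonneg.mpr hℓ0.le
  -- the inputs at this `D`, `χ`, `j`
  have eId := h₃ D χ hD₃ hq hp hA j hj
  have e42 := h₄ D χ hD₄ hq hp hA j hj
  -- Lemma 16.1 at `s = 1 − β_j`, `d = l = 1`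
  have hdl : ((1 * 1 : ℕ) : ℝ) < bigP D / bigT D ^ 2 := by
    have hT : 0 < bigT D ^ 2 := pow_pos (Real.exp_pos _) 2
    rw [Nat.cast_mul, Nat.cast_one, mul_one, lt_div_iff₀ hT, one_mul]
    exact bigT_sq_lt_bigP hℓ2
  have hs : ‖(1 - betaJ c' D j) - 1‖ < 5 * alpha D := by
    rw [sub_sub_cancel_left, norm_neg]
    exact norm_betaJ_lt_five_alpha hℓ2 hℓπ hj
  have e161 : ‖calM2star c' χ (1 - betaJ c' D j) - frakp χ‖ ≤ C_L * (ell D ^ 8)⁻¹ :=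
    hL D χ hD_L hq hp hA 1 1 le_rfl le_rfl hdl (1 - betaJ c' D j) hs
  -- sizes
  have hp4 := norm_frakp_le_four χ hq
  have hp2 := half_le_norm_frakp χ hq
  have hpne : frakp χ ≠ 0 := by
    intro h0
    rw [h0, norm_zero] at hp2
    norm_num at hp2
  have h8' : 0 ≤ (ell D ^ 8)⁻¹ := inv_nonneg.mpr (pow_nonneg hℓ0.le 8)
  have h8 : (ell D ^ 8)⁻¹ ≤ 1 := inv_le_one_of_one_le₀ (one_le_pow₀ hℓ1)
  have h81 : (ell D ^ 8)⁻¹ ≤ (ell D)⁻¹ := by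
    refine inv_anti₀ hℓ0 ?_
    calc ell D = ell D ^ 1 := (pow_one _).symm
      _ ≤ ell D ^ 8 := pow_le_pow_right₀ hℓ1 (by norm_num)
  have hMle : ‖calM2star c' χ (1 - betaJ c' D j)‖ ≤ 4 + max C_L 0 := by
    have htri : ‖calM2star c' χ (1 - betaJ c' D j)‖ ≤
        ‖calM2star c' χ (1 - betaJ c' D j) - frakp χ‖ + ‖frakp χ‖ := norm_le_norm_sub_add _ _
    have : C_L * (ell D ^ 8)⁻¹ ≤ max C_L 0 := by
      calc C_L * (ell D ^ 8)⁻¹ ≤ max C_L 0 * (ell D ^ 8)⁻¹ :=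
            mul_le_mul_of_nonneg_right (le_max_left _ _) h8'
        _ ≤ max C_L 0 * 1 := mul_le_mul_of_nonneg_left h8 (le_max_right _ _)
        _ = max C_L 0 := mul_one _
    linarith
  obtain ⟨hA0, hAle⟩ := frakA_nonneg_and_le_norm_sq χ
  have hEj : ‖frake j‖ ≤ E := norm_frake_le_of_mem hj
  have hE0 : 0 ≤ E := le_trans (norm_nonneg _) hEj
  have hφ : ‖((Nat.totient D : ℂ) / (D : ℂ))‖ ≤ 1 := by
    rw [norm_div, Complex.norm_natCast, Complex.norm_natCast]
    have hD0 : (0 : ℝ) < D := by exact_mod_cast Nat.pos_of_ne_zero (NeZero.ne D)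
    rw [div_le_one hD0]
    exact_mod_cast Nat.totient_le D
  set x : ℝ := ‖deriv χ.LFunction 1‖ with hx
  have hx0 : 0 ≤ x := norm_nonneg _
  -- the main-term size: `‖(𝔞𝔢ⱼ/𝔭)(φ/D)L′‖ ≤ 2E(1+x)³`
  set Mj := (frakA χ : ℂ) * frake j / frakp χ * ((Nat.totient D : ℂ) / (D : ℂ)) *
    deriv χ.LFunction 1 with hMj
  have hMj_le : ‖Mj‖ ≤ 2 * E * (1 + x) ^ 3 := by
    have h1 : ‖(frakA χ : ℂ) * frake j / frakp χ‖ ≤ x ^ 2 * E * 2 := by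
      rw [norm_div, norm_mul, Complex.norm_real, Real.norm_of_nonneg hA0, div_le_iff₀ (by linarith)]
      have : frakA χ * ‖frake j‖ ≤ x ^ 2 * E := mul_le_mul hAle hEj (norm_nonneg _) (sq_nonneg _)
      nlinarith [norm_nonneg (frake j), mul_nonneg hA0 (norm_nonneg (frake j)),
        mul_nonneg (sq_nonneg x) hE0]
    have hx3 : x ^ 2 * x ≤ (1 + x) ^ 3 := by nlinarith
    calc ‖Mj‖ = ‖(frakA χ : ℂ) * frake j / frakp χ‖ * ‖((Nat.totient D : ℂ) / (D : ℂ))‖ * x := by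
          rw [hMj, norm_mul, norm_mul]
      _ ≤ (x ^ 2 * E * 2) * 1 * x := by
          refine mul_le_mul_of_nonneg_right (mul_le_mul h1 hφ (norm_nonneg _) (by positivity)) hx0
      _ = 2 * E * (x ^ 2 * x) := by ring
      _ ≤ 2 * E * (1 + x) ^ 3 := mul_le_mul_of_nonneg_left hx3 (by positivity)
  -- assemble
  rw [eId]
  have hzero : frakp χ / frakp χ - 1 = 0 := by rw [div_self hpne, sub_self]
  rw [hzero, zero_mul, add_zero]
  have t1 : ‖calM2star c' χ (1 - betaJ c' D j) *
      ((∑ n ∈ Finset.Ico 1 ⌈bigP D⌉₊, b1coef c' χ n * varpi2 c' χ j n / (n : ℂ)) - Mj)‖ ≤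
      (4 + max C_L 0) * (max C₄ 0 * (1 + x) ^ 3 * (ell D)⁻¹) := by
    rw [norm_mul]
    refine mul_le_mul hMle (le_trans e42 ?_) (norm_nonneg _) (by positivity)
    exact mul_le_mul_of_nonneg_right (mul_le_mul_of_nonneg_right (le_max_left _ _) (by positivity))
      hinv0
  have t2 : ‖(calM2star c' χ (1 - betaJ c' D j) - frakp χ) * Mj‖ ≤
      max C_L 0 * (2 * E) * (1 + x) ^ 3 * (ell D)⁻¹ := by
    rw [norm_mul]
    calc ‖calM2star c' χ (1 - betaJ c' D j) - frakp χ‖ * ‖Mj‖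
        ≤ (max C_L 0 * (ell D ^ 8)⁻¹) * (2 * E * (1 + x) ^ 3) :=
          mul_le_mul (le_trans e161 (mul_le_mul_of_nonneg_right (le_max_left _ _) h8')) hMj_le
            (norm_nonneg _) (by positivity)
      _ = max C_L 0 * (2 * E) * (1 + x) ^ 3 * (ell D ^ 8)⁻¹ := by ring
      _ ≤ max C_L 0 * (2 * E) * (1 + x) ^ 3 * (ell D)⁻¹ :=
          mul_le_mul_of_nonneg_left h81 (by positivity)
  calc ‖calM2star c' χ (1 - betaJ c' D j) *
          ((∑ n ∈ Finset.Ico 1 ⌈bigP D⌉₊, b1coef c' χ n * varpi2 c' χ j n / (n : ℂ)) - Mj) +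
        (calM2star c' χ (1 - betaJ c' D j) - frakp χ) * Mj‖
      ≤ (4 + max C_L 0) * (max C₄ 0 * (1 + x) ^ 3 * (ell D)⁻¹) +
          max C_L 0 * (2 * E) * (1 + x) ^ 3 * (ell D)⁻¹ :=
        le_trans (norm_add_le _ _) (add_le_add t1 t2)
    _ = ((4 + max C_L 0) * max C₄ 0 + max C_L 0 * (2 * E)) * (1 + x) ^ 3 * (ell D)⁻¹ := by ring

/-- **Lemma 16.1 ⇒ ((16.16)R ⇐ u042R)**, (16.13) being itself a consequence of Lemma 16.1
(`eq16_13_of_lemma161`). [cite: Zhang2022LandauSiegel, §16 (16.16) p.95] -/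
theorem eq16_16R_of_lemma161 (h161 : Lemma161 c') (h42 : Step16_u042R c') : Eq16_16R c' :=
  eq16_16R_of c' (eq16_13_of_lemma161 c' h161) h42 h161

/-- **The §16B chain below (16.16), assembled** (PROVED, 0 facts): Lemma 16.1 [PROVED, sz-d57] + (16.15)
+ the `𝔫(𝔮)`-removal + u040 + the repaired u041 ⇒ (16.16) in its transmitted form `Eq16_16R`.
[cite: Zhang2022LandauSiegel, §16 (16.13)–(16.16) pp.93–95] -/
theorem eq16_16R_of_leaves (h161 : Lemma161 c') (h15 : Eq16_15 c') (hrem : Inline16_nsetRemovable c')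
    (h40a : Step16_u040a c') (h40b : Step16_u040b c') (h41a : Step16_u041aR c')
    (h41b : Step16_u041bR c') : Eq16_16R c' :=
  eq16_16R_of_lemma161 c' h161 (step16_u042R_of_repair c' h15 hrem h40a h40b h41a h41b)

end Literature.NumberTheory.LFunctions.Zhang2022.Typed.Section16B
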